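import Literature.Barriers.CriticalPhenomena.PlaquetteWalkHoleRootKillForcedZeros
import Literature.Barriers.CriticalPhenomena.PlaquetteWalkHoleRootConfinement
import Literature.Probability.RandomPlanarGeometry.YangBaxterSAWHexDictionaryWinding
import Literature.Probability.RandomPlanarGeometry.YangBaxterSAWHexDictionarySecondAngle
import HarnessLib

/-!
# Barrier catalogue (SAWScalingLimit): the STRUCTURAL UNDER-ROUTE `w₂`-KILL at the far cell of a hole root — a
missing corner cell two rows below the far cell's western neighbour forces every wound under-walk through a double
`(π − θ)`-corner rhombus, with no walk enumerated

Companion of `PlaquetteWalkHoleRootKillForcedZeros` (the KILL-FORCED ZEROS of the Yang–Baxter vertex functional at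
the far cell `farW w = (w.1 − 2, w.2)` of a hole root in the `W`-normalisation: root `a = w.side W`, hole
`holeFaceW w = (w.1 − 1, w.2) ∉ D`). There the two «honeycomb kills» — EVERY wound class-`B2a` walk of one route is
`w₂`-marked (passes some rhombus other than the far cell twice through its two `(π − θ)`-corners, weight `w₂(π/3) = 0`),
resp. `w₁`-marked at the dual angle — are HYPOTHESES, which the venture lane discharged by exact enumeration, domain by
domain. This file proves the under-route `w₂`-kill as a THEOREM SCHEMA from four absent cells:

* the hole `holeFaceW w ∉ D`;
* the KILL CELL `killSW w = (w.1 − 3, w.2 − 2) ∉ D` — the cell `K_S2` two rows below the far cell's western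
  neighbour `farWW w = (w.1 − 3, w.2)` of the lane's corner-kill table;
* the cell `pocketSWW w = (w.1 − 4, w.2 − 1) ∉ D` west of the POCKET CELL `pocketSW w = (w.1 − 3, w.2 − 1)`;
* the bottom line of the far cell's row is uncrossable west of the pocket cell: for every column `x ≤ w.1 − 4` one of
  `(x, w.2)`, `(x, w.2 − 1)` is absent (vacuous when the far cell's western neighbour is a boundary column).

## Results (axioms `propext`, `Classical.choice`, `Quot.sound`)

* §1 `ΩG.exists_nth_eq_pocketSW_side_N_of_AJ_ne_zero` — **the crossing lemma**: a class-`B2a` walk at the far cell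
  with first side `S` whose excursion polygon winds around the root midpoint (`AJ ≠ 0`) crosses the top side of the
  pocket cell at an interior index after its arc in the far cell. Proof: the tree's WINDING PARITY LAW at the root
  (`ΩG.AJ_root_ne_zero_iff_odd_rayCountAt` of `YangBaxterSAWExcursionJordan`, base edge `w.side W` itself, ray running
  WEST along the bottom line of the row: the bottom sides of the hole, of the far cell, of `farWW w`, …) gives an odd
  number of crossings; the hole's bottom side and the edges beyond column `w.1 − 4` are not doors
  (`YBWalk.door_nth`), the far cell's bottom side is the first side (crossed once, by the prefix), so a crossing of
  `farWW.S = pocketSW.N` exists.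
* §2 `ΩG.exists_excursion_arc_farSW_W_of_AJ_ne_zero` — **the pocket lemma**: that crossing arc either comes down into
  the pocket cell and leaves it eastwards (its `S` and `W` doors are shut), or goes up out of it having entered from
  the east; either way the excursion has an arc in the cell BELOW the far cell, `farSW w`, with that cell's `W` side as
  an end.
* §3 `ΩG.prefix_arc_farSW` — the arc before the first hit lies in `farSW w` and exits through `N` (first side `S`).
* §4 ★★ `ΩG.kindsIn_farSW_eq_of_AJ_ne_zero` — two arcs in `farSW w`: neither is straight and their ends are disjoint
  (`YBWalk.not_straight_of_two_arcs`), so the prefix arc is `{E, N}` and the excursion arc `{S, W}`: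
  `kindsIn (farSW w) = [coCorner, coCorner]` (`YBWalk.kindsIn_eq_coCorner_coCorner`, a counting form of the Fig. 1
  shape theorem); `ΩG.not_W2FreeOff_farW_of_AJ_ne_zero`.
* §5 ★★★ `ΩG.not_W2FreeOff_farW_of_wound_under` — **THE STRUCTURAL UNDER-ROUTE `w₂`-KILL** for every WOUND walk
  (`WE ≠ excursionWinding`, either orientation: the reversed companion has the same kinds off the far cell,
  `ΩG.kindsIn_rev_perm`); `ΩG.under_killed_of_killSW` (the hypothesis `hS`/`hS₂` of the companion file's §1/§4, verbatim,
  discharged); `ΩG.sum_routeMassW_S_pi_div_three_eq_zero_of_killSW` (`M_S(π/3) = 0`).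
* §6 ★★★ `im_vertexFunctional_printed_farCellW_pi_div_three_pos_of_killSW` (`Im VF(π/3) > 0` from the four absent
  cells and ONE `w₂`-free wound over-walk), ★★★ `vertexFunctional_printed_farCellW_exists_eq_zero_Ioo_of_killSW_of_over_killed`
  (the kill-forced zero in `(π/3, 2π/3)` with the under-kill discharged; the over-route `w₁`-kill at `2π/3` and the two
  free witnesses remain hypotheses), ★★ `…_of_killSW_of_im_neg` (one structural kill and one sign).
* §7 (edition 2) ★★★ `ΩG.kindsIn_farNW_eq_of_wound_over` / `ΩG.not_W1FreeOff_farW_of_wound_over` /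
  `ΩG.over_killed_of_killNW` — **THE STRUCTURAL OVER-ROUTE `w₁`-KILL**, the row-mirror twin: northern kill cell
  `killNW w = (w.1 − 3, w.2 + 2)` (`K_N1`), the cell `pocketNWW w = (w.1 − 4, w.2 + 1)` absent, the TOP line of the row
  uncrossable beyond ⇒ every wound over-walk has `kindsIn (farNW w) = [corner, corner]`. Proof by TRANSPORT: the
  reflection in the root row (`PlaquetteWalkMirrorDuality.MirrorWalk.mirrorWalk`; `ΩG.mirrorFar`) fixes root, hole and
  far cell, maps `D` onto `rowMirrorDom w D`, over-walks to under-walks (`mirrorFar_firstSideG`, `mirrorFar_z1`,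
  `mirrorFar_isB2a` via `YangBaxterSAWHexDictionaryWinding`'s `*_of_mids_mirror` lemmas), and a walk wound at `θ` to a
  walk wound at `π − θ` (`mirrorFar_WE`: `WE'(θ) = −WE(π − θ)` by `YangBaxterSAWHexDictionarySecondAngle`'s
  `sum_map_arcTurnOf_mirrorArc`; `excursionWinding_mirrorSide`); §5 applies in the reflected domain and the double
  co-corner below the far cell reflects to a double corner above it (`arcKind_mirrorSide`, `YBWalk.arcKind_mem_kindsIn`,
  `YBWalk.kindsIn_eq_corner_corner`). `ΩG.sum_routeMassW_N_two_pi_div_three_eq_zero_of_killNW` (`M_N(2π/3) = 0`).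
* §8 (edition 2) ★★★ `im_vertexFunctional_printed_farCellW_two_pi_div_three_neg_of_killNW` (`Im VF(2π/3) < 0` from the
  northern geometry and ONE `w₁`-free wound under-walk), ★★★★
  `vertexFunctional_printed_farCellW_exists_eq_zero_Ioo_of_killSW_of_killNW` — THE KILL-FORCED ZERO WITH BOTH KILLS
  STRUCTURAL: the eight absent cells / two line conditions and the two free witnesses force an exact zero of the
  Yang–Baxter vertex functional in `(π/3, 2π/3)` (instance in the lane's data: the row-symmetric
  `5×5 ∖ {(2,2),(0,0),(0,4)}`, root `W` of `(3,2)` — over-walks 64 wound / 28 `w₂`-free / 0 `w₁`-free, under-walks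
  64 / 0 / 28 — until now «doubly explained» by the mirror zero at `π/2` and by enumerated kills; the kills are now
  theorems); ★★ `…_of_im_pos_of_killNW` (one structural upper kill and one sign).
* §9 (edition 3) THE DEAD-END COLUMN VARIANT — the lane's boxes with the hole in column `3`, where the pocket cell HAS
  a western door (boundary column `w.1 − 4 = 0` alive): ★ `ΩG.exists_nth_eq_pocket_sides_of_AJ_ne_zero` (the crossing
  lemma WITH PARITY: the odd crossing is the top side of the pocket or of the cell west of it, and NOT BOTH —
  `Finset.card_le_card_of_injOn` into the two edges), `ΩG.fc_ne_colWbot` (the bottom cell `(w.1 − 4, w.2 − 2)` of that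
  column is a dead end once `K_S2` is gone: no arc), ★ `ΩG.exists_excursion_arc_farSW_W_of_AJ_ne_zero_deadEnd` (the pocket
  lemma: a crossing at the western cell runs east through the pocket into the cell below the far cell, every other
  continuation being a shut door, the dead end, or a SECOND crossing), `ΩG.kindsIn_farSW_eq_of_excursion_arc_W` (§4's
  last step isolated), ★★★ `ΩG.kindsIn_farSW_eq_of_wound_under_deadEnd` / `ΩG.under_killed_of_killSW_deadEnd` and the
  mirror twins ★★★ `ΩG.kindsIn_farNW_eq_of_wound_over_deadEnd` / `ΩG.over_killed_of_killNW_deadEnd` (hypotheses: kill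
  cell, column `w.1 − 5` absent on two rows, `(w.1 − 4, w.2 ∓ 3)` absent, line uncrossable for `x ≤ w.1 − 5`; the cells of
  column `w.1 − 4` free), ★★★★ `vertexFunctional_printed_farCellW_exists_eq_zero_Ioo_of_kills_deadEnd` (both kills
  structural in this geometry: covers the companion file's asymmetric instance `6×5 ∖ {(3,2),(1,0),(1,4),(0,1)}`, zero in
  `[0.50557π, 0.50570π]`, and `6×5 ∖ {(3,2),(1,0),(1,4)}`, up to the two free witnesses),
  `im_vertexFunctional_printed_farCellW_pi_div_three_pos_of_killSW_deadEnd` / `…two_pi_div_three_neg_of_killNW_deadEnd`.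
* §10 (edition 4) THE EAST PAIR FOR DIRECT ROUTES — the cells east of the ROOT PLAQUETTE: ★ `ΩG.exists_nth_eq_east_sides_of_AJ_ne_zero`
  (the eastern crossing lemma with parity: root ray running EAST, presentation `(holeFaceW w, E)` of the root edge; the
  odd crossing is the bottom side of `w` or the top side of the eastern pocket `pocketSE w = (w.1 + 1, w.2 − 1)`, not
  both), ★★ `ΩG.kindsIn_rootS_eq_of_AJ_ne_zero_direct` / ★★★ `ΩG.kindsIn_rootS_eq_of_wound_direct` — eastern kill cell
  `killSE w = K_S1 = (w.1 + 1, w.2 − 2)` and `pocketSEE w = (w.1 + 2, w.2 − 1)` absent, bottom line uncrossable for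
  `x ≥ w.1 + 2` ⇒ every wound class-`B2a` walk at the far cell whose FIRST ARC LEAVES THE ROOT PLAQUETTE SOUTHWARDS
  (`nth 1 = w.side S`, the «direct» under route) has `kindsIn (rootS w) = [corner, corner]` (prefix arc `{N, W}` and
  excursion arc `{S, E}` below the root plaquette); the mirror twin ★★★ `ΩG.kindsIn_rootN_eq_of_wound_direct`
  (`K_N2 = (w.1 + 1, w.2 + 2)`, first arc northwards ⇒ `kindsIn (rootN w) = [coCorner, coCorner]`);
  `ΩG.under_w1_killed_of_killSE_of_direct` / `ΩG.over_w2_killed_of_killNE_of_direct` (the companion file's `hS₁` / `hN₂`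
  GIVEN directness of the wound walks of the route — in the lane's data every wound under-walk of the single-hole boxes
  is direct: `5×5 ∖ {(2,2),(4,0)}` 128/128, `6×6 ∖ {(3,2),(5,0)}` 64 192/64 192, kit j264974; the non-direct case needs
  a separation argument for the prefix loop, not typed), ★★★ `…exists_eq_zero_Ioo_of_killNE_of_killSE_of_direct` (the
  companion file's §4′ with both universal kills reduced to directness; the lane's `6×5 ∖ {(3,2),(5,0),(5,4),(0,0)}`).
* §11 (edition 5) THE EAST PAIR BEYOND DIRECT ROUTES: ★★ `ΩG.kindsIn_root_eq_of_cross_root_S` ((a) an excursion through the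
  root plaquette's bottom side forces the first arc NORTH and doubles the ROOT PLAQUETTE: `kindsIn w = [corner, corner]`, no
  hypothesis beyond the hole), ★★ `ΩG.kindsIn_rootE_eq_of_AJ_ne_zero_east` ((b) first arc EAST ⇒ `rootE w = (w.1 + 1, w.2)`
  doubles, no kill cell), ★★★ `ΩG.not_W1FreeOff_farW_of_wound_not_north` (K_S1 geometry: every wound walk whose first arc does
  NOT leave `w` northwards is `w₁`-marked), its mirror ★★★ `ΩG.not_W2FreeOff_farW_of_wound_not_south` (K_N2; via the generic
  transfer `ΩG.kindsIn_eq_coCorner_of_mirrorFar_corner`), `ΩG.under_w1_killed_of_killSE_of_not_north` /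
  `ΩG.over_w2_killed_of_killNE_of_not_south`, ★★★ `…exists_eq_zero_Ioo_of_killNE_of_killSE`. OPEN after this edition,
  exactly: a wound under-walk leaving `w` NORTHWARDS (its excursion then avoids `w`, by (a)) — excluded on paper by a Jordan
  separation for the prefix loop (HOME `DESIGN-next-g24.md` §2–§3), not typed; in the lane's boxes it does not occur.

Scope (venture lane «pcv-sawmu», HOME `FINDING-YB-KILL-FORCED-ZEROS.md` §2/§5/§8, `DESIGN-next-g23.md` §2; seat
b-step0 gen 24). The schema covers the lane's kill instances whose pocket cell has no western neighbour:
`5×5 ∖ {(2,2),(0,0)}` (root `W` of `(3,2)`: kill cell `(0,0)`, pocket cell `(0,1)`; data 128/128 wound under-walks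
double-visit `(1,1)` through its `(π−θ)`-corners), `6×6 ∖ {(2,3),(0,1)}` (62 720/62 720 at `(1,2)`), the other
single-hole boxes of the lane's corner-kill census with the hole in column `2` and `K_S2` removed (`5×7`, `5×6`, `6×6`,
`7×5`), and the asymmetric kill-forced-zero domain `6×5 ∖ {(3,2),(1,0),(1,4),(0,1)}` of the companion
file's docstring (kill cell `(1,0)`, `(0,1)` absent west of the pocket cell `(1,1)`, row condition met by `(0,1) ∉ D`);
it does NOT cover kills whose pocket cell has a live western door (`6×5 ∖ {(3,2),(1,0)}`, `7×6 ∖ {(3,2),(1,0)}` — there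
the lane's data show the same double co-corner, by a pocket argument one column longer, not typed here). The three
mirror/column twins of the corner-kill table (`K_N1`: over route `w₁`-killed; `K_S1`, `K_N2` east of the root
plaquette) are not typed here. Not in print (the printed sources treat simply connected domains); elementary given the
tree's parity law and the companion files.

References: A. Glazman, I. Manolescu, arXiv:1708.00395v3, §1 (Fig. 1, Fig. 2: «if θ = π/3, then w₂ = 0») and
Lemma 2.1 [GlazmanManolescu2019]; A. Glazman, Electron. Commun. Probab. 20 (2015) no. 86, Lemma 3.1, proof pp. 6–7
(the classes of walks through a rhombus) [Glazman2015WeightedSAW]; R. Courant, H. Robbins, *What is Mathematics?*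
(1941/1958), Ch. V Appendix §2 (the even–odd rule for polygons) [CourantRobbins1958]; H. Duminil-Copin, S. Smirnov,
Ann. of Math. 175 (2012), Lemma 1 [DuminilCopinSmirnov2012].
-/

noncomputable section

namespace Literature.Probability.RandomPlanarGeometry.SAW.YangBaxter

open Real

open private fc_fh rev_snd_arcs from Literature.Probability.RandomPlanarGeometry.YangBaxterSAWGeneralDomain

/-! ## §0 The cells south-west of the far cell -/

section Cells

variable (w : Face)

/-- The POCKET CELL `(w.1 − 3, w.2 − 1)`: west of the cell below the far cell, south of the far cell's western
neighbour `farWW w`. [cite: GlazmanManolescu2019, §1 (the lattice of rhombi and its mid-edges)] -/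
def pocketSW : Face := (w.1 - 3, w.2 - 1)

/-- The KILL CELL `K_S2 = (w.1 − 3, w.2 − 2)` below the pocket cell (two rows below the far cell's western neighbour).
[cite: GlazmanManolescu2019, §1 (the lattice of rhombi and its mid-edges)] -/
def killSW : Face := (w.1 - 3, w.2 - 2)

/-- The cell `(w.1 − 4, w.2 − 1)` west of the pocket cell. [cite: GlazmanManolescu2019, §1 (the lattice of rhombi and its mid-edges)] -/
def pocketSWW : Face := (w.1 - 4, w.2 - 1)

/-- `farWW.S = pocketSW.N`. [cite: GlazmanManolescu2019, §1 (the lattice of rhombi and its mid-edges)] -/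
theorem pocketSW_side_N : (pocketSW w).side .N = (farWW w).side .S := by
  obtain ⟨k, j⟩ := w; simp [pocketSW, farWW, Face.side]

/-- `pocketSW.E = farSW.W`. [cite: GlazmanManolescu2019, §1 (the lattice of rhombi and its mid-edges)] -/
theorem pocketSW_side_E : (pocketSW w).side .E = (farSW w).side .W := by
  obtain ⟨k, j⟩ := w; simp [pocketSW, farSW, Face.side]; ring

/-- The pocket cell's `N` side as a lattice mid-edge. [cite: GlazmanManolescu2019, §1 (the lattice of rhombi and its mid-edges)] -/
theorem pocketSW_side_N_eq : (pocketSW w).side .N = MidEdge.slant (w.1 - 3) w.2 := by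
  obtain ⟨k, j⟩ := w; simp [pocketSW, Face.side]

/-- The faces of the pocket cell's `S` side: the kill cell and the pocket cell. [cite: GlazmanManolescu2019, §1 (the lattice of rhombi and its mid-edges)] -/
theorem pocketSW_side_S_faces : ((pocketSW w).side .S).faces = (killSW w, pocketSW w) := by
  obtain ⟨k, j⟩ := w; simp [pocketSW, killSW, Face.side, MidEdge.faces]; ring

/-- The faces of the pocket cell's `W` side. [cite: GlazmanManolescu2019, §1 (the lattice of rhombi and its mid-edges)] -/
theorem pocketSW_side_W_faces : ((pocketSW w).side .W).faces = (pocketSWW w, pocketSW w) := by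
  obtain ⟨k, j⟩ := w; simp [pocketSW, pocketSWW, Face.side, MidEdge.faces]; ring

/-- The faces of the pocket cell's `E` side: the pocket cell and the cell below the far cell. [cite: GlazmanManolescu2019, §1 (the lattice of rhombi and its mid-edges)] -/
theorem pocketSW_side_E_faces : ((pocketSW w).side .E).faces = (pocketSW w, farSW w) := by
  obtain ⟨k, j⟩ := w; simp [pocketSW, farSW, Face.side, MidEdge.faces]; ring

/-- The faces of the pocket cell's `N` side: the pocket cell and the far cell's western neighbour. [cite: GlazmanManolescu2019, §1 (the lattice of rhombi and its mid-edges)] -/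
theorem pocketSW_side_N_faces : ((pocketSW w).side .N).faces = (pocketSW w, farWW w) := by
  obtain ⟨k, j⟩ := w; simp [pocketSW, farWW, Face.side, MidEdge.faces]

/-- The faces of the `N` side of the cell below the far cell: that cell and the far cell. [cite: GlazmanManolescu2019, §1 (the lattice of rhombi and its mid-edges)] -/
theorem farSW_side_N_faces : ((farSW w).side .N).faces = (farSW w, farW w) := by
  obtain ⟨k, j⟩ := w; simp [farSW, farW, Face.side, MidEdge.faces]

/-- The ray behind the root `w.side W`, running west: its `m`-th edge is the bottom side of the cell `m + 1` columns
west of `w`. [cite: CourantRobbins1958, Ch. V Appendix §2 (The Jordan Curve Theorem for Polygons: the even–odd rule)] -/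
theorem rayMid_W_eq (m : ℕ) : rayMid w .W m = MidEdge.slant (w.1 - 1 - m) w.2 := by
  simp [rayMid, rayCell, raySide, Face.side]

/-- A side of the far cell on the bottom line of its row is its `S` side. [cite: GlazmanManolescu2019, §1 (the lattice of rhombi and its mid-edges)] -/
theorem farW_side_eq_slant_row {s : Side} {x : ℤ} (h : (farW w).side s = MidEdge.slant x w.2) : s = .S ∧ x = w.1 - 2 := by
  obtain ⟨k, j⟩ := w
  cases s
  · simp [farW, Face.side] at h
  · simp [farW, Face.side] at h
  · simp only [farW, Face.side, MidEdge.slant.injEq] at h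
    exact ⟨rfl, by omega⟩
  · simp only [farW, Face.side, MidEdge.slant.injEq] at h
    omega

/-- The sides of the far cell are not the pocket cell's `N` side. [cite: GlazmanManolescu2019, §1 (the lattice of rhombi and its mid-edges)] -/
theorem farW_side_ne_pocketSW_side_N (s : Side) : (farW w).side s ≠ (pocketSW w).side .N := by
  rw [pocketSW_side_N_eq]
  intro h
  have := (farW_side_eq_slant_row w h).2
  omega

/-- The root is not the `N` side of the cell below the far cell. [cite: GlazmanManolescu2019, §1 (the lattice of rhombi and its mid-edges)] -/
theorem root_ne_farSW_side_N : w.side .W ≠ (farSW w).side .N := by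
  obtain ⟨k, j⟩ := w; simp [farSW, Face.side]

end Cells

/-! ## §1 A wound under-walk crosses the top side of the pocket cell -/

namespace ΩG

variable {D : Set Face} {w : Face}

/-- ★ **The crossing lemma.** At the far cell of a hole root (`W`-normalisation, hole `holeFaceW w ∉ D`), suppose the
bottom line of the far cell's row cannot be crossed further west than the far cell's western neighbour: for every
column `x ≤ w.1 − 4` one of the two cells `(x, w.2)`, `(x, w.2 − 1)` is absent. Then every class-`B2a` walk at the
far cell that entered it from `S` and whose excursion polygon winds around the root midpoint crosses the TOP SIDE OF
THE POCKET CELL `(w.1 − 3, w.2 − 1)` at some interior index after its arc in the far cell: the polygon crosses the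
lattice half-line running west from the root along that bottom line an odd number of times (even–odd rule), and
the only crossable edge of that half-line is the pocket cell's top side (the hole's bottom side and the edges beyond
column `w.1 − 4` are not doors, the far cell's bottom side is the walk's first side).
[cite: CourantRobbins1958, Ch. V Appendix §2 (The Jordan Curve Theorem for Polygons: the even–odd rule)]
[cite: Glazman2015WeightedSAW, Lemma 3.1 (proof, pp. 6–7: the classes of walks through a rhombus)] -/
theorem exists_nth_eq_pocketSW_side_N_of_AJ_ne_zero (hh : holeFaceW w ∉ D)
    (hrow : ∀ x : ℤ, x ≤ w.1 - 4 → (x, w.2) ∉ D ∨ (x, w.2 - 1) ∉ D)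
    (ω : ΩG D (w.side .W) (farW w)) (hr : RootedFace D (w.side .W) (farW w)) (h : ω.IsB2a)
    (hS : ω.2.firstSideG = .S) (hA : ω.AJ hr h (toC (midPt (w.side .W))) ≠ 0) :
    ∃ i, ω.2.firstHitG < i ∧ i + 1 < ω.2.arcs.length ∧ ω.2.nth (i + 1) = (pocketSW w).side .N := by
  classical
  have hodd := (ω.AJ_root_ne_zero_iff_odd_rayCountAt (hr := hr) h (b := w) (τ := .W) rfl).1 hA
  have hpos : 0 < ω.rayCountAt hr h w .W := hodd.pos
  unfold ΩG.rayCountAt at hpos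
  obtain ⟨j, hj⟩ := Finset.card_pos.1 hpos
  simp only [Finset.mem_filter, Finset.mem_range] at hj
  obtain ⟨hjM, m, hm⟩ := hj
  have hF := ω.fh_lt h
  have hjn : ω.2.firstHitG + j < ω.2.arcs.length := by unfold ΩG.Mv at hjM; omega
  -- the exit edge of slot `j` is the mid-edge `nth (F + j + 1)`
  have hexit : (ω.jFace h j).side (ω.jOut hr h j) = ω.2.nth (ω.2.firstHitG + j + 1) := by
    by_cases hj0 : j = 0
    · subst hj0
      simp only [ΩG.jFace, ΩG.jOut, Nat.add_zero]
      exact (ω.2.exitSide_specG hr hF).1.symm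
    · simp only [ΩG.jFace, ΩG.jOut, if_neg hj0]
      exact (ω.2.side_sIn_nth hjn).2.1
  rw [hexit, rayMid_W_eq] at hm
  set i := ω.2.firstHitG + j with hi
  -- the endpoint of the walk is a side of the far cell, never on the line west of the far cell except at `m = 1`
  have hlast : i + 1 = ω.2.arcs.length → m = 1 := by
    intro e
    rw [e, ω.2.nth_length] at hm
    have := (farW_side_eq_slant_row w hm).2
    omega
  -- `m = 1` is the first side, crossed at the first hit only
  have hm1 : m ≠ 1 := by
    rintro rfl
    have e : ω.2.nth (i + 1) = ω.2.nth ω.2.firstHitG := by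
      rw [hm, ω.2.nth_firstHitG, hS]
      obtain ⟨k, l⟩ := w
      simp only [farW, Face.side, MidEdge.slant.injEq, and_true]
      ring
    have := ω.2.nth_inj (by omega) hF.le e
    omega
  have hlt : i + 1 < ω.2.arcs.length := by
    rcases Nat.lt_or_ge (i + 1) ω.2.arcs.length with hl | hl
    · exact hl
    · exact absurd (hlast (by omega)) hm1
  -- interior edges of the walk are doors
  have hdoor := ω.2.door_nth (j := i + 1) (by omega) hlt
  rw [hm] at hdoor
  simp only [MidEdge.faces] at hdoor
  obtain rfl | rfl | rfl | hm3 : m = 0 ∨ m = 1 ∨ m = 2 ∨ 3 ≤ m := by omega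
  · -- the hole's bottom side is not a door
    refine absurd ?_ hh
    have e : holeFaceW w = (w.1 - 1 - ((0 : ℕ) : ℤ), w.2) := by simp [holeFaceW]
    rw [e]; exact hdoor.2
  · exact absurd rfl hm1
  · refine ⟨i, ?_, hlt, by rw [hm, pocketSW_side_N_eq]; push_cast; ring_nf⟩
    -- not the exit edge of the arc in the far cell
    by_contra hle
    have ei : i = ω.2.firstHitG := by omega
    have e2 := (ω.2.exitSide_specG hr hF).1
    rw [← ei, hm] at e2
    have := (farW_side_eq_slant_row w e2.symm).2
    push_cast at this
    omega
  · -- beyond column `w.1 - 4` the line is not crossable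
    rcases hrow (w.1 - 1 - m) (by omega) with hx | hx
    · exact absurd hdoor.2 hx
    · exact absurd hdoor.1 hx


/-! ## §2 The pocket: the crossing arc continues into the cell below the far cell through its `W` side -/

/-- No side of the far cell is a side of the pocket cell (the two cells are diagonal neighbours). [cite: GlazmanManolescu2019, §1 (the lattice of rhombi and its mid-edges)] -/
theorem farW_side_ne_pocketSW_side (w : Face) (s t : Side) : (farW w).side s ≠ (pocketSW w).side t := by
  obtain ⟨k, j⟩ := w
  cases s <;> cases t <;> simp only [farW, pocketSW, Face.side, ne_eq, MidEdge.vert.injEq, MidEdge.slant.injEq,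
    reduceCtorEq, not_false_eq_true, not_and] <;> omega

/-- The far cell is not the cell below it. [cite: GlazmanManolescu2019, §1 (the lattice of rhombi and its mid-edges)] -/
theorem farSW_ne_farW (w : Face) : farSW w ≠ farW w := by
  obtain ⟨k, j⟩ := w
  simp only [farSW, farW, ne_eq, Prod.mk.injEq, true_and]
  omega

/-- A face having the mid-edge `e` as a side is one of the two faces of `e`. [cite: GlazmanManolescu2019, §1 (the lattice of rhombi and its mid-edges)] -/
private theorem face_of_side_eq {F : Face} {s : Side} {e : MidEdge} (h : F.side s = e) : F = e.faces.1 ∨ F = e.faces.2 :=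
  (Face.exists_side_eq_iff F e).1 ⟨s, h⟩

/-- The face of the `i`-th arc through `nth`. [cite: GlazmanManolescu2019, §1 (the lattice of rhombi and its mid-edges)] -/
private theorem _root_.Literature.Probability.RandomPlanarGeometry.SAW.YangBaxter.YBWalk.arcFace_nth_eq_fcSK
    {a z : MidEdge} (γ : YBWalk D a z) {i : ℕ} (hi : i < γ.arcs.length) :
    arcFace (γ.nth i, γ.nth (i + 1)) = some (γ.fc i) := by
  have h := (YBWalk.arcFace_arcAt hi).1
  have hl := γ.length_eq
  rw [YBWalk.arcAt_eq hi, ← γ.nth_eq_getElem (by omega), ← γ.nth_eq_getElem (by omega)] at h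
  exact h

/-- ★ **The pocket lemma.** If moreover the two cells behind the pocket cell are absent — the KILL CELL
`K_S2 = (w.1 − 3, w.2 − 2)` below it and the cell `(w.1 − 4, w.2 − 1)` west of it — then the excursion of such a walk
has an arc in the cell BELOW THE FAR CELL with the `W` side of that cell as one of its ends: the arc crossing the top
side of the pocket cell either comes down from the far cell's western neighbour, and then can only leave the pocket
cell eastwards, or goes up into it, and then it entered the pocket cell from the east.
[cite: Glazman2015WeightedSAW, Lemma 3.1 (proof, pp. 6–7: the classes of walks through a rhombus)]
[cite: CourantRobbins1958, Ch. V Appendix §2 (The Jordan Curve Theorem for Polygons: the even–odd rule)] -/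
theorem exists_excursion_arc_farSW_W_of_AJ_ne_zero (hh : holeFaceW w ∉ D)
    (hrow : ∀ x : ℤ, x ≤ w.1 - 4 → (x, w.2) ∉ D ∨ (x, w.2 - 1) ∉ D) (hK : killSW w ∉ D) (hPW : pocketSWW w ∉ D)
    (ω : ΩG D (w.side .W) (farW w)) (hr : RootedFace D (w.side .W) (farW w)) (h : ω.IsB2a)
    (hS : ω.2.firstSideG = .S) (hA : ω.AJ hr h (toC (midPt (w.side .W))) ≠ 0) :
    ∃ k, ω.2.firstHitG < k ∧ k < ω.2.arcs.length ∧ ω.2.fc k = farSW w ∧ (ω.2.sIn k = .W ∨ ω.2.sOut k = .W) := by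
  obtain ⟨i, hFi, hi1, hnth⟩ := ω.exists_nth_eq_pocketSW_side_N_of_AJ_ne_zero hh hrow hr h hS hA
  have hF := ω.fh_lt h
  have hfcF : ω.2.fc ω.2.firstHitG = farW w := (fc_fh ω hr h).1
  -- the two arcs at the crossed edge
  obtain ⟨-, hout_i, -⟩ := ω.2.side_sIn_nth (i := i) (by omega)
  obtain ⟨hin_i1, hout_i1, hne_i1⟩ := ω.2.side_sIn_nth (i := i + 1) hi1
  rw [hnth] at hout_i hin_i1
  have hfi := face_of_side_eq hout_i
  have hfi1 := face_of_side_eq hin_i1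
  rw [pocketSW_side_N_faces] at hfi hfi1
  simp only at hfi hfi1
  have hsucc : ω.2.fc i ≠ ω.2.fc (i + 1) := YBWalk.fc_succ_ne hi1
  -- the endpoint of the walk is a side of the far cell, not of the pocket cell
  have hlast : ∀ t : Side, ω.2.nth ω.2.arcs.length ≠ (pocketSW w).side t := by
    intro t; rw [ω.2.nth_length]; exact farW_side_ne_pocketSW_side w ω.1 t
  rcases hfi1 with e1 | e1
  · -- Case A: arc `i + 1` lies in the pocket cell, entered from `N`; it leaves through `E`
    have hsIn : ω.2.sIn (i + 1) = .N := Face.side_injective (pocketSW w) (by rw [e1] at hin_i1; exact hin_i1)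
    have hi2 : i + 2 < ω.2.arcs.length := by
      rcases Nat.lt_or_ge (i + 2) ω.2.arcs.length with hl | hl
      · exact hl
      · have e : i + 2 = ω.2.arcs.length := by omega
        exact absurd (by rw [← e, ← hout_i1, e1]) (hlast (ω.2.sOut (i + 1)))
    have hdoor := ω.2.door_nth (j := i + 2) (by omega) hi2
    rw [← hout_i1, e1] at hdoor
    have hsOut : ω.2.sOut (i + 1) = .E := by
      have hne : ω.2.sOut (i + 1) ≠ .N := fun e => hne_i1 (hsIn.trans e.symm)
      revert hdoor hne
      cases ω.2.sOut (i + 1)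
      · rw [pocketSW_side_W_faces]; intro hd _; exact absurd hd.1 hPW
      · intros; rfl
      · rw [pocketSW_side_S_faces]; intro hd _; exact absurd hd.1 hK
      · intro _ hne; exact absurd rfl hne
    -- arc `i + 2` enters the cell below the far cell from `W`
    obtain ⟨hin_i2, -, -⟩ := ω.2.side_sIn_nth hi2
    rw [← hout_i1, e1, hsOut] at hin_i2
    have hfi2 := face_of_side_eq hin_i2
    rw [pocketSW_side_E_faces] at hfi2
    simp only at hfi2
    have hsucc' : ω.2.fc (i + 1) ≠ ω.2.fc (i + 1 + 1) := YBWalk.fc_succ_ne (by omega)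
    rcases hfi2 with e2 | e2
    · exact absurd (e1.trans e2.symm) hsucc'
    · refine ⟨i + 2, by omega, hi2, e2, Or.inl (Face.side_injective (farSW w) ?_)⟩
      rw [e2] at hin_i2
      rw [hin_i2, pocketSW_side_E]
  · -- Case B: arc `i + 1` lies in the far cell's western neighbour; arc `i` went up through the pocket cell
    have e0 : ω.2.fc i = pocketSW w := by
      rcases hfi with e | e
      · exact e
      · exact absurd (e.trans e1.symm) hsucc
    have hsOut : ω.2.sOut i = .N := Face.side_injective (pocketSW w) (by rw [e0] at hout_i; exact hout_i)
    obtain ⟨hin_i, -, hne_i⟩ := ω.2.side_sIn_nth (i := i) (by omega)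
    rw [e0] at hin_i
    have hdoor := ω.2.door_nth (j := i) (by omega) (by omega)
    rw [← hin_i] at hdoor
    have hsIn : ω.2.sIn i = .E := by
      have hne : ω.2.sIn i ≠ .N := fun e => hne_i (e.trans hsOut.symm)
      revert hdoor hne
      cases ω.2.sIn i
      · rw [pocketSW_side_W_faces]; intro hd _; exact absurd hd.1 hPW
      · intros; rfl
      · rw [pocketSW_side_S_faces]; intro hd _; exact absurd hd.1 hK
      · intro _ hne; exact absurd rfl hne
    rw [hsIn] at hin_i
    -- arc `i - 1` left the cell below the far cell through `W`
    have hi0 : 1 ≤ i := by omega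
    obtain ⟨-, hout_im, -⟩ := ω.2.side_sIn_nth (i := i - 1) (by omega)
    rw [show i - 1 + 1 = i by omega, ← hin_i] at hout_im
    have hfim := face_of_side_eq hout_im
    rw [pocketSW_side_E_faces] at hfim
    simp only at hfim
    have hsucc' : ω.2.fc (i - 1) ≠ ω.2.fc (i - 1 + 1) := YBWalk.fc_succ_ne (by omega)
    rw [show i - 1 + 1 = i by omega, e0] at hsucc'
    rcases hfim with e2 | e2
    · exact absurd e2 hsucc'
    · refine ⟨i - 1, ?_, by omega, e2, Or.inr (Face.side_injective (farSW w) ?_)⟩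
      · -- `i - 1` is not the first hit: that arc lies in the far cell
        rcases Nat.lt_or_ge ω.2.firstHitG (i - 1) with hl | hl
        · exact hl
        · have e : i - 1 = ω.2.firstHitG := by omega
          rw [e, hfcF] at e2
          exact absurd e2 (farSW_ne_farW w).symm
      · rw [e2] at hout_im
        rw [hout_im, pocketSW_side_E]

/-! ## §3 The prefix: the arc before the first hit lies in the cell below the far cell and leaves it through `N` -/

/-- **The prefix arc below the far cell.** A class-`B2a` walk at the far cell with first side `S` reached that side
through the cell below the far cell: its arc just before the first hit lies in `farSW w` and exits through `N`.
[cite: Glazman2015WeightedSAW, Lemma 3.1 (proof, pp. 6–7: the classes of walks through a rhombus)] -/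
theorem prefix_arc_farSW (ω : ΩG D (w.side .W) (farW w)) (h : ω.IsB2a) (hS : ω.2.firstSideG = .S) :
    1 ≤ ω.2.firstHitG ∧ ω.2.fc (ω.2.firstHitG - 1) = farSW w ∧ ω.2.sOut (ω.2.firstHitG - 1) = .N := by
  have hF := ω.fh_lt h
  have hnthF : ω.2.nth ω.2.firstHitG = (farSW w).side .N := by rw [ω.2.nth_firstHitG, hS, farSW_side_N]
  have h1 : 1 ≤ ω.2.firstHitG := by
    rcases Nat.eq_zero_or_pos ω.2.firstHitG with e | e
    · rw [e, ω.2.nth_zero] at hnthF; exact absurd hnthF (root_ne_farSW_side_N w)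
    · exact e
  obtain ⟨-, hout, -⟩ := ω.2.side_sIn_nth (i := ω.2.firstHitG - 1) (by omega)
  rw [show ω.2.firstHitG - 1 + 1 = ω.2.firstHitG by omega, hnthF] at hout
  have hf := face_of_side_eq hout
  rw [farSW_side_N_faces] at hf
  simp only at hf
  rcases hf with e | e
  · exact ⟨h1, e, Face.side_injective (farSW w) (by rw [e] at hout; exact hout)⟩
  · -- no arc before the first hit lies in the far cell
    exfalso
    have hne := ω.2.arcFace_ne_of_lt_firstHitG (i := ω.2.firstHitG - 1) (by omega) (by omega)
    rw [ω.2.arcFace_nth_eq_fcSK (by omega), e] at hne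
    exact hne rfl

/-! ## §4 Two arcs in the cell below the far cell: the double `(π − θ)`-corner -/

/-- Side bookkeeping for the cell below the far cell: an arc `{x, N}` and a disjoint non-crossing arc `{s, t}` with
`W ∈ {s, t}` are the two `(π − θ)`-corner arcs `{E, N}` and `{S, W}`. [cite: GlazmanManolescu2019, §1, Fig. 1] -/
private theorem two_coCorners {x s t : Side} (hxN : x ≠ .N) (hx : Side.N ≠ x.opp) (hst : s ≠ t) (ho : t ≠ s.opp)
    (h1 : s ≠ x) (h2 : s ≠ .N) (h3 : t ≠ x) (h4 : t ≠ .N) (hW : s = .W ∨ t = .W) :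
    arcKind x .N = .coCorner ∧ arcKind s t = .coCorner := by
  revert hxN hx hst ho h1 h2 h3 h4 hW
  cases x <;> cases s <;> cases t <;> decide

/-- Two co-corner arcs of a walk in one rhombus make its kind list `[coCorner, coCorner]`.
[cite: GlazmanManolescu2019, §1, Fig. 1 (two arcs at the two (π−θ)-corners weigh w₂)] -/
theorem _root_.Literature.Probability.RandomPlanarGeometry.SAW.YangBaxter.YBWalk.kindsIn_eq_coCorner_coCorner
    {a z : MidEdge} (γ : YBWalk D a z) {m m' : ℕ} (hm : m < γ.arcs.length) (hm' : m' < γ.arcs.length) (hmm' : m < m')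
    (hf : γ.fc m' = γ.fc m) (hc : arcKind (γ.sIn m) (γ.sOut m) = .coCorner)
    (hc' : arcKind (γ.sIn m') (γ.sOut m') = .coCorner) : γ.kindsIn (γ.fc m) = [.coCorner, .coCorner] := by
  set f := γ.fc m with hfdef
  have hkind : ∀ {n : ℕ} (hn : n < γ.arcs.length), γ.fc n = f → arcKind (γ.sIn n) (γ.sOut n) = .coCorner →
      (if arcFace γ.arcs[n] = some f then arcKindOf γ.arcs[n] else none) = some ArcKind.coCorner := by
    intro n hn hfn hcn
    obtain ⟨h1, h2⟩ := YBWalk.arcKindOf_getElem hn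
    rw [hfn] at h1
    rw [if_pos h1, h2, hcn]
  have hcount : 2 ≤ (γ.kindsIn f).count .coCorner := by
    have hsub : [γ.arcs[m], γ.arcs[m']].Sublist γ.arcs := by
      have h1 : [γ.arcs[m]].Sublist (γ.arcs.take m') := by
        rw [List.singleton_sublist]
        exact List.mem_iff_getElem.2 ⟨m, by rw [List.length_take]; omega, List.getElem_take⟩
      have h2 : [γ.arcs[m']].Sublist (γ.arcs.drop m') := by
        rw [List.singleton_sublist]
        exact List.mem_iff_getElem.2 ⟨0, by rw [List.length_drop]; omega, by rw [List.getElem_drop]; simp⟩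
      have := h1.append h2
      rwa [List.take_append_drop] at this
    set F : MidEdge × MidEdge → Option ArcKind := fun p => if arcFace p = some f then arcKindOf p else none with hF
    have := (hsub.filterMap F).count_le ArcKind.coCorner
    have e1 : F γ.arcs[m] = some .coCorner := hkind hm rfl hc
    have e2 : F γ.arcs[m'] = some .coCorner := hkind hm' hf hc'
    rw [List.filterMap_cons_some e1, List.filterMap_cons_some e2, List.filterMap_nil] at this
    rw [YBWalk.kindsIn]
    simpa using this
  rcases γ.kindsIn_shape f with e | e | e | e | e | e <;> rw [e] at hcount ⊢ <;> simp at hcount ⊢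

/-- ★★ **THE DOUBLE CO-CORNER BELOW THE FAR CELL.** Under the hypotheses of the pocket lemma (hole, kill cell and the
cell west of the pocket cell absent, the far cell's row uncrossable beyond its western neighbour), every class-`B2a`
walk at the far cell with first side `S` whose excursion polygon winds around the root passes the cell BELOW the far
cell twice, through its two `(π − θ)`-corners: the prefix arc `{E, N}` (it cannot be straight next to a second arc,
and its other end is not `W`, an end of the excursion's arc) and the excursion arc `{S, W}`.
[cite: GlazmanManolescu2019, §1, Fig. 1 (the local configurations; two (π−θ)-corner arcs weigh w₂)]
[cite: Glazman2015WeightedSAW, Lemma 3.1 (proof, pp. 6–7: the classes of walks through a rhombus)]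
[cite: CourantRobbins1958, Ch. V Appendix §2 (The Jordan Curve Theorem for Polygons: the even–odd rule)] -/
theorem kindsIn_farSW_eq_of_AJ_ne_zero (hh : holeFaceW w ∉ D)
    (hrow : ∀ x : ℤ, x ≤ w.1 - 4 → (x, w.2) ∉ D ∨ (x, w.2 - 1) ∉ D) (hK : killSW w ∉ D) (hPW : pocketSWW w ∉ D)
    (ω : ΩG D (w.side .W) (farW w)) (hr : RootedFace D (w.side .W) (farW w)) (h : ω.IsB2a)
    (hS : ω.2.firstSideG = .S) (hA : ω.AJ hr h (toC (midPt (w.side .W))) ≠ 0) :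
    ω.2.kindsIn (farSW w) = [.coCorner, .coCorner] := by
  obtain ⟨k, hFk, hkn, hfck, hkW⟩ := ω.exists_excursion_arc_farSW_W_of_AJ_ne_zero hh hrow hK hPW hr h hS hA
  obtain ⟨h1, hfcp, hpN⟩ := ω.prefix_arc_farSW h hS
  have hF := ω.fh_lt h
  set p := ω.2.firstHitG - 1 with hp
  have hpn : p < ω.2.arcs.length := by omega
  have hpk : p < k := by omega
  have hf : ω.2.fc k = ω.2.fc p := hfck.trans hfcp.symm
  obtain ⟨hopp, d1, d2, d3, d4⟩ := YBWalk.not_straight_of_two_arcs hpn hkn (by omega) hf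
  obtain ⟨hopp', -, -, -, -⟩ := YBWalk.not_straight_of_two_arcs hkn hpn (by omega) hf.symm
  have hxN := (ω.2.side_sIn_nth hpn).2.2
  have hst := (ω.2.side_sIn_nth hkn).2.2
  rw [hpN] at hopp d2 d4 hxN
  obtain ⟨c1, c2⟩ := two_coCorners hxN hopp hst hopp' d1 d2 d3 d4 hkW
  rw [← hpN] at c1
  rw [← hfcp]
  exact ω.2.kindsIn_eq_coCorner_coCorner hpn hkn hpk hf c1 c2

/-- ★★ Hence such a walk is NOT `w₂`-free off the far cell. [cite: GlazmanManolescu2019, §1 (the paragraph of Fig. 2: «if θ = π/3, then w₂ = 0»)] -/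
theorem not_W2FreeOff_farW_of_AJ_ne_zero (hh : holeFaceW w ∉ D)
    (hrow : ∀ x : ℤ, x ≤ w.1 - 4 → (x, w.2) ∉ D ∨ (x, w.2 - 1) ∉ D) (hK : killSW w ∉ D) (hPW : pocketSWW w ∉ D)
    (ω : ΩG D (w.side .W) (farW w)) (hr : RootedFace D (w.side .W) (farW w)) (h : ω.IsB2a)
    (hS : ω.2.firstSideG = .S) (hA : ω.AJ hr h (toC (midPt (w.side .W))) ≠ 0) : ¬ω.2.W2FreeOff (farW w) := by
  have hk := ω.kindsIn_farSW_eq_of_AJ_ne_zero hh hrow hK hPW hr h hS hA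
  intro hfree
  have hmem : farSW w ∈ ω.2.facesVisited := by
    by_contra hn
    rw [YBWalk.kindsIn_eq_nil hn] at hk
    exact List.cons_ne_nil _ _ hk.symm
  exact hfree _ hmem (farSW_ne_farW w) hk


/-! ## §5 The wound form: either orientation -/

/-- A double co-corner in the cell below the far cell rules out `w₂`-freeness off the far cell. [cite: GlazmanManolescu2019, §1 (the paragraph of Fig. 2: «if θ = π/3, then w₂ = 0»)] -/
theorem not_W2FreeOff_farW_of_kindsIn_farSW (ω : ΩG D (w.side .W) (farW w))
    (hk : ω.2.kindsIn (farSW w) = [.coCorner, .coCorner]) : ¬ω.2.W2FreeOff (farW w) := by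
  intro hfree
  have hmem : farSW w ∈ ω.2.facesVisited := by
    by_contra hn
    rw [YBWalk.kindsIn_eq_nil hn] at hk
    exact List.cons_ne_nil _ _ hk.symm
  exact hfree _ hmem (farSW_ne_farW w) hk

/-- The reversed companion of a class-`B2a` walk carries the same arc kinds in every rhombus other than `r`.
[cite: Glazman2015WeightedSAW, Lemma 3.1 (proof, pp. 6–7: the classes of walks through a rhombus)] -/
theorem kindsIn_rev_perm {a : MidEdge} {r : Face} (ω : ΩG D a r) (hr : RootedFace D a r) (h : ω.IsB2a)
    {g : Face} (hg : g ≠ r) : ((ω.rev hr).2.kindsIn g).Perm (ω.2.kindsIn g) := by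
  have hF := ω.fh_lt h
  refine YBWalk.kindsIn_of_revSuffix_of_ne ω.2 (ω.rev hr).2 r ω.2.firstHitG _ (rev_snd_arcs ω hr h) ?_ hF ?_ hg
  · rw [ω.2.nth_firstHitG]
    exact arcFace_side_side r _ _ (ω.firstSide_exit_return_distinct hr h).2.1
  · rw [ω.2.arcs_getElem_eq_nth hF, ω.2.nth_firstHitG, (ω.2.exitSide_specG hr hF).1]
    exact arcFace_side_side r _ _ (ω.2.exitSide_specG hr hF).2.symm

/-- ★★★ **THE STRUCTURAL UNDER-ROUTE `w₂`-KILL.** At the far cell `farW w = (w.1 − 2, w.2)` of a hole root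
(`W`-normalisation: root `w.side W`, hole `holeFaceW w = (w.1 − 1, w.2) ∉ D`), suppose the KILL CELL
`K_S2 = (w.1 − 3, w.2 − 2)` and the cell `(w.1 − 4, w.2 − 1)` west of the pocket cell `(w.1 − 3, w.2 − 1)` are absent,
and the bottom line of the far cell's row is uncrossable west of column `w.1 − 3` (for every `x ≤ w.1 − 4` one of
`(x, w.2)`, `(x, w.2 − 1)` is absent). Then EVERY WOUND class-`B2a` walk at the far cell that entered it from `S` (the
under route) passes the cell below the far cell twice through its two `(π − θ)`-corners; in particular it is not
`w₂`-free off the far cell, and at `θ = π/3` its exterior weight vanishes. No walk is enumerated: the excursion polygon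
of the walk (or of its reversed companion) winds around the root, hence crosses the half-line running west from the
root an odd number of times (even–odd rule); the only crossable edge of that half-line is the top side of the pocket
cell; the pocket cell's only other door leads into the cell below the far cell, which the prefix already crossed from
some side to `N` — and two arcs in one rhombus are two disjoint corner arcs.
[cite: GlazmanManolescu2019, §1, Fig. 1 and the paragraph of Fig. 2 («if θ = π/3, then w₂ = 0»)]
[cite: Glazman2015WeightedSAW, Lemma 3.1 (proof, pp. 6–7: the classes of walks through a rhombus)]
[cite: CourantRobbins1958, Ch. V Appendix §2 (The Jordan Curve Theorem for Polygons: the even–odd rule)] -/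
theorem not_W2FreeOff_farW_of_wound_under (hh : holeFaceW w ∉ D)
    (hrow : ∀ x : ℤ, x ≤ w.1 - 4 → (x, w.2) ∉ D ∨ (x, w.2 - 1) ∉ D) (hK : killSW w ∉ D) (hPW : pocketSWW w ∉ D)
    (ω : ΩG D (w.side .W) (farW w)) (hr : RootedFace D (w.side .W) (farW w)) (h : ω.IsB2a)
    (hS : ω.2.firstSideG = .S) {θ : ℝ}
    (hW : ω.WE (fun _ => θ) ≠ excursionWinding θ ω.2.firstSideG (ω.z1 hr h) ω.1) :
    ω.2.kindsIn (farSW w) = [.coCorner, .coCorner] := by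
  rcases ω.AJ_ne_zero_or_rev_of_wound hr h θ hW with hA | hA
  · exact ω.kindsIn_farSW_eq_of_AJ_ne_zero hh hrow hK hPW hr h hS hA
  · have h' := ω.rev_isB2a hr h
    have hS' : (ω.rev hr).2.firstSideG = .S := (ω.rev_firstSide hr h).trans hS
    have hk := (ω.rev hr).kindsIn_farSW_eq_of_AJ_ne_zero hh hrow hK hPW hr h' hS' hA
    have hperm := ω.kindsIn_rev_perm hr h (farSW_ne_farW w)
    rw [hk] at hperm
    have hp : (ω.2.kindsIn (farSW w)).Perm (List.replicate 2 .coCorner) := hperm.symm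
    exact List.perm_replicate.1 hp

/-- ★★★ The same, as the hypothesis «every wound under-walk is `w₂`-marked off the far cell» of the catalogue's
kill-forced-zero theorems (`PlaquetteWalkHoleRootKillForcedZeros` §1/§4), now DISCHARGED structurally.
[cite: GlazmanManolescu2019, §1 (the paragraph of Fig. 2: «if θ = π/3, then w₂ = 0»)]
[cite: CourantRobbins1958, Ch. V Appendix §2 (The Jordan Curve Theorem for Polygons: the even–odd rule)] -/
theorem under_killed_of_killSW (hh : holeFaceW w ∉ D)
    (hrow : ∀ x : ℤ, x ≤ w.1 - 4 → (x, w.2) ∉ D ∨ (x, w.2 - 1) ∉ D) (hK : killSW w ∉ D) (hPW : pocketSWW w ∉ D)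
    (hr : RootedFace D (w.side .W) (farW w)) (θ : ℝ) :
    ∀ (ω : ΩG D (w.side .W) (farW w)) (h : ω.IsB2a), ω.2.firstSideG = .S →
      ω.WE (fun _ => θ) ≠ excursionWinding θ ω.2.firstSideG (ω.z1 hr h) ω.1 → ¬ω.2.W2FreeOff (farW w) :=
  fun ω h hS hW => ω.not_W2FreeOff_farW_of_kindsIn_farSW (ω.not_W2FreeOff_farW_of_wound_under hh hrow hK hPW hr h hS hW)

/-- ★ Consequently the under route has honeycomb mass ZERO: `M_S(π/3) = 0` at the far cell.
[cite: GlazmanManolescu2019, §1 (the paragraph of Fig. 2: «if θ = π/3, then w₂ = 0»)] -/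
theorem sum_routeMassW_S_pi_div_three_eq_zero_of_killSW [Finite D] (hh : holeFaceW w ∉ D)
    (hrow : ∀ x : ℤ, x ≤ w.1 - 4 → (x, w.2) ∉ D ∨ (x, w.2 - 1) ∉ D) (hK : killSW w ∉ D) (hPW : pocketSWW w ∉ D)
    (hr : RootedFace D (w.side .W) (farW w)) :
    ∑ ω ∈ setB2a D (w.side .W) (farW w), routeMassW (π / 3) hr .S ω = 0 :=
  sum_routeMassW_pi_div_three_eq_zero_of_killed hr .S (under_killed_of_killSW hh hrow hK hPW hr (π / 3))

end ΩG

end Literature.Probability.RandomPlanarGeometry.SAW.YangBaxter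

/-! ## §6 The far-cell defect: structural honeycomb sign and kill-forced zeros with the under-kill discharged -/

namespace Literature.Barriers.CriticalPhenomena.PlaquetteWalk

open Literature.Probability.RandomPlanarGeometry.SAW.YangBaxter
open Real Complex

/-- ★★★ **STRUCTURAL HONEYCOMB SIGN OF THE FAR-CELL DEFECT.** At the far cell of a hole root with the kill cell
`K_S2 = (w.1 − 3, w.2 − 2)` and the cell `(w.1 − 4, w.2 − 1)` absent and the far cell's row uncrossable west of its
western neighbour, ONE `w₂`-free wound over-walk makes the imaginary part of the Yang–Baxter vertex functional at
`θ = π/3` STRICTLY POSITIVE (`Im VF(π/3) = x_c²·M_N(π/3)`, the under route being `w₂`-killed by §5).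
[cite: GlazmanManolescu2019, Lemma 2.1 (statement, "in the form given in [Gl]")]
[cite: GlazmanManolescu2019, §1 (the paragraph of Fig. 2: «if θ = π/3, then w₂ = 0»)]
[cite: CourantRobbins1958, Ch. V Appendix §2 (The Jordan Curve Theorem for Polygons: the even–odd rule)] -/
theorem im_vertexFunctional_printed_farCellW_pi_div_three_pos_of_killSW (Dl : List Face) (w : Face)
    (hf : farW w ∈ Dl) (hh : holeFaceW w ∉ dom Dl) (hr : RootedFace (dom Dl) (w.side .W) (farW w))
    (hK : killSW w ∉ dom Dl) (hPW : pocketSWW w ∉ dom Dl)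
    (hrow : ∀ x : ℤ, x ≤ w.1 - 4 → (x, w.2) ∉ dom Dl ∨ (x, w.2 - 1) ∉ dom Dl)
    (hN : ∃ (ω : ΩG (dom Dl) (w.side .W) (farW w)) (h : ω.IsB2a), ω.2.firstSideG = .N ∧
      ω.WE (fun _ => π / 3) ≠ excursionWinding (π / 3) ω.2.firstSideG (ω.z1 hr h) ω.1 ∧ ω.2.W2FreeOff (farW w)) :
    0 < (vertexFunctional (printedWeights (π / 3)) tFiveEighths (ybCoeff (π / 3)) Dl (w.side .W) (farW w)).im :=
  im_vertexFunctional_printed_farCellW_pi_div_three_pos_of_under_killed Dl w hf hh hr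
    (ΩG.under_killed_of_killSW hh hrow hK hPW hr (π / 3)) hN

/-- ★★★ **KILL-FORCED ZERO WITH THE UNDER-ROUTE KILL DISCHARGED.** Same geometry; if in addition some wound over-walk
is `w₂`-free (honeycomb point), every wound over-walk is `w₁`-marked and some wound under-walk is `w₁`-free (dual
point), the Yang–Baxter vertex functional of the hole root vanishes EXACTLY at some `θ* ∈ (π/3, 2π/3)`.
[cite: GlazmanManolescu2019, Lemma 2.1 (statement, "in the form given in [Gl]")]
[cite: GlazmanManolescu2019, §1 (the paragraph of Fig. 2 and the remark after eq. (1))]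
[cite: Glazman2015WeightedSAW, Lemma 3.1 (proof, pp. 6–7)] [cite: DuminilCopinSmirnov2012, proof of Lemma 1] -/
theorem vertexFunctional_printed_farCellW_exists_eq_zero_Ioo_of_killSW_of_over_killed (Dl : List Face) (w : Face)
    (hf : farW w ∈ Dl) (hh : holeFaceW w ∉ dom Dl) (hr : RootedFace (dom Dl) (w.side .W) (farW w))
    (hK : killSW w ∉ dom Dl) (hPW : pocketSWW w ∉ dom Dl)
    (hrow : ∀ x : ℤ, x ≤ w.1 - 4 → (x, w.2) ∉ dom Dl ∨ (x, w.2 - 1) ∉ dom Dl)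
    (hN₂ : ∃ (ω : ΩG (dom Dl) (w.side .W) (farW w)) (h : ω.IsB2a), ω.2.firstSideG = .N ∧
      ω.WE (fun _ => π / 3) ≠ excursionWinding (π / 3) ω.2.firstSideG (ω.z1 hr h) ω.1 ∧ ω.2.W2FreeOff (farW w))
    (hN₁ : ∀ (ω : ΩG (dom Dl) (w.side .W) (farW w)) (h : ω.IsB2a), ω.2.firstSideG = .N →
      ω.WE (fun _ => 2 * π / 3) ≠ excursionWinding (2 * π / 3) ω.2.firstSideG (ω.z1 hr h) ω.1 →
        ¬ω.2.W1FreeOff (farW w))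
    (hS₁ : ∃ (ω : ΩG (dom Dl) (w.side .W) (farW w)) (h : ω.IsB2a), ω.2.firstSideG = .S ∧
      ω.WE (fun _ => 2 * π / 3) ≠ excursionWinding (2 * π / 3) ω.2.firstSideG (ω.z1 hr h) ω.1 ∧
        ω.2.W1FreeOff (farW w)) :
    ∃ θ ∈ Set.Ioo (π / 3) (2 * π / 3),
      vertexFunctional (printedWeights θ) tFiveEighths (ybCoeff θ) Dl (w.side .W) (farW w) = 0 :=
  vertexFunctional_printed_farCellW_exists_eq_zero_Ioo_of_opposite_kills Dl w hf hh hr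
    (ΩG.under_killed_of_killSW hh hrow hK hPW hr (π / 3)) hN₂ hN₁ hS₁

/-- ★★ **ONE STRUCTURAL KILL AND ONE SIGN.** Same geometry, a `w₂`-free wound over-walk, and a printed angle `θ₂`
with `Im VF(θ₂) < 0` ⇒ an exact zero of the far-cell defect in `(π/3, θ₂)`.
[cite: GlazmanManolescu2019, Lemma 2.1 (statement, "in the form given in [Gl]")]
[cite: GlazmanManolescu2019, §1 (the paragraph of Fig. 2)] [cite: DuminilCopinSmirnov2012, proof of Lemma 1] -/
theorem vertexFunctional_printed_farCellW_exists_eq_zero_Ioo_of_killSW_of_im_neg {θ₂ : ℝ}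
    (hθ₂ : θ₂ ∈ Set.Icc (π / 3) (2 * π / 3)) (Dl : List Face) (w : Face)
    (hf : farW w ∈ Dl) (hh : holeFaceW w ∉ dom Dl) (hr : RootedFace (dom Dl) (w.side .W) (farW w))
    (hK : killSW w ∉ dom Dl) (hPW : pocketSWW w ∉ dom Dl)
    (hrow : ∀ x : ℤ, x ≤ w.1 - 4 → (x, w.2) ∉ dom Dl ∨ (x, w.2 - 1) ∉ dom Dl)
    (hN₂ : ∃ (ω : ΩG (dom Dl) (w.side .W) (farW w)) (h : ω.IsB2a), ω.2.firstSideG = .N ∧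
      ω.WE (fun _ => π / 3) ≠ excursionWinding (π / 3) ω.2.firstSideG (ω.z1 hr h) ω.1 ∧ ω.2.W2FreeOff (farW w))
    (h₂ : (vertexFunctional (printedWeights θ₂) tFiveEighths (ybCoeff θ₂) Dl (w.side .W) (farW w)).im < 0) :
    ∃ θ ∈ Set.Ioo (π / 3) θ₂,
      vertexFunctional (printedWeights θ) tFiveEighths (ybCoeff θ) Dl (w.side .W) (farW w) = 0 :=
  vertexFunctional_printed_farCellW_exists_eq_zero_Ioo_of_under_killed_of_im_neg hθ₂ Dl w hf hh hr
    (ΩG.under_killed_of_killSW hh hrow hK hPW hr (π / 3)) hN₂ h₂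

end Literature.Barriers.CriticalPhenomena.PlaquetteWalk

/-! ## §7 (edition 2) The row-mirror twin: the STRUCTURAL OVER-ROUTE `w₁`-KILL

The reflection in the axis of the root row `w.2` (`PlaquetteWalkMirrorDuality`: `mirrorRow`, `mirrorRowFace`, sides
`N ↔ S`, arc kinds `corner ↔ coCorner`) fixes the root `w.side W`, the hole and the far cell, exchanges the over and the
under route, and carries the cells of §0 to their northern twins. A wound over-walk of `D` reflects to a wound under-walk
of the reflected domain (Glazman–Manolescu walks reflect to Glazman–Manolescu walks, `MirrorWalk.mirrorWalk`; the class
`B2a`, the first/exit/return sides and the excursion winding at the dual angle are transported by the tree's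
`YangBaxterSAWHexDictionaryWinding` / `…SecondAngle` lemmas), §5 applies there, and the double `(π − θ)`-corner below the
far cell reflects back to a double `θ`-corner ABOVE the far cell. -/

namespace Literature.Probability.RandomPlanarGeometry.SAW.YangBaxter

open Real
open Literature.Barriers.CriticalPhenomena.PlaquetteWalk (mirrorRow mirrorRowFace mirrorSide mirrorKind mirrorArc
  mirrorRow_side arcsOf_map_mirrorRow arcKind_mirrorSide mirrorRowFace_mirrorRowFace mirrorSide_mirrorSide
  mirrorKind_mirrorKind)
open Literature.Barriers.CriticalPhenomena.PlaquetteWalk.MirrorWalk (mirrorWalk)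

open private fc_fh fc_ne from Literature.Probability.RandomPlanarGeometry.YangBaxterSAWGeneralDomain

section CellsN

variable (w : Face)

/-- The northern POCKET CELL `(w.1 − 3, w.2 + 1)`: north of the far cell's western neighbour. [cite: GlazmanManolescu2019, §1 (the lattice of rhombi and its mid-edges)] -/
def pocketNW : Face := (w.1 - 3, w.2 + 1)

/-- The northern KILL CELL `K_N1 = (w.1 − 3, w.2 + 2)` above the northern pocket cell. [cite: GlazmanManolescu2019, §1 (the lattice of rhombi and its mid-edges)] -/
def killNW : Face := (w.1 - 3, w.2 + 2)

/-- The cell `(w.1 − 4, w.2 + 1)` west of the northern pocket cell. [cite: GlazmanManolescu2019, §1 (the lattice of rhombi and its mid-edges)] -/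
def pocketNWW : Face := (w.1 - 4, w.2 + 1)

/-- The reflected domain: the faces whose mirror image in the root row lies in `D`.
[cite: GlazmanManolescu2019, §4.2 (lattice symmetries)] -/
def rowMirrorDom (D : Set Face) : Set Face := {g | mirrorRowFace w.2 g ∈ D}

/-- Membership in the reflected domain. [cite: GlazmanManolescu2019, §4.2 (lattice symmetries)] -/
theorem mem_rowMirrorDom {D : Set Face} {g : Face} : g ∈ rowMirrorDom w D ↔ mirrorRowFace w.2 g ∈ D := Iff.rfl

/-- The reflection fixes the root. [cite: GlazmanManolescu2019, §4.2 (lattice symmetries)] -/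
theorem mirrorRow_root : mirrorRow w.2 (w.side .W) = w.side .W := by
  obtain ⟨k, j⟩ := w; simp [mirrorRow, Face.side]; ring

/-- The reflection fixes the root plaquette. [cite: GlazmanManolescu2019, §4.2 (lattice symmetries)] -/
theorem mirrorRowFace_self : mirrorRowFace w.2 w = w := by
  obtain ⟨k, j⟩ := w; simp [mirrorRowFace]; ring

/-- The reflection fixes the far cell. [cite: GlazmanManolescu2019, §4.2 (lattice symmetries)] -/
theorem mirrorRowFace_farW : mirrorRowFace w.2 (farW w) = farW w := by
  obtain ⟨k, j⟩ := w; simp [mirrorRowFace, farW]; ring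

/-- The reflection fixes the hole. [cite: GlazmanManolescu2019, §4.2 (lattice symmetries)] -/
theorem mirrorRowFace_holeFaceW : mirrorRowFace w.2 (holeFaceW w) = holeFaceW w := by
  obtain ⟨k, j⟩ := w; simp [mirrorRowFace, holeFaceW]; ring

/-- The reflection exchanges the cells below and above the far cell. [cite: GlazmanManolescu2019, §4.2 (lattice symmetries)] -/
theorem mirrorRowFace_farSW : mirrorRowFace w.2 (farSW w) = farNW w := by
  obtain ⟨k, j⟩ := w; simp [mirrorRowFace, farSW, farNW]; ring

/-- The reflection carries the kill cell to the northern kill cell. [cite: GlazmanManolescu2019, §4.2 (lattice symmetries)] -/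
theorem mirrorRowFace_killSW : mirrorRowFace w.2 (killSW w) = killNW w := by
  obtain ⟨k, j⟩ := w; simp [mirrorRowFace, killSW, killNW]; ring

/-- The reflection carries the cell west of the pocket cell to its northern twin. [cite: GlazmanManolescu2019, §4.2 (lattice symmetries)] -/
theorem mirrorRowFace_pocketSWW : mirrorRowFace w.2 (pocketSWW w) = pocketNWW w := by
  obtain ⟨k, j⟩ := w; simp [mirrorRowFace, pocketSWW, pocketNWW]; ring

/-- The reflection fixes the cells of the root row. [cite: GlazmanManolescu2019, §4.2 (lattice symmetries)] -/
theorem mirrorRowFace_row (x : ℤ) : mirrorRowFace w.2 (x, w.2) = (x, w.2) := by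
  simp [mirrorRowFace]; ring

/-- The reflection exchanges the rows below and above the root row. [cite: GlazmanManolescu2019, §4.2 (lattice symmetries)] -/
theorem mirrorRowFace_row_pred (x : ℤ) : mirrorRowFace w.2 (x, w.2 - 1) = (x, w.2 + 1) := by
  simp [mirrorRowFace]; ring

/-- A side of the far cell reflects to the mirror side of the far cell. [cite: GlazmanManolescu2019, §4.2 (lattice symmetries)] -/
theorem mirrorRow_farW_side (s : Side) : mirrorRow w.2 ((farW w).side s) = (farW w).side (mirrorSide s) := by
  rw [mirrorRow_side, mirrorRowFace_farW]

/-- The far cell is not the cell above it. [cite: GlazmanManolescu2019, §1 (the lattice of rhombi and its mid-edges)] -/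
theorem farNW_ne_farW : farNW w ≠ farW w := by
  obtain ⟨k, j⟩ := w
  simp only [farNW, farW, ne_eq, Prod.mk.injEq, true_and]
  omega

/-- The rooted far cell of the reflected domain. [cite: GlazmanManolescu2019, §2.1 (walks start on the boundary of the domain)] -/
theorem rootedFace_rowMirrorDom {D : Set Face} (hr : RootedFace D (w.side .W) (farW w)) :
    RootedFace (rowMirrorDom w D) (w.side .W) (farW w) := by
  refine ⟨by rw [mem_rowMirrorDom, mirrorRowFace_farW]; exact hr.mem, fun hh => hr.root ?_⟩
  obtain ⟨k, j⟩ := w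
  simp only [Face.side, MidEdge.faces, mem_rowMirrorDom, mirrorRowFace] at hh ⊢
  have e : 2 * j - j = j := by ring
  rw [e] at hh
  exact hh

/-- The excursion winding table is odd under the reflection composed with `θ ↦ π − θ`.
[cite: GlazmanManolescu2019, Lemma 2.1 (proof: [Gl], Lemma 3.1) and §1 (θ ↔ π − θ)] -/
theorem excursionWinding_mirrorSide (θ : ℝ) (z₀ z₁ z₂ : Side) :
    excursionWinding θ (mirrorSide z₀) (mirrorSide z₁) (mirrorSide z₂) = -excursionWinding (π - θ) z₀ z₁ z₂ := by
  cases z₀ <;> cases z₁ <;> cases z₂ <;> simp [excursionWinding, mirrorSide] <;> ring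

end CellsN

namespace YBWalk

variable {D : Set Face} {a z : MidEdge}

/-- The `i`-th arc contributes its kind to the kind list of its rhombus. [cite: GlazmanManolescu2019, §1 (Fig. 1)] -/
theorem arcKind_mem_kindsIn (γ : YBWalk D a z) {i : ℕ} (hi : i < γ.arcs.length) :
    arcKind (γ.sIn i) (γ.sOut i) ∈ γ.kindsIn (γ.fc i) := by
  obtain ⟨h1, h2⟩ := YBWalk.arcKindOf_getElem hi
  rw [kindsIn]
  exact List.mem_filterMap.2 ⟨γ.arcs[i], List.getElem_mem _, by rw [if_pos h1, h2]⟩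

/-- Two corner arcs of a walk in one rhombus make its kind list `[corner, corner]`.
[cite: GlazmanManolescu2019, §1, Fig. 1 (two arcs at the two θ-corners weigh w₁)] -/
theorem kindsIn_eq_corner_corner (γ : YBWalk D a z) {m m' : ℕ} (hm : m < γ.arcs.length) (hm' : m' < γ.arcs.length)
    (hmm' : m < m') (hf : γ.fc m' = γ.fc m) (hc : arcKind (γ.sIn m) (γ.sOut m) = .corner)
    (hc' : arcKind (γ.sIn m') (γ.sOut m') = .corner) : γ.kindsIn (γ.fc m) = [.corner, .corner] := by
  set f := γ.fc m with hfdef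
  have hkind : ∀ {n : ℕ} (hn : n < γ.arcs.length), γ.fc n = f → arcKind (γ.sIn n) (γ.sOut n) = .corner →
      (if arcFace γ.arcs[n] = some f then arcKindOf γ.arcs[n] else none) = some ArcKind.corner := by
    intro n hn hfn hcn
    obtain ⟨h1, h2⟩ := YBWalk.arcKindOf_getElem hn
    rw [hfn] at h1
    rw [if_pos h1, h2, hcn]
  have hcount : 2 ≤ (γ.kindsIn f).count .corner := by
    have hsub : [γ.arcs[m], γ.arcs[m']].Sublist γ.arcs := by
      have h1 : [γ.arcs[m]].Sublist (γ.arcs.take m') := by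
        rw [List.singleton_sublist]
        exact List.mem_iff_getElem.2 ⟨m, by rw [List.length_take]; omega, List.getElem_take⟩
      have h2 : [γ.arcs[m']].Sublist (γ.arcs.drop m') := by
        rw [List.singleton_sublist]
        exact List.mem_iff_getElem.2 ⟨0, by rw [List.length_drop]; omega, by rw [List.getElem_drop]; simp⟩
      have := h1.append h2
      rwa [List.take_append_drop] at this
    set F : MidEdge × MidEdge → Option ArcKind := fun p => if arcFace p = some f then arcKindOf p else none with hF
    have := (hsub.filterMap F).count_le ArcKind.corner
    have e1 : F γ.arcs[m] = some .corner := hkind hm rfl hc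
    have e2 : F γ.arcs[m'] = some .corner := hkind hm' hf hc'
    rw [List.filterMap_cons_some e1, List.filterMap_cons_some e2, List.filterMap_nil] at this
    rw [YBWalk.kindsIn]
    simpa using this
  rcases γ.kindsIn_shape f with e | e | e | e | e | e <;> rw [e] at hcount ⊢ <;> simp at hcount ⊢

end YBWalk

namespace ΩG

variable {D : Set Face} {w : Face}

/-- **The reflected walk**: the image of a walk at the far cell under the reflection in the root row — a walk of the
reflected domain from the same root, ending on the mirror side of the far cell. [cite: GlazmanManolescu2019, §4.2 (lattice symmetries)] -/
def mirrorFar (ω : ΩG D (w.side .W) (farW w)) : ΩG (rowMirrorDom w D) (w.side .W) (farW w) :=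
  ⟨mirrorSide ω.1, mirrorWalk w.2 (fun g hg => by rw [mem_rowMirrorDom, mirrorRowFace_mirrorRowFace]; exact hg)
    (mirrorRow_root w) (mirrorRow_farW_side w ω.1) ω.2⟩

variable (ω : ΩG D (w.side .W) (farW w))

/-- Its mid-edges are the reflected mid-edges. [cite: GlazmanManolescu2019, §4.2 (lattice symmetries)] -/
theorem mirrorFar_mids : ω.mirrorFar.2.mids = ω.2.mids.map (mirrorRow w.2) := rfl

/-- Its return side is the mirror side. [cite: GlazmanManolescu2019, §4.2 (lattice symmetries)] -/
theorem mirrorFar_fst : ω.mirrorFar.1 = mirrorSide ω.1 := rfl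

/-- Same number of arcs. [cite: GlazmanManolescu2019, §4.2 (lattice symmetries)] -/
theorem mirrorFar_length : ω.mirrorFar.2.arcs.length = ω.2.arcs.length :=
  YBWalk.length_arcs_eq_of_mids_mirror ω.mirrorFar_mids

/-- Same first hit of the (reflected = same) far cell. [cite: Glazman2015WeightedSAW, Lemma 3.1 (proof, pp. 6–7: the first crossing of ∂r)] -/
theorem mirrorFar_firstHitG : ω.mirrorFar.2.firstHitG = ω.2.firstHitG := by
  have hset : ω.mirrorFar.2.hitIdx (farW w) = ω.2.hitIdx (farW w) := by
    have h := YBWalk.hitIdx_eq_of_mids_mirror ω.mirrorFar_mids (farW w)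
    rwa [mirrorRowFace_farW] at h
  unfold YBWalk.firstHitG
  apply le_antisymm
  · exact Finset.min'_le _ _ (by rw [hset]; exact Finset.min'_mem _ _)
  · exact Finset.min'_le _ _ (by rw [← hset]; exact Finset.min'_mem _ _)

/-- The arcs of the reflected walk lie in the reflected rhombi … [cite: GlazmanManolescu2019, §4.2 (lattice symmetries)] -/
theorem mirrorFar_fc {i : ℕ} (hi : i < ω.2.arcs.length) : ω.mirrorFar.2.fc i = mirrorRowFace w.2 (ω.2.fc i) :=
  YBWalk.fc_eq_of_mids_mirror ω.mirrorFar_mids hi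

/-- … through the mirror sides. [cite: GlazmanManolescu2019, §4.2 (lattice symmetries)] -/
theorem mirrorFar_sIn_sOut {i : ℕ} (hi : i < ω.2.arcs.length) :
    ω.mirrorFar.2.sIn i = mirrorSide (ω.2.sIn i) ∧ ω.mirrorFar.2.sOut i = mirrorSide (ω.2.sOut i) :=
  YBWalk.sIn_sOut_eq_of_mids_mirror ω.mirrorFar_mids hi

variable {ω}

/-- The reflected walk of a class-`B2a` walk is of class `B2a`. [cite: Glazman2015WeightedSAW, Lemma 3.1 (proof, pp. 6–7: the classes of walks through a rhombus)] -/
theorem mirrorFar_isB2a (hr : RootedFace D (w.side .W) (farW w)) (h : ω.IsB2a) : ω.mirrorFar.IsB2a := by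
  have hB2 : ω.2.firstHitG + 1 < ω.2.arcs.length := h.1
  refine isB2a_of_forall_fc_ne (by rw [mirrorFar_firstHitG, mirrorFar_length]; exact hB2) fun j hj1 hj2 e => ?_
  rw [mirrorFar_firstHitG] at hj1
  rw [mirrorFar_length] at hj2
  rw [ω.mirrorFar_fc hj2] at e
  have e' := congrArg (mirrorRowFace w.2) e
  rw [mirrorRowFace_mirrorRowFace, mirrorRowFace_farW] at e'
  exact fc_ne ω hr h hj1 hj2 e'

/-- Its first side is the mirror side. [cite: Glazman2015WeightedSAW, Lemma 3.1 (proof, pp. 6–7)] -/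
theorem mirrorFar_firstSideG : ω.mirrorFar.2.firstSideG = mirrorSide ω.2.firstSideG := by
  have h1 := ω.mirrorFar.2.nth_firstHitG
  rw [YBWalk.nth_eq_of_mids_mirror ω.mirrorFar_mids, mirrorFar_firstHitG, ω.2.nth_firstHitG, mirrorRow_farW_side] at h1
  exact (Face.side_injective _ h1).symm

/-- Its exit side is the mirror side. [cite: Glazman2015WeightedSAW, Lemma 3.1 (proof, pp. 6–7)] -/
theorem mirrorFar_z1 (hr : RootedFace D (w.side .W) (farW w)) (h : ω.IsB2a) :
    ω.mirrorFar.z1 (rootedFace_rowMirrorDom w hr) (ω.mirrorFar_isB2a hr h) = mirrorSide (ω.z1 hr h) := by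
  have hF := ω.fh_lt h
  have hF' := ω.mirrorFar.fh_lt (ω.mirrorFar_isB2a hr h)
  have h1 := (ω.mirrorFar.2.exitSide_specG (rootedFace_rowMirrorDom w hr) hF').1
  rw [YBWalk.nth_eq_of_mids_mirror ω.mirrorFar_mids, mirrorFar_firstHitG, (ω.2.exitSide_specG hr hF).1,
    mirrorRow_farW_side] at h1
  exact (Face.side_injective _ h1).symm

/-- **The excursion winding of the reflected walk at `θ` is minus that of the walk at `π − θ`.**
[cite: GlazmanManolescu2019, §2.1, eq. (2.1) (wind(γ)) and §1 (θ ↔ π − θ)] -/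
theorem mirrorFar_WE (θ : ℝ) : ω.mirrorFar.WE (fun _ => θ) = -ω.WE (fun _ => π - θ) := by
  unfold ΩG.WE
  rw [mirrorFar_firstHitG]
  have harcs : ω.mirrorFar.2.arcs = ω.2.arcs.map (mirrorArc w.2) := by
    show arcsOf ω.mirrorFar.2.mids = _
    rw [mirrorFar_mids, arcsOf_map_mirrorRow]
  rw [harcs, ← List.map_drop, sum_map_arcTurnOf_mirrorArc]

/-- **Woundness is preserved**: a walk wound at `θ` reflects to a walk wound at `π − θ`.
[cite: GlazmanManolescu2019, Lemma 2.1 (statement, "in the form given in [Gl]") and §1 (θ ↔ π − θ)] -/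
theorem mirrorFar_wound (hr : RootedFace D (w.side .W) (farW w)) (h : ω.IsB2a) {θ : ℝ}
    (hW : ω.WE (fun _ => θ) ≠ excursionWinding θ ω.2.firstSideG (ω.z1 hr h) ω.1) :
    ω.mirrorFar.WE (fun _ => π - θ) ≠ excursionWinding (π - θ) ω.mirrorFar.2.firstSideG
      (ω.mirrorFar.z1 (rootedFace_rowMirrorDom w hr) (ω.mirrorFar_isB2a hr h)) ω.mirrorFar.1 := by
  rw [mirrorFar_WE, ω.mirrorFar_firstSideG, ω.mirrorFar_z1 hr h, mirrorFar_fst, excursionWinding_mirrorSide,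
    sub_sub_cancel]
  exact fun e => hW (neg_injective e)


/-- ★★★ **THE STRUCTURAL OVER-ROUTE `w₁`-KILL** (row-mirror twin of §5). At the far cell of a hole root
(`W`-normalisation), suppose the northern kill cell `K_N1 = (w.1 − 3, w.2 + 2)` and the cell `(w.1 − 4, w.2 + 1)` west
of the northern pocket cell are absent and the TOP line of the far cell's row is uncrossable west of the pocket (for
every `x ≤ w.1 − 4` one of `(x, w.2)`, `(x, w.2 + 1)` is absent). Then every WOUND class-`B2a` walk at the far cell that
entered it from `N` (the over route) passes the cell ABOVE the far cell twice through its two `θ`-corners: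
`kindsIn (farNW w) = [corner, corner]`. Proof: reflect in the root row and apply §5 to the reflected walk, a wound
under-walk of the reflected domain at the dual angle. [cite: GlazmanManolescu2019, §1, Fig. 1 and the remark after eq. (1) (θ ↔ π − θ exchanges w₁ and w₂)]
[cite: Glazman2015WeightedSAW, Lemma 3.1 (proof, pp. 6–7: the classes of walks through a rhombus)]
[cite: CourantRobbins1958, Ch. V Appendix §2 (The Jordan Curve Theorem for Polygons: the even–odd rule)] -/
theorem kindsIn_farNW_eq_of_wound_over (hh : holeFaceW w ∉ D)
    (hrow : ∀ x : ℤ, x ≤ w.1 - 4 → (x, w.2) ∉ D ∨ (x, w.2 + 1) ∉ D) (hK : killNW w ∉ D) (hPW : pocketNWW w ∉ D)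
    (ω : ΩG D (w.side .W) (farW w)) (hr : RootedFace D (w.side .W) (farW w)) (h : ω.IsB2a)
    (hN : ω.2.firstSideG = .N) {θ : ℝ}
    (hW : ω.WE (fun _ => θ) ≠ excursionWinding θ ω.2.firstSideG (ω.z1 hr h) ω.1) :
    ω.2.kindsIn (farNW w) = [.corner, .corner] := by
  -- the reflected walk is a wound under-walk of the reflected domain, to which §5 applies
  have hr' := rootedFace_rowMirrorDom w hr
  have h' := ω.mirrorFar_isB2a hr h
  have hh' : holeFaceW w ∉ rowMirrorDom w D := by rwa [mem_rowMirrorDom, mirrorRowFace_holeFaceW]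
  have hK' : killSW w ∉ rowMirrorDom w D := by rwa [mem_rowMirrorDom, mirrorRowFace_killSW]
  have hPW' : pocketSWW w ∉ rowMirrorDom w D := by rwa [mem_rowMirrorDom, mirrorRowFace_pocketSWW]
  have hrow' : ∀ x : ℤ, x ≤ w.1 - 4 → (x, w.2) ∉ rowMirrorDom w D ∨ (x, w.2 - 1) ∉ rowMirrorDom w D := by
    intro x hx
    rw [mem_rowMirrorDom, mem_rowMirrorDom, mirrorRowFace_row, mirrorRowFace_row_pred]
    exact hrow x hx
  have hS' : ω.mirrorFar.2.firstSideG = .S := by rw [mirrorFar_firstSideG, hN]; rfl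
  have hk := ω.mirrorFar.not_W2FreeOff_farW_of_wound_under hh' hrow' hK' hPW' hr' h' hS' (ω.mirrorFar_wound hr h hW)
  -- two co-corner arcs of the reflected walk below the far cell are two corner arcs of the walk above it
  obtain ⟨i, j, hij, hj, hfi, hfj⟩ :=
    ω.mirrorFar.2.exists_two_arcs_of_two_le_length_kindsIn (f := farSW w) (by rw [hk]; simp)
  have hn := ω.mirrorFar_length
  have hi0 : i < ω.2.arcs.length := by omega
  have hj0 : j < ω.2.arcs.length := by omega
  have hface : ∀ {m : ℕ}, m < ω.2.arcs.length → ω.mirrorFar.2.fc m = farSW w → ω.2.fc m = farNW w := by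
    intro m hm e
    have e1 := ω.mirrorFar_fc hm
    rw [e] at e1
    have e2 := congrArg (mirrorRowFace w.2) e1
    rw [mirrorRowFace_farSW, mirrorRowFace_mirrorRowFace] at e2
    exact e2.symm
  have hkind : ∀ {m : ℕ}, m < ω.2.arcs.length → ω.mirrorFar.2.fc m = farSW w →
      arcKind (ω.2.sIn m) (ω.2.sOut m) = .corner := by
    intro m hm e
    have hmem := ω.mirrorFar.2.arcKind_mem_kindsIn (i := m) (by omega)
    obtain ⟨e1, e2⟩ := ω.mirrorFar_sIn_sOut hm
    rw [e, hk, e1, e2, arcKind_mirrorSide] at hmem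
    have e3 : mirrorKind (arcKind (ω.2.sIn m) (ω.2.sOut m)) = .coCorner := by simpa using hmem
    have e4 := congrArg mirrorKind e3
    rw [mirrorKind_mirrorKind] at e4
    exact e4
  have hfci := hface hi0 hfi
  have hfcj := hface hj0 hfj
  rw [← hfci]
  exact ω.2.kindsIn_eq_corner_corner hi0 hj0 hij (hfcj.trans hfci.symm) (hkind hi0 hfi) (hkind hj0 hfj)

/-- ★★ Hence such a walk is NOT `w₁`-free off the far cell (at `θ = 2π/3` its exterior weight vanishes).
[cite: GlazmanManolescu2019, §1, remark after eq. (1)] -/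
theorem not_W1FreeOff_farW_of_wound_over (hh : holeFaceW w ∉ D)
    (hrow : ∀ x : ℤ, x ≤ w.1 - 4 → (x, w.2) ∉ D ∨ (x, w.2 + 1) ∉ D) (hK : killNW w ∉ D) (hPW : pocketNWW w ∉ D)
    (ω : ΩG D (w.side .W) (farW w)) (hr : RootedFace D (w.side .W) (farW w)) (h : ω.IsB2a)
    (hN : ω.2.firstSideG = .N) {θ : ℝ}
    (hW : ω.WE (fun _ => θ) ≠ excursionWinding θ ω.2.firstSideG (ω.z1 hr h) ω.1) : ¬ω.2.W1FreeOff (farW w) := by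
  have hk := ω.kindsIn_farNW_eq_of_wound_over hh hrow hK hPW hr h hN hW
  intro hfree
  have hmem : farNW w ∈ ω.2.facesVisited := by
    by_contra hn
    rw [YBWalk.kindsIn_eq_nil hn] at hk
    exact List.cons_ne_nil _ _ hk.symm
  exact hfree _ hmem (farNW_ne_farW w) hk

/-- ★★★ The hypothesis «every wound over-walk is `w₁`-marked off the far cell» of the companion file's §2/§4
(`hN₁`), DISCHARGED structurally. [cite: GlazmanManolescu2019, §1, remark after eq. (1)]
[cite: CourantRobbins1958, Ch. V Appendix §2 (The Jordan Curve Theorem for Polygons: the even–odd rule)] -/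
theorem over_killed_of_killNW (hh : holeFaceW w ∉ D)
    (hrow : ∀ x : ℤ, x ≤ w.1 - 4 → (x, w.2) ∉ D ∨ (x, w.2 + 1) ∉ D) (hK : killNW w ∉ D) (hPW : pocketNWW w ∉ D)
    (hr : RootedFace D (w.side .W) (farW w)) (θ : ℝ) :
    ∀ (ω : ΩG D (w.side .W) (farW w)) (h : ω.IsB2a), ω.2.firstSideG = .N →
      ω.WE (fun _ => θ) ≠ excursionWinding θ ω.2.firstSideG (ω.z1 hr h) ω.1 → ¬ω.2.W1FreeOff (farW w) :=
  fun ω h hN hW => ω.not_W1FreeOff_farW_of_wound_over hh hrow hK hPW hr h hN hW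

/-- ★ Consequently the over route has dual honeycomb mass ZERO: `M_N(2π/3) = 0` at the far cell.
[cite: GlazmanManolescu2019, §1, remark after eq. (1)] -/
theorem sum_routeMassW_N_two_pi_div_three_eq_zero_of_killNW [Finite D] (hh : holeFaceW w ∉ D)
    (hrow : ∀ x : ℤ, x ≤ w.1 - 4 → (x, w.2) ∉ D ∨ (x, w.2 + 1) ∉ D) (hK : killNW w ∉ D) (hPW : pocketNWW w ∉ D)
    (hr : RootedFace D (w.side .W) (farW w)) :
    ∑ ω ∈ setB2a D (w.side .W) (farW w), routeMassW (2 * π / 3) hr .N ω = 0 :=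
  sum_routeMassW_two_pi_div_three_eq_zero_of_killed hr .N (over_killed_of_killNW hh hrow hK hPW hr (2 * π / 3))

end ΩG

end Literature.Probability.RandomPlanarGeometry.SAW.YangBaxter

/-! ## §8 (edition 2) The far-cell defect with BOTH kills structural -/

namespace Literature.Barriers.CriticalPhenomena.PlaquetteWalk

open Literature.Probability.RandomPlanarGeometry.SAW.YangBaxter
open Real Complex

/-- ★★★ **STRUCTURAL DUAL SIGN OF THE FAR-CELL DEFECT.** Northern kill cell, the cell west of the northern pocket cell
absent, top line uncrossable beyond, and ONE `w₁`-free wound under-walk ⇒ `Im VF(2π/3) < 0` (`= −v·M_S(2π/3)`, the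
over route being `w₁`-killed by §7). [cite: GlazmanManolescu2019, Lemma 2.1 (statement, "in the form given in [Gl]")]
[cite: GlazmanManolescu2019, §1, remark after eq. (1)]
[cite: CourantRobbins1958, Ch. V Appendix §2 (The Jordan Curve Theorem for Polygons: the even–odd rule)] -/
theorem im_vertexFunctional_printed_farCellW_two_pi_div_three_neg_of_killNW (Dl : List Face) (w : Face)
    (hf : farW w ∈ Dl) (hh : holeFaceW w ∉ dom Dl) (hr : RootedFace (dom Dl) (w.side .W) (farW w))
    (hK : killNW w ∉ dom Dl) (hPW : pocketNWW w ∉ dom Dl)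
    (hrow : ∀ x : ℤ, x ≤ w.1 - 4 → (x, w.2) ∉ dom Dl ∨ (x, w.2 + 1) ∉ dom Dl)
    (hS : ∃ (ω : ΩG (dom Dl) (w.side .W) (farW w)) (h : ω.IsB2a), ω.2.firstSideG = .S ∧
      ω.WE (fun _ => 2 * π / 3) ≠ excursionWinding (2 * π / 3) ω.2.firstSideG (ω.z1 hr h) ω.1 ∧
        ω.2.W1FreeOff (farW w)) :
    (vertexFunctional (printedWeights (2 * π / 3)) tFiveEighths (ybCoeff (2 * π / 3)) Dl (w.side .W)
      (farW w)).im < 0 :=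
  im_vertexFunctional_printed_farCellW_two_pi_div_three_neg_of_over_killed Dl w hf hh hr
    (ΩG.over_killed_of_killNW hh hrow hK hPW hr (2 * π / 3)) hS

/-- ★★★★ **THE KILL-FORCED ZERO WITH BOTH KILLS STRUCTURAL.** At the far cell of a hole root (`W`-normalisation) with
BOTH corner cells `K_S2 = (w.1 − 3, w.2 − 2)`, `K_N1 = (w.1 − 3, w.2 + 2)` and both cells `(w.1 − 4, w.2 ∓ 1)` west of
the two pocket cells absent, and the bottom and top lines of the far cell's row uncrossable west of the pockets: ONE
`w₂`-free wound over-walk and ONE `w₁`-free wound under-walk force an EXACT ZERO of the Yang–Baxter vertex functional of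
the hole root at some `θ* ∈ (π/3, 2π/3)` (`Im VF(π/3) > 0 > Im VF(2π/3)`, `Re VF ≡ 0`, continuity). The two universal
kill hypotheses of the companion file's §4 are theorems here; only the two existential witnesses remain data.
[cite: GlazmanManolescu2019, Lemma 2.1 (statement, "in the form given in [Gl]")]
[cite: GlazmanManolescu2019, §1 (the paragraph of Fig. 2 and the remark after eq. (1))]
[cite: Glazman2015WeightedSAW, Lemma 3.1 (proof, pp. 6–7)] [cite: DuminilCopinSmirnov2012, proof of Lemma 1]
[cite: CourantRobbins1958, Ch. V Appendix §2 (The Jordan Curve Theorem for Polygons: the even–odd rule)] -/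
theorem vertexFunctional_printed_farCellW_exists_eq_zero_Ioo_of_killSW_of_killNW (Dl : List Face) (w : Face)
    (hf : farW w ∈ Dl) (hh : holeFaceW w ∉ dom Dl) (hr : RootedFace (dom Dl) (w.side .W) (farW w))
    (hKS : killSW w ∉ dom Dl) (hPS : pocketSWW w ∉ dom Dl)
    (hrowS : ∀ x : ℤ, x ≤ w.1 - 4 → (x, w.2) ∉ dom Dl ∨ (x, w.2 - 1) ∉ dom Dl)
    (hKN : killNW w ∉ dom Dl) (hPN : pocketNWW w ∉ dom Dl)
    (hrowN : ∀ x : ℤ, x ≤ w.1 - 4 → (x, w.2) ∉ dom Dl ∨ (x, w.2 + 1) ∉ dom Dl)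
    (hN₂ : ∃ (ω : ΩG (dom Dl) (w.side .W) (farW w)) (h : ω.IsB2a), ω.2.firstSideG = .N ∧
      ω.WE (fun _ => π / 3) ≠ excursionWinding (π / 3) ω.2.firstSideG (ω.z1 hr h) ω.1 ∧ ω.2.W2FreeOff (farW w))
    (hS₁ : ∃ (ω : ΩG (dom Dl) (w.side .W) (farW w)) (h : ω.IsB2a), ω.2.firstSideG = .S ∧
      ω.WE (fun _ => 2 * π / 3) ≠ excursionWinding (2 * π / 3) ω.2.firstSideG (ω.z1 hr h) ω.1 ∧
        ω.2.W1FreeOff (farW w)) :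
    ∃ θ ∈ Set.Ioo (π / 3) (2 * π / 3),
      vertexFunctional (printedWeights θ) tFiveEighths (ybCoeff θ) Dl (w.side .W) (farW w) = 0 :=
  vertexFunctional_printed_farCellW_exists_eq_zero_Ioo_of_opposite_kills Dl w hf hh hr
    (ΩG.under_killed_of_killSW hh hrowS hKS hPS hr (π / 3)) hN₂
    (ΩG.over_killed_of_killNW hh hrowN hKN hPN hr (2 * π / 3)) hS₁

/-- ★★ **ONE STRUCTURAL UPPER KILL AND ONE SIGN.** Northern kill geometry, a `w₁`-free wound under-walk, and a printed
angle `θ₁` with `Im VF(θ₁) > 0` ⇒ an exact zero of the far-cell defect in `(θ₁, 2π/3)`.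
[cite: GlazmanManolescu2019, Lemma 2.1 (statement, "in the form given in [Gl]")]
[cite: GlazmanManolescu2019, §1, remark after eq. (1)] [cite: DuminilCopinSmirnov2012, proof of Lemma 1] -/
theorem vertexFunctional_printed_farCellW_exists_eq_zero_Ioo_of_im_pos_of_killNW {θ₁ : ℝ}
    (hθ₁ : θ₁ ∈ Set.Icc (π / 3) (2 * π / 3)) (Dl : List Face) (w : Face)
    (hf : farW w ∈ Dl) (hh : holeFaceW w ∉ dom Dl) (hr : RootedFace (dom Dl) (w.side .W) (farW w))
    (hK : killNW w ∉ dom Dl) (hPW : pocketNWW w ∉ dom Dl)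
    (hrow : ∀ x : ℤ, x ≤ w.1 - 4 → (x, w.2) ∉ dom Dl ∨ (x, w.2 + 1) ∉ dom Dl)
    (h₁ : 0 < (vertexFunctional (printedWeights θ₁) tFiveEighths (ybCoeff θ₁) Dl (w.side .W) (farW w)).im)
    (hS₁ : ∃ (ω : ΩG (dom Dl) (w.side .W) (farW w)) (h : ω.IsB2a), ω.2.firstSideG = .S ∧
      ω.WE (fun _ => 2 * π / 3) ≠ excursionWinding (2 * π / 3) ω.2.firstSideG (ω.z1 hr h) ω.1 ∧
        ω.2.W1FreeOff (farW w)) :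
    ∃ θ ∈ Set.Ioo θ₁ (2 * π / 3),
      vertexFunctional (printedWeights θ) tFiveEighths (ybCoeff θ) Dl (w.side .W) (farW w) = 0 :=
  vertexFunctional_printed_farCellW_exists_eq_zero_Ioo_of_im_pos_of_over_killed hθ₁ Dl w hf hh hr h₁
    (ΩG.over_killed_of_killNW hh hrow hK hPW hr (2 * π / 3)) hS₁

end Literature.Barriers.CriticalPhenomena.PlaquetteWalk

/-! ## §9 (edition 3) The DEAD-END COLUMN variant: a live column west of the pocket

In the lane's boxes with the hole in column `3` (`6×5 ∖ (3,2)`, `7×5 ∖ (3,2)`, `7×6 ∖ (3,2)`, `8×5 ∖ (3,2)` and the kill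
instances built on them) the pocket cell `(w.1 − 3, w.2 − 1)` HAS a western door: the boundary column `w.1 − 4 = 0` is
alive. The kill still works, by one more step of the same kind: with the kill cell `K_S2 = (w.1 − 3, w.2 − 2)` gone,
the bottom cell `(w.1 − 4, w.2 − 2)` of that column is a DEAD END (no door but its top side), so a crossing of the
bottom line at column `w.1 − 4` must continue east through the pocket into the cell below the far cell — or run up
again through the pocket's top side, a SECOND crossing of the half-line, which the odd parity forbids. This section
replaces the two hypotheses «`(w.1 − 4, w.2 − 1)` absent, row uncrossable for `x ≤ w.1 − 4`» of §§1–6 by «column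
`w.1 − 5` absent on the three rows `w.2`, `w.2 − 1`, `w.2 − 2` (through the row condition for `x ≤ w.1 − 5` and two
cells), `(w.1 − 4, w.2 − 3)` absent» — the cells of column `w.1 − 4` themselves may be present or not. -/

namespace Literature.Probability.RandomPlanarGeometry.SAW.YangBaxter

open Real
open Literature.Barriers.CriticalPhenomena.PlaquetteWalk (mirrorRow mirrorRowFace mirrorSide mirrorKind mirrorArc
  mirrorRow_side arcsOf_map_mirrorRow arcKind_mirrorSide mirrorRowFace_mirrorRowFace mirrorSide_mirrorSide
  mirrorKind_mirrorKind)

open private fc_fh from Literature.Probability.RandomPlanarGeometry.YangBaxterSAWGeneralDomain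

section CellsV

variable (w : Face)

/-- The bottom cell `(w.1 − 4, w.2 − 2)` of the column west of the pocket (a dead end once the kill cell is gone).
[cite: GlazmanManolescu2019, §1 (the lattice of rhombi and its mid-edges)] -/
def colWbot : Face := (w.1 - 4, w.2 - 2)

/-- The pocket cell's top side is the ray edge `m = 2`. [cite: CourantRobbins1958, Ch. V Appendix §2 (the even–odd rule)] -/
theorem pocketSW_side_N_eq_rayMid : (pocketSW w).side .N = rayMid w .W 2 := by
  rw [rayMid_W_eq, pocketSW_side_N_eq]; push_cast; ring_nf

/-- The western cell's top side is the ray edge `m = 3`. [cite: CourantRobbins1958, Ch. V Appendix §2 (the even–odd rule)] -/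
theorem pocketSWW_side_N_eq_rayMid : (pocketSWW w).side .N = rayMid w .W 3 := by
  rw [rayMid_W_eq]; obtain ⟨k, j⟩ := w; simp [pocketSWW, Face.side]; ring

/-- The western cell's top side as a lattice mid-edge. [cite: GlazmanManolescu2019, §1 (the lattice of rhombi and its mid-edges)] -/
theorem pocketSWW_side_N_eq : (pocketSWW w).side .N = MidEdge.slant (w.1 - 4) w.2 := by
  obtain ⟨k, j⟩ := w; simp [pocketSWW, Face.side]

/-- `pocketSWW.E = pocketSW.W`. [cite: GlazmanManolescu2019, §1 (the lattice of rhombi and its mid-edges)] -/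
theorem pocketSWW_side_E : (pocketSWW w).side .E = (pocketSW w).side .W := by
  obtain ⟨k, j⟩ := w; simp [pocketSWW, pocketSW, Face.side]; ring

/-- Faces of the western cell's `S` side. [cite: GlazmanManolescu2019, §1 (the lattice of rhombi and its mid-edges)] -/
theorem pocketSWW_side_S_faces : ((pocketSWW w).side .S).faces = (colWbot w, pocketSWW w) := by
  obtain ⟨k, j⟩ := w; simp [pocketSWW, colWbot, Face.side, MidEdge.faces]; ring

/-- Faces of the western cell's `W` side. [cite: GlazmanManolescu2019, §1 (the lattice of rhombi and its mid-edges)] -/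
theorem pocketSWW_side_W_faces : ((pocketSWW w).side .W).faces = (((w.1 - 5, w.2 - 1) : Face), pocketSWW w) := by
  obtain ⟨k, j⟩ := w; simp [pocketSWW, Face.side, MidEdge.faces]; ring

/-- Faces of the western cell's `N` side. [cite: GlazmanManolescu2019, §1 (the lattice of rhombi and its mid-edges)] -/
theorem pocketSWW_side_N_faces : ((pocketSWW w).side .N).faces = (pocketSWW w, ((w.1 - 4, w.2) : Face)) := by
  obtain ⟨k, j⟩ := w; simp [pocketSWW, Face.side, MidEdge.faces]

/-- Faces of the dead end's `S` side. [cite: GlazmanManolescu2019, §1 (the lattice of rhombi and its mid-edges)] -/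
theorem colWbot_side_S_faces : ((colWbot w).side .S).faces = (((w.1 - 4, w.2 - 3) : Face), colWbot w) := by
  obtain ⟨k, j⟩ := w; simp [colWbot, Face.side, MidEdge.faces]; ring

/-- Faces of the dead end's `W` side. [cite: GlazmanManolescu2019, §1 (the lattice of rhombi and its mid-edges)] -/
theorem colWbot_side_W_faces : ((colWbot w).side .W).faces = (((w.1 - 5, w.2 - 2) : Face), colWbot w) := by
  obtain ⟨k, j⟩ := w; simp [colWbot, Face.side, MidEdge.faces]; ring

/-- Faces of the dead end's `E` side: the dead end and the kill cell. [cite: GlazmanManolescu2019, §1 (the lattice of rhombi and its mid-edges)] -/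
theorem colWbot_side_E_faces : ((colWbot w).side .E).faces = (colWbot w, killSW w) := by
  obtain ⟨k, j⟩ := w; simp [colWbot, killSW, Face.side, MidEdge.faces]; ring

/-- Faces of the dead end's `N` side. [cite: GlazmanManolescu2019, §1 (the lattice of rhombi and its mid-edges)] -/
theorem colWbot_side_N_faces : ((colWbot w).side .N).faces = (colWbot w, pocketSWW w) := by
  obtain ⟨k, j⟩ := w; simp [colWbot, pocketSWW, Face.side, MidEdge.faces]; ring

/-- No side of the far cell is a side of the western cell. [cite: GlazmanManolescu2019, §1 (the lattice of rhombi and its mid-edges)] -/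
theorem farW_side_ne_pocketSWW_side (s t : Side) : (farW w).side s ≠ (pocketSWW w).side t := by
  obtain ⟨k, j⟩ := w
  cases s <;> cases t <;> simp only [farW, pocketSWW, Face.side, ne_eq, MidEdge.vert.injEq, MidEdge.slant.injEq,
    reduceCtorEq, not_false_eq_true, not_and] <;> omega

/-- No side of the far cell is a side of the dead end. [cite: GlazmanManolescu2019, §1 (the lattice of rhombi and its mid-edges)] -/
theorem farW_side_ne_colWbot_side (s t : Side) : (farW w).side s ≠ (colWbot w).side t := by
  obtain ⟨k, j⟩ := w
  cases s <;> cases t <;> simp only [farW, colWbot, Face.side, ne_eq, MidEdge.vert.injEq, MidEdge.slant.injEq,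
    reduceCtorEq, not_false_eq_true, not_and] <;> omega

/-- The two crossable ray edges are distinct. [cite: GlazmanManolescu2019, §1 (the lattice of rhombi and its mid-edges)] -/
theorem pocketSW_side_N_ne_pocketSWW_side_N : (pocketSW w).side .N ≠ (pocketSWW w).side .N := by
  obtain ⟨k, j⟩ := w; simp [pocketSW, pocketSWW, Face.side]

end CellsV

namespace ΩG

variable {D : Set Face} {w : Face}

/-- A face having the mid-edge `e` as a side is one of the two faces of `e`. [cite: GlazmanManolescu2019, §1 (the lattice of rhombi and its mid-edges)] -/
private theorem face_of_side_eq' {F : Face} {s : Side} {e : MidEdge} (h : F.side s = e) : F = e.faces.1 ∨ F = e.faces.2 :=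
  (Face.exists_side_eq_iff F e).1 ⟨s, h⟩

/-- ★ **The crossing lemma, dead-end version (with parity).** Hole absent and the bottom line of the far cell's row
uncrossable for `x ≤ w.1 − 5`: the excursion polygon of a class-`B2a` walk at the far cell with first side `S` that
winds around the root crosses the top side of the pocket cell or the top side of the cell west of it — and NOT BOTH
(two crossings of the half-line would be an even count). [cite: CourantRobbins1958, Ch. V Appendix §2 (The Jordan Curve Theorem for Polygons: the even–odd rule)]
[cite: Glazman2015WeightedSAW, Lemma 3.1 (proof, pp. 6–7: the classes of walks through a rhombus)] -/
theorem exists_nth_eq_pocket_sides_of_AJ_ne_zero (hh : holeFaceW w ∉ D)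
    (hrow : ∀ x : ℤ, x ≤ w.1 - 5 → (x, w.2) ∉ D ∨ (x, w.2 - 1) ∉ D)
    (ω : ΩG D (w.side .W) (farW w)) (hr : RootedFace D (w.side .W) (farW w)) (h : ω.IsB2a)
    (hS : ω.2.firstSideG = .S) (hA : ω.AJ hr h (toC (midPt (w.side .W))) ≠ 0) :
    (∃ i, ω.2.firstHitG < i ∧ i + 1 < ω.2.arcs.length ∧
        (ω.2.nth (i + 1) = (pocketSW w).side .N ∨ ω.2.nth (i + 1) = (pocketSWW w).side .N)) ∧
      ¬((∃ i, ω.2.firstHitG ≤ i ∧ i < ω.2.arcs.length ∧ ω.2.nth (i + 1) = (pocketSW w).side .N) ∧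
        (∃ i, ω.2.firstHitG ≤ i ∧ i < ω.2.arcs.length ∧ ω.2.nth (i + 1) = (pocketSWW w).side .N)) := by
  classical
  have hodd := (ω.AJ_root_ne_zero_iff_odd_rayCountAt (hr := hr) h (b := w) (τ := .W) rfl).1 hA
  have hF := ω.fh_lt h
  set F := ω.2.firstHitG with hFdef
  set n := ω.2.arcs.length with hndef
  -- the exit edge of slot `j`
  have hexit : ∀ j < ω.Mv, (ω.jFace h j).side (ω.jOut hr h j) = ω.2.nth (F + j + 1) := by
    intro j hj
    have hjn : F + j < n := by unfold ΩG.Mv at hj; omega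
    by_cases hj0 : j = 0
    · subst hj0
      simp only [ΩG.jFace, ΩG.jOut, Nat.add_zero]
      exact (ω.2.exitSide_specG hr hF).1.symm
    · simp only [ΩG.jFace, ΩG.jOut, if_neg hj0]
      exact (ω.2.side_sIn_nth hjn).2.1
  -- every crossed ray edge is the top side of the pocket cell (`m = 2`) or of the western cell (`m = 3`)
  have hclass : ∀ j < ω.Mv, ∀ m : ℕ, ω.2.nth (F + j + 1) = rayMid w .W m →
      F < F + j ∧ F + j + 1 < n ∧
        (ω.2.nth (F + j + 1) = (pocketSW w).side .N ∨ ω.2.nth (F + j + 1) = (pocketSWW w).side .N) := by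
    intro j hj m hm
    have hjn : F + j < n := by unfold ΩG.Mv at hj; omega
    rw [rayMid_W_eq] at hm
    have hlast : F + j + 1 = n → m = 1 := by
      intro e
      rw [e, ω.2.nth_length] at hm
      have := (farW_side_eq_slant_row w hm).2
      omega
    have hm1 : m ≠ 1 := by
      rintro rfl
      have e : ω.2.nth (F + j + 1) = ω.2.nth F := by
        rw [hm, ω.2.nth_firstHitG, hS]
        obtain ⟨k, l⟩ := w
        simp only [farW, Face.side, MidEdge.slant.injEq, and_true]
        ring
      have := ω.2.nth_inj (by omega) hF.le e
      omega
    have hlt : F + j + 1 < n := by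
      rcases Nat.lt_or_ge (F + j + 1) n with hl | hl
      · exact hl
      · exact absurd (hlast (by omega)) hm1
    have hpos : F < F + j := by
      by_contra hle
      have ej : j = 0 := by omega
      subst ej
      have e2 := (ω.2.exitSide_specG hr hF).1
      rw [Nat.add_zero] at hm
      rw [hm] at e2
      have := (farW_side_eq_slant_row w e2.symm).2
      omega
    have hdoor := ω.2.door_nth (j := F + j + 1) (by omega) hlt
    rw [hm] at hdoor
    simp only [MidEdge.faces] at hdoor
    refine ⟨hpos, hlt, ?_⟩
    obtain rfl | rfl | rfl | rfl | hm4 : m = 0 ∨ m = 1 ∨ m = 2 ∨ m = 3 ∨ 4 ≤ m := by omega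
    · refine absurd ?_ hh
      have e : holeFaceW w = (w.1 - 1 - ((0 : ℕ) : ℤ), w.2) := by simp [holeFaceW]
      rw [e]; exact hdoor.2
    · exact absurd rfl hm1
    · left; rw [hm, pocketSW_side_N_eq]; push_cast; ring_nf
    · right; rw [hm, pocketSWW_side_N_eq]; push_cast; ring_nf
    · rcases hrow (w.1 - 1 - m) (by omega) with hx | hx
      · exact absurd hdoor.2 hx
      · exact absurd hdoor.1 hx
  -- the filter of crossing slots
  set S := (Finset.range ω.Mv).filter fun j => ∃ m : ℕ, (ω.jFace h j).side (ω.jOut hr h j) = rayMid w .W m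
    with hSdef
  have hcard : S.card = ω.rayCountAt hr h w .W := by unfold ΩG.rayCountAt; rfl
  have hmemS : ∀ j, j ∈ S ↔ j < ω.Mv ∧ ∃ m : ℕ, ω.2.nth (F + j + 1) = rayMid w .W m := by
    intro j
    rw [hSdef, Finset.mem_filter, Finset.mem_range]
    constructor
    · rintro ⟨hj, m, hm⟩; exact ⟨hj, m, by rw [← hexit j hj]; exact hm⟩
    · rintro ⟨hj, m, hm⟩; exact ⟨hj, m, by rw [hexit j hj]; exact hm⟩
  refine ⟨?_, ?_⟩
  · have hpos : 0 < S.card := by rw [hcard]; exact hodd.pos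
    obtain ⟨j, hj⟩ := Finset.card_pos.1 hpos
    obtain ⟨hjM, m, hm⟩ := (hmemS j).1 hj
    obtain ⟨h1, h2, h3⟩ := hclass j hjM m hm
    exact ⟨F + j, h1, h2, h3⟩
  · rintro ⟨⟨i₂, hi₂, hi₂n, e₂⟩, ⟨i₃, hi₃, hi₃n, e₃⟩⟩
    have hFM : F + ω.Mv = n := by unfold ΩG.Mv; omega
    have hj₂ : i₂ - F ∈ S := (hmemS _).2 ⟨by omega, 2, by
      rw [show F + (i₂ - F) + 1 = i₂ + 1 by omega, e₂, pocketSW_side_N_eq_rayMid]⟩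
    have hj₃ : i₃ - F ∈ S := (hmemS _).2 ⟨by omega, 3, by
      rw [show F + (i₃ - F) + 1 = i₃ + 1 by omega, e₃, pocketSWW_side_N_eq_rayMid]⟩
    have hne : i₂ - F ≠ i₃ - F := by
      intro e
      have ei : i₂ = i₃ := by omega
      rw [ei] at e₂
      exact pocketSW_side_N_ne_pocketSWW_side_N w (e₂.symm.trans e₃)
    have htwo : 2 ≤ S.card := Finset.one_lt_card.2 ⟨_, hj₂, _, hj₃, hne⟩
    have hle : S.card ≤ 2 := by
      calc S.card ≤ ({(pocketSW w).side .N, (pocketSWW w).side .N} : Finset MidEdge).card :=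
            Finset.card_le_card_of_injOn (fun j => ω.2.nth (F + j + 1)) (fun j hj => by
              obtain ⟨hjM, m, hm⟩ := (hmemS j).1 hj
              rcases (hclass j hjM m hm).2.2 with e | e <;> simp [e]) (fun j hj j' hj' e => by
              obtain ⟨hjM, -⟩ := (hmemS j).1 hj
              obtain ⟨hjM', -⟩ := (hmemS j').1 hj'
              have := ω.2.nth_inj (by omega) (by omega) e
              omega)
        _ ≤ 2 := Finset.card_le_two
    have h2 : S.card = 2 := le_antisymm hle htwo
    rw [hcard] at h2
    rw [h2] at hodd
    exact absurd hodd (by decide)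

/-- **The dead end carries no arc**: with the kill cell, the cell west of the dead end and the cell below it absent,
no arc of the walk at an interior index lies in `colWbot w`. [cite: Glazman2015WeightedSAW, Lemma 3.1 (proof, pp. 6–7)] -/
theorem fc_ne_colWbot (hK : killSW w ∉ D) (hW : ((w.1 - 5, w.2 - 2) : Face) ∉ D)
    (hB : ((w.1 - 4, w.2 - 3) : Face) ∉ D) (ω : ΩG D (w.side .W) (farW w)) {i : ℕ} (hi0 : 0 < i)
    (hi : i + 1 < ω.2.arcs.length) : ω.2.fc i ≠ colWbot w := by
  intro e
  obtain ⟨hin, hout, hne⟩ := ω.2.side_sIn_nth (i := i) (by omega)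
  rw [e] at hin hout
  have hdin := ω.2.door_nth (j := i) hi0 (by omega)
  have hdout := ω.2.door_nth (j := i + 1) (by omega) hi
  rw [← hin] at hdin
  rw [← hout] at hdout
  have key : ∀ s : Side, ((colWbot w).side s).faces.1 ∈ D ∧ ((colWbot w).side s).faces.2 ∈ D → s = .N := by
    intro s hs
    cases s
    · rw [colWbot_side_W_faces] at hs; exact absurd hs.1 hW
    · rw [colWbot_side_E_faces] at hs; exact absurd hs.2 hK
    · rw [colWbot_side_S_faces] at hs; exact absurd hs.1 hB
    · rfl
  exact hne ((key _ hdin).trans (key _ hdout).symm)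

/-- ★ **The pocket lemma, dead-end version.** Kill cell absent, column `w.1 − 5` absent on the rows `w.2 − 1`,
`w.2 − 2` and the row condition beyond, `(w.1 − 4, w.2 − 3)` absent: the excursion of such a walk has an arc in the cell
below the far cell with that cell's `W` side as an end. [cite: Glazman2015WeightedSAW, Lemma 3.1 (proof, pp. 6–7: the classes of walks through a rhombus)]
[cite: CourantRobbins1958, Ch. V Appendix §2 (The Jordan Curve Theorem for Polygons: the even–odd rule)] -/
theorem exists_excursion_arc_farSW_W_of_AJ_ne_zero_deadEnd (hh : holeFaceW w ∉ D)
    (hrow : ∀ x : ℤ, x ≤ w.1 - 5 → (x, w.2) ∉ D ∨ (x, w.2 - 1) ∉ D) (hK : killSW w ∉ D)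
    (hW1 : ((w.1 - 5, w.2 - 1) : Face) ∉ D) (hW2 : ((w.1 - 5, w.2 - 2) : Face) ∉ D)
    (hB : ((w.1 - 4, w.2 - 3) : Face) ∉ D)
    (ω : ΩG D (w.side .W) (farW w)) (hr : RootedFace D (w.side .W) (farW w)) (h : ω.IsB2a)
    (hS : ω.2.firstSideG = .S) (hA : ω.AJ hr h (toC (midPt (w.side .W))) ≠ 0) :
    ∃ k, ω.2.firstHitG < k ∧ k < ω.2.arcs.length ∧ ω.2.fc k = farSW w ∧ (ω.2.sIn k = .W ∨ ω.2.sOut k = .W) := by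
  obtain ⟨⟨i, hFi, hi1, hnth⟩, hnotboth⟩ := ω.exists_nth_eq_pocket_sides_of_AJ_ne_zero hh hrow hr h hS hA
  have hF := ω.fh_lt h
  have hfcF : ω.2.fc ω.2.firstHitG = farW w := (fc_fh ω hr h).1
  have hF1 : 1 ≤ ω.2.firstHitG := (ω.prefix_arc_farSW h hS).1
  set F := ω.2.firstHitG with hFdef
  set n := ω.2.arcs.length with hndef
  -- endpoint bookkeeping: the last edge is a side of the far cell
  have hlastP : ∀ t : Side, ω.2.nth n ≠ (pocketSW w).side t := by
    intro t; rw [ω.2.nth_length]; exact farW_side_ne_pocketSW_side w ω.1 t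
  have hlastW : ∀ t : Side, ω.2.nth n ≠ (pocketSWW w).side t := by
    intro t; rw [ω.2.nth_length]; exact farW_side_ne_pocketSWW_side w ω.1 t
  -- (a) an arc in the pocket cell with an end on its `N` side leaves/enters through `E` (towards the far cell's column):
  --     its `S` door is the kill cell, and a `W` end would run into the western cell and produce the second crossing
  have pocket_E : ∀ {k : ℕ}, F < k → k < n → ω.2.fc k = pocketSW w →
      (ω.2.sIn k = .N ∨ ω.2.sOut k = .N) → (ω.2.sIn k = .E ∨ ω.2.sOut k = .E) := by
    intro k hFk hkn hfk hN
    obtain ⟨hin, hout, hne⟩ := ω.2.side_sIn_nth hkn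
    rw [hfk] at hin hout
    -- the pocket's `N` edge is crossed at index `k` or `k + 1`: record the crossing for the parity clause
    have hcrossP : ∃ i, F ≤ i ∧ i < n ∧ ω.2.nth (i + 1) = (pocketSW w).side .N := by
      rcases hN with e | e
      · refine ⟨k - 1, by omega, by omega, ?_⟩
        rw [show k - 1 + 1 = k by omega, ← hin, e]
      · exact ⟨k, hFk.le, hkn, by rw [← hout, e]⟩
    -- the other end `t` of the arc
    have other : ∀ t : Side, t ≠ .N → ((pocketSW w).side t = ω.2.nth k ∨ (pocketSW w).side t = ω.2.nth (k + 1)) →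
        t = .E := by
      intro t htN ht
      -- that edge is a door (interior index)
      have hdoor : ((pocketSW w).side t).faces.1 ∈ D ∧ ((pocketSW w).side t).faces.2 ∈ D := by
        rcases ht with e | e
        · rw [e]; exact ω.2.door_nth (j := k) (by omega) hkn
        · have hk1 : k + 1 < n := by
            rcases Nat.lt_or_ge (k + 1) n with hl | hl
            · exact hl
            · exact absurd (by rw [show n = k + 1 by omega] ; exact e.symm) (hlastP t)
          rw [e]; exact ω.2.door_nth (j := k + 1) (by omega) hk1
      cases t
      · -- `W`: the arc continues into the western cell, which it must leave through its top side: a second crossing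
        exfalso
        rw [pocketSW_side_W_faces] at hdoor
        -- the index `k'` of the arc in the western cell adjacent to this edge
        have hWW : ∃ k', F < k' ∧ k' < n ∧ ω.2.fc k' = pocketSWW w ∧ (ω.2.sIn k' = .E ∨ ω.2.sOut k' = .E) := by
          rcases ht with e | e
          · -- entered the pocket from `W` at index `k`: arc `k - 1` lies in the western cell and exits `E`
            have hk0 : 1 ≤ k := by omega
            obtain ⟨-, hout', -⟩ := ω.2.side_sIn_nth (i := k - 1) (by omega)
            rw [show k - 1 + 1 = k by omega, ← e] at hout'
            have hf' := face_of_side_eq' hout'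
            rw [pocketSW_side_W_faces] at hf'
            simp only at hf'
            have hsucc : ω.2.fc (k - 1) ≠ ω.2.fc (k - 1 + 1) := YBWalk.fc_succ_ne (by omega)
            rw [show k - 1 + 1 = k by omega, hfk] at hsucc
            rcases hf' with e' | e'
            · refine ⟨k - 1, ?_, by omega, e', Or.inr (Face.side_injective (pocketSWW w) ?_)⟩
              · rcases Nat.lt_or_ge F (k - 1) with hl | hl
                · exact hl
                · exfalso
                  have eF : k - 1 = F := by omega
                  rw [eF, hfcF] at e'
                  obtain ⟨a, b⟩ := w
                  simp only [farW, pocketSWW, Prod.mk.injEq] at e'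
                  omega
              · rw [e'] at hout'; rw [hout', pocketSWW_side_E]
            · exact absurd e' hsucc
          · -- left the pocket through `W` at index `k + 1`: arc `k + 1` lies in the western cell, entered from `E`
            have hk1 : k + 1 < n := by
              rcases Nat.lt_or_ge (k + 1) n with hl | hl
              · exact hl
              · exact absurd (by rw [show n = k + 1 by omega]; exact e.symm) (hlastP .W)
            obtain ⟨hin', -, -⟩ := ω.2.side_sIn_nth (i := k + 1) hk1
            rw [← e] at hin'
            have hf' := face_of_side_eq' hin'
            rw [pocketSW_side_W_faces] at hf'
            simp only at hf'
            have hsucc : ω.2.fc k ≠ ω.2.fc (k + 1) := YBWalk.fc_succ_ne hk1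
            rw [hfk] at hsucc
            rcases hf' with e' | e'
            · refine ⟨k + 1, by omega, hk1, e', Or.inl (Face.side_injective (pocketSWW w) ?_)⟩
              rw [e'] at hin'; rw [hin', pocketSWW_side_E]
            · exact absurd e'.symm hsucc
        obtain ⟨k', hFk', hk'n, hfk', hE'⟩ := hWW
        -- the arc in the western cell: its other end is `N` (top side = second crossing), `S` (dead end) or `W` (absent)
        obtain ⟨hin', hout', hne'⟩ := ω.2.side_sIn_nth hk'n
        rw [hfk'] at hin' hout'
        have otherW : ∀ t : Side, t ≠ .E →
            ((pocketSWW w).side t = ω.2.nth k' ∨ (pocketSWW w).side t = ω.2.nth (k' + 1)) → t = .N := by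
          intro t htE ht'
          have hdoor' : ((pocketSWW w).side t).faces.1 ∈ D ∧ ((pocketSWW w).side t).faces.2 ∈ D := by
            rcases ht' with e | e
            · rw [e]; exact ω.2.door_nth (j := k') (by omega) hk'n
            · have hk1 : k' + 1 < n := by
                rcases Nat.lt_or_ge (k' + 1) n with hl | hl
                · exact hl
                · exact absurd (by rw [show n = k' + 1 by omega]; exact e.symm) (hlastW t)
              rw [e]; exact ω.2.door_nth (j := k' + 1) (by omega) hk1
          cases t
          · rw [pocketSWW_side_W_faces] at hdoor'; exact absurd hdoor'.1 hW1
          · exact absurd rfl htE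
          · -- `S`: into the dead end, which carries no arc
            exfalso
            rw [pocketSWW_side_S_faces] at hdoor'
            rcases ht' with e | e
            · -- entered from `S` at index `k'`: arc `k' - 1` lies in the dead end
              have hk0 : 1 ≤ k' := by omega
              obtain ⟨-, ho, -⟩ := ω.2.side_sIn_nth (i := k' - 1) (by omega)
              rw [show k' - 1 + 1 = k' by omega, ← e] at ho
              have hf' := face_of_side_eq' ho
              rw [pocketSWW_side_S_faces] at hf'
              simp only at hf'
              have hsucc : ω.2.fc (k' - 1) ≠ ω.2.fc (k' - 1 + 1) := YBWalk.fc_succ_ne (by omega)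
              rw [show k' - 1 + 1 = k' by omega, hfk'] at hsucc
              rcases hf' with e' | e'
              · exact ω.fc_ne_colWbot hK hW2 hB (i := k' - 1) (by omega) (by omega) e'
              · exact hsucc e'
            · have hk1 : k' + 1 < n := by
                rcases Nat.lt_or_ge (k' + 1) n with hl | hl
                · exact hl
                · exact absurd (by rw [show n = k' + 1 by omega]; exact e.symm) (hlastW .S)
              obtain ⟨hi', -, -⟩ := ω.2.side_sIn_nth (i := k' + 1) hk1
              rw [← e] at hi'
              have hf' := face_of_side_eq' hi'
              rw [pocketSWW_side_S_faces] at hf'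
              simp only at hf'
              have hsucc : ω.2.fc k' ≠ ω.2.fc (k' + 1) := YBWalk.fc_succ_ne hk1
              rw [hfk'] at hsucc
              rcases hf' with e' | e'
              · have hk2 : k' + 1 + 1 < n := by
                  rcases Nat.lt_or_ge (k' + 1 + 1) n with hl | hl
                  · exact hl
                  · exfalso
                    obtain ⟨-, ho, -⟩ := ω.2.side_sIn_nth (i := k' + 1) hk1
                    rw [e', show k' + 1 + 1 = n by omega, ω.2.nth_length] at ho
                    exact farW_side_ne_colWbot_side w ω.1 _ ho.symm
                exact ω.fc_ne_colWbot hK hW2 hB (i := k' + 1) (by omega) hk2 e'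
              · exact hsucc e'.symm
          · rfl
        -- so the other end is `N`: a crossing of the western cell's top side
        have hcrossW : ∃ i, F ≤ i ∧ i < n ∧ ω.2.nth (i + 1) = (pocketSWW w).side .N := by
          rcases hE' with e | e
          · -- entered from `E`, exits through `t = sOut`
            have ht := otherW (ω.2.sOut k') (fun h' => hne' (e.trans h'.symm)) (Or.inr (by rw [hout']))
            exact ⟨k', hFk'.le, hk'n, by rw [← hout', ht]⟩
          · have ht := otherW (ω.2.sIn k') (fun h' => hne' (h'.trans e.symm)) (Or.inl (by rw [hin']))
            refine ⟨k' - 1, by omega, by omega, ?_⟩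
            rw [show k' - 1 + 1 = k' by omega, ← hin', ht]
        exact hnotboth ⟨hcrossP, hcrossW⟩
      · rfl
      · rw [pocketSW_side_S_faces] at hdoor; exact absurd hdoor.1 hK
      · exact absurd rfl htN
    rcases hN with e | e
    · right; exact other _ (fun h' => hne (e.trans h'.symm)) (Or.inr (by rw [hout]))
    · left; exact other _ (fun h' => hne (h'.trans e.symm)) (Or.inl (by rw [hin]))
  -- (b) from an `E` end of a pocket arc to an arc in the cell below the far cell through `W`
  have toFarSW : ∀ {k : ℕ}, F < k → k < n → ω.2.fc k = pocketSW w → (ω.2.sIn k = .E ∨ ω.2.sOut k = .E) →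
      ∃ k', F < k' ∧ k' < n ∧ ω.2.fc k' = farSW w ∧ (ω.2.sIn k' = .W ∨ ω.2.sOut k' = .W) := by
    intro k hFk hkn hfk hE
    obtain ⟨hin, hout, hne⟩ := ω.2.side_sIn_nth hkn
    rw [hfk] at hin hout
    rcases hE with e | e
    · -- entered from `E` at index `k`: arc `k - 1` lies in `farSW w` and exits `W`
      have hk0 : 1 ≤ k := by omega
      rw [e] at hin
      obtain ⟨-, ho, -⟩ := ω.2.side_sIn_nth (i := k - 1) (by omega)
      rw [show k - 1 + 1 = k by omega, ← hin] at ho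
      have hf' := face_of_side_eq' ho
      rw [pocketSW_side_E_faces] at hf'
      simp only at hf'
      have hsucc : ω.2.fc (k - 1) ≠ ω.2.fc (k - 1 + 1) := YBWalk.fc_succ_ne (by omega)
      rw [show k - 1 + 1 = k by omega, hfk] at hsucc
      rcases hf' with e' | e'
      · exact absurd e' hsucc
      · refine ⟨k - 1, ?_, by omega, e', Or.inr (Face.side_injective (farSW w) ?_)⟩
        · rcases Nat.lt_or_ge F (k - 1) with hl | hl
          · exact hl
          · exfalso
            have eF : k - 1 = F := by omega
            rw [eF, hfcF] at e'
            exact farSW_ne_farW w e'.symm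
        · rw [e'] at ho; rw [ho, pocketSW_side_E]
    · -- exits through `E` at index `k + 1`: arc `k + 1` lies in `farSW w`, entered from `W`
      rw [e] at hout
      have hk1 : k + 1 < n := by
        rcases Nat.lt_or_ge (k + 1) n with hl | hl
        · exact hl
        · exact absurd (by rw [show n = k + 1 by omega]; exact hout.symm) (hlastP .E)
      obtain ⟨hi', -, -⟩ := ω.2.side_sIn_nth (i := k + 1) hk1
      rw [← hout] at hi'
      have hf' := face_of_side_eq' hi'
      rw [pocketSW_side_E_faces] at hf'
      simp only at hf'
      have hsucc : ω.2.fc k ≠ ω.2.fc (k + 1) := YBWalk.fc_succ_ne hk1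
      rw [hfk] at hsucc
      rcases hf' with e' | e'
      · exact absurd e'.symm hsucc
      · refine ⟨k + 1, by omega, hk1, e', Or.inl (Face.side_injective (farSW w) ?_)⟩
        rw [e'] at hi'; rw [hi', pocketSW_side_E]
  -- (c) the crossing
  rcases hnth with hnth | hnth
  · -- the pocket's top side: one of the arcs `i`, `i + 1` lies in the pocket with an `N` end
    obtain ⟨-, hout_i, -⟩ := ω.2.side_sIn_nth (i := i) (by omega)
    obtain ⟨hin_i1, -, -⟩ := ω.2.side_sIn_nth (i := i + 1) hi1
    rw [hnth] at hout_i hin_i1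
    have hfi := face_of_side_eq' hout_i
    have hfi1 := face_of_side_eq' hin_i1
    rw [pocketSW_side_N_faces] at hfi hfi1
    simp only at hfi hfi1
    have hsucc : ω.2.fc i ≠ ω.2.fc (i + 1) := YBWalk.fc_succ_ne hi1
    rcases hfi1 with e1 | e1
    · have hN : ω.2.sIn (i + 1) = .N := Face.side_injective (pocketSW w) (by rw [e1] at hin_i1; exact hin_i1)
      exact toFarSW (by omega) hi1 e1 (pocket_E (by omega) hi1 e1 (Or.inl hN))
    · have e0 : ω.2.fc i = pocketSW w := by
        rcases hfi with e | e
        · exact e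
        · exact absurd (e.trans e1.symm) hsucc
      have hN : ω.2.sOut i = .N := Face.side_injective (pocketSW w) (by rw [e0] at hout_i; exact hout_i)
      exact toFarSW hFi (by omega) e0 (pocket_E hFi (by omega) e0 (Or.inr hN))
  · -- the western cell's top side: one of the arcs `i`, `i + 1` lies in the western cell with an `N` end; its other
    -- end is `E` (`W` absent, `S` the dead end), i.e. the pocket's `W` side — and then the pocket arc has an `N` or
    -- `E` end; an `N` end is a second crossing, so it is `E`
    obtain ⟨-, hout_i, -⟩ := ω.2.side_sIn_nth (i := i) (by omega)
    obtain ⟨hin_i1, -, -⟩ := ω.2.side_sIn_nth (i := i + 1) hi1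
    rw [hnth] at hout_i hin_i1
    have hfi := face_of_side_eq' hout_i
    have hfi1 := face_of_side_eq' hin_i1
    rw [pocketSWW_side_N_faces] at hfi hfi1
    simp only at hfi hfi1
    have hsucc : ω.2.fc i ≠ ω.2.fc (i + 1) := YBWalk.fc_succ_ne hi1
    have hcrossW : ∃ i', F ≤ i' ∧ i' < n ∧ ω.2.nth (i' + 1) = (pocketSWW w).side .N := ⟨i, hFi.le, by omega, hnth⟩
    -- the index of the arc in the western cell and its `N` end
    have hk : ∃ k, F < k ∧ k < n ∧ ω.2.fc k = pocketSWW w ∧ (ω.2.sIn k = .N ∨ ω.2.sOut k = .N) := by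
      rcases hfi1 with e1 | e1
      · exact ⟨i + 1, by omega, hi1, e1, Or.inl (Face.side_injective (pocketSWW w) (by rw [e1] at hin_i1; exact hin_i1))⟩
      · have e0 : ω.2.fc i = pocketSWW w := by
          rcases hfi with e | e
          · exact e
          · exact absurd (e.trans e1.symm) hsucc
        exact ⟨i, hFi, by omega, e0, Or.inr (Face.side_injective (pocketSWW w) (by rw [e0] at hout_i; exact hout_i))⟩
    obtain ⟨k, hFk, hkn, hfk, hN⟩ := hk
    obtain ⟨hin, hout, hne⟩ := ω.2.side_sIn_nth hkn
    rw [hfk] at hin hout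
    -- the other end of that arc is `E`
    have otherW : ∀ t : Side, t ≠ .N →
        ((pocketSWW w).side t = ω.2.nth k ∨ (pocketSWW w).side t = ω.2.nth (k + 1)) → t = .E := by
      intro t htN ht
      have hdoor : ((pocketSWW w).side t).faces.1 ∈ D ∧ ((pocketSWW w).side t).faces.2 ∈ D := by
        rcases ht with e | e
        · rw [e]; exact ω.2.door_nth (j := k) (by omega) hkn
        · have hk1 : k + 1 < n := by
            rcases Nat.lt_or_ge (k + 1) n with hl | hl
            · exact hl
            · exact absurd (by rw [show n = k + 1 by omega]; exact e.symm) (hlastW t)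
          rw [e]; exact ω.2.door_nth (j := k + 1) (by omega) hk1
      cases t
      · rw [pocketSWW_side_W_faces] at hdoor; exact absurd hdoor.1 hW1
      · rfl
      · exfalso
        rcases ht with e | e
        · have hk0 : 1 ≤ k := by omega
          obtain ⟨-, ho, -⟩ := ω.2.side_sIn_nth (i := k - 1) (by omega)
          rw [show k - 1 + 1 = k by omega, ← e] at ho
          have hf' := face_of_side_eq' ho
          rw [pocketSWW_side_S_faces] at hf'
          simp only at hf'
          have hsucc' : ω.2.fc (k - 1) ≠ ω.2.fc (k - 1 + 1) := YBWalk.fc_succ_ne (by omega)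
          rw [show k - 1 + 1 = k by omega, hfk] at hsucc'
          rcases hf' with e' | e'
          · exact ω.fc_ne_colWbot hK hW2 hB (i := k - 1) (by omega) (by omega) e'
          · exact hsucc' e'
        · have hk1 : k + 1 < n := by
            rcases Nat.lt_or_ge (k + 1) n with hl | hl
            · exact hl
            · exact absurd (by rw [show n = k + 1 by omega]; exact e.symm) (hlastW .S)
          obtain ⟨hi', -, -⟩ := ω.2.side_sIn_nth (i := k + 1) hk1
          rw [← e] at hi'
          have hf' := face_of_side_eq' hi'
          rw [pocketSWW_side_S_faces] at hf'
          simp only at hf'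
          have hsucc' : ω.2.fc k ≠ ω.2.fc (k + 1) := YBWalk.fc_succ_ne hk1
          rw [hfk] at hsucc'
          rcases hf' with e' | e'
          · have hk2 : k + 1 + 1 < n := by
              rcases Nat.lt_or_ge (k + 1 + 1) n with hl | hl
              · exact hl
              · exfalso
                obtain ⟨-, ho, -⟩ := ω.2.side_sIn_nth (i := k + 1) hk1
                rw [e', show k + 1 + 1 = n by omega, ω.2.nth_length] at ho
                exact farW_side_ne_colWbot_side w ω.1 _ ho.symm
            exact ω.fc_ne_colWbot hK hW2 hB (i := k + 1) (by omega) hk2 e'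
          · exact hsucc' e'.symm
      · exact absurd rfl htN
    -- hence an arc in the pocket through its `W` side, at index `k - 1` or `k + 1`
    have hP : ∃ k', F < k' ∧ k' < n ∧ ω.2.fc k' = pocketSW w ∧ (ω.2.sIn k' = .W ∨ ω.2.sOut k' = .W) := by
      rcases hN with e | e
      · -- entered from `N`, exits `E` at index `k + 1`
        have ht := otherW (ω.2.sOut k) (fun h' => hne (e.trans h'.symm)) (Or.inr (by rw [hout]))
        rw [ht, pocketSWW_side_E] at hout
        have hk1 : k + 1 < n := by
          rcases Nat.lt_or_ge (k + 1) n with hl | hl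
          · exact hl
          · exact absurd (by rw [show n = k + 1 by omega]; exact hout.symm) (hlastP .W)
        obtain ⟨hi', -, -⟩ := ω.2.side_sIn_nth (i := k + 1) hk1
        rw [← hout] at hi'
        have hf' := face_of_side_eq' hi'
        rw [pocketSW_side_W_faces] at hf'
        simp only at hf'
        have hsucc' : ω.2.fc k ≠ ω.2.fc (k + 1) := YBWalk.fc_succ_ne hk1
        rw [hfk] at hsucc'
        rcases hf' with e' | e'
        · exact absurd e'.symm hsucc'
        · exact ⟨k + 1, by omega, hk1, e', Or.inl (Face.side_injective (pocketSW w) (by rw [e'] at hi'; exact hi'))⟩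
      · -- exits `N`, entered from `E` at index `k`
        have ht := otherW (ω.2.sIn k) (fun h' => hne (h'.trans e.symm)) (Or.inl (by rw [hin]))
        rw [ht, pocketSWW_side_E] at hin
        have hk0 : 1 ≤ k := by omega
        obtain ⟨-, ho, -⟩ := ω.2.side_sIn_nth (i := k - 1) (by omega)
        rw [show k - 1 + 1 = k by omega, ← hin] at ho
        have hf' := face_of_side_eq' ho
        rw [pocketSW_side_W_faces] at hf'
        simp only at hf'
        have hsucc' : ω.2.fc (k - 1) ≠ ω.2.fc (k - 1 + 1) := YBWalk.fc_succ_ne (by omega)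
        rw [show k - 1 + 1 = k by omega, hfk] at hsucc'
        rcases hf' with e' | e'
        · exact absurd e' hsucc'
        · refine ⟨k - 1, ?_, by omega, e', Or.inr (Face.side_injective (pocketSW w) (by rw [e'] at ho; exact ho))⟩
          rcases Nat.lt_or_ge F (k - 1) with hl | hl
          · exact hl
          · exfalso
            have eF : k - 1 = F := by omega
            rw [eF, hfcF] at e'
            obtain ⟨a, b⟩ := w
            simp only [farW, pocketSW, Prod.mk.injEq] at e'
            omega
    obtain ⟨k', hFk', hk'n, hfk', hW'⟩ := hP
    -- the pocket arc's other end: not `N` (second crossing), not `S` (kill cell), so `E`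
    obtain ⟨hin', hout', hne'⟩ := ω.2.side_sIn_nth hk'n
    rw [hfk'] at hin' hout'
    have otherP : ∀ t : Side, t ≠ .W →
        ((pocketSW w).side t = ω.2.nth k' ∨ (pocketSW w).side t = ω.2.nth (k' + 1)) → t = .E := by
      intro t htW ht
      have hdoor : ((pocketSW w).side t).faces.1 ∈ D ∧ ((pocketSW w).side t).faces.2 ∈ D := by
        rcases ht with e | e
        · rw [e]; exact ω.2.door_nth (j := k') (by omega) hk'n
        · have hk1 : k' + 1 < n := by
            rcases Nat.lt_or_ge (k' + 1) n with hl | hl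
            · exact hl
            · exact absurd (by rw [show n = k' + 1 by omega]; exact e.symm) (hlastP t)
          rw [e]; exact ω.2.door_nth (j := k' + 1) (by omega) hk1
      cases t
      · exact absurd rfl htW
      · rfl
      · rw [pocketSW_side_S_faces] at hdoor; exact absurd hdoor.1 hK
      · -- `N`: a crossing of the pocket's top side as well — two crossings
        exfalso
        refine hnotboth ⟨?_, hcrossW⟩
        rcases ht with e | e
        · refine ⟨k' - 1, by omega, by omega, ?_⟩
          rw [show k' - 1 + 1 = k' by omega, ← e]
        · exact ⟨k', hFk'.le, hk'n, e.symm⟩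
    have hE : ω.2.sIn k' = .E ∨ ω.2.sOut k' = .E := by
      rcases hW' with e | e
      · right; exact otherP _ (fun h' => hne' (e.trans h'.symm)) (Or.inr (by rw [hout']))
      · left; exact otherP _ (fun h' => hne' (h'.trans e.symm)) (Or.inl (by rw [hin']))
    exact toFarSW hFk' hk'n hfk' hE


/-- ★★ **The double co-corner from an excursion arc through the `W` side of the cell below the far cell** (the last
step of §4, isolated): first side `S` and such an arc force `kindsIn (farSW w) = [coCorner, coCorner]`.
[cite: GlazmanManolescu2019, §1, Fig. 1 (the local configurations; two (π−θ)-corner arcs weigh w₂)]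
[cite: Glazman2015WeightedSAW, Lemma 3.1 (proof, pp. 6–7: the classes of walks through a rhombus)] -/
theorem kindsIn_farSW_eq_of_excursion_arc_W (ω : ΩG D (w.side .W) (farW w)) (h : ω.IsB2a)
    (hS : ω.2.firstSideG = .S) {k : ℕ} (hFk : ω.2.firstHitG < k) (hkn : k < ω.2.arcs.length)
    (hfck : ω.2.fc k = farSW w) (hkW : ω.2.sIn k = .W ∨ ω.2.sOut k = .W) :
    ω.2.kindsIn (farSW w) = [.coCorner, .coCorner] := by
  obtain ⟨h1, hfcp, hpN⟩ := ω.prefix_arc_farSW h hS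
  set p := ω.2.firstHitG - 1 with hp
  have hpn : p < ω.2.arcs.length := by omega
  have hpk : p < k := by omega
  have hf : ω.2.fc k = ω.2.fc p := hfck.trans hfcp.symm
  obtain ⟨hopp, d1, d2, d3, d4⟩ := YBWalk.not_straight_of_two_arcs hpn hkn (by omega) hf
  obtain ⟨hopp', -, -, -, -⟩ := YBWalk.not_straight_of_two_arcs hkn hpn (by omega) hf.symm
  have hxN := (ω.2.side_sIn_nth hpn).2.2
  have hst := (ω.2.side_sIn_nth hkn).2.2
  rw [hpN] at hopp d2 d4 hxN
  obtain ⟨c1, c2⟩ := two_coCorners hxN hopp hst hopp' d1 d2 d3 d4 hkW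
  rw [← hpN] at c1
  rw [← hfcp]
  exact ω.2.kindsIn_eq_coCorner_coCorner hpn hkn hpk hf c1 c2

/-- ★★★ **THE STRUCTURAL UNDER-ROUTE `w₂`-KILL, dead-end version.** At the far cell of a hole root
(`W`-normalisation, hole `(w.1 − 1, w.2) ∉ D`), suppose the kill cell `K_S2 = (w.1 − 3, w.2 − 2)` is absent, the column
`w.1 − 5` is absent on the rows `w.2 − 1`, `w.2 − 2`, the cell `(w.1 − 4, w.2 − 3)` is absent, and the bottom line of the
far cell's row is uncrossable for `x ≤ w.1 − 5` (the cells `(w.1 − 4, w.2)`, `(w.1 − 4, w.2 − 1)`, `(w.1 − 4, w.2 − 2)` of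
the column west of the pocket may be present: the lane's boxes with the hole in column `3`). Then every WOUND
class-`B2a` under-walk at the far cell carries `kindsIn (farSW w) = [coCorner, coCorner]`.
[cite: GlazmanManolescu2019, §1, Fig. 1 and the paragraph of Fig. 2 («if θ = π/3, then w₂ = 0»)]
[cite: Glazman2015WeightedSAW, Lemma 3.1 (proof, pp. 6–7: the classes of walks through a rhombus)]
[cite: CourantRobbins1958, Ch. V Appendix §2 (The Jordan Curve Theorem for Polygons: the even–odd rule)] -/
theorem kindsIn_farSW_eq_of_wound_under_deadEnd (hh : holeFaceW w ∉ D)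
    (hrow : ∀ x : ℤ, x ≤ w.1 - 5 → (x, w.2) ∉ D ∨ (x, w.2 - 1) ∉ D) (hK : killSW w ∉ D)
    (hW1 : ((w.1 - 5, w.2 - 1) : Face) ∉ D) (hW2 : ((w.1 - 5, w.2 - 2) : Face) ∉ D)
    (hB : ((w.1 - 4, w.2 - 3) : Face) ∉ D)
    (ω : ΩG D (w.side .W) (farW w)) (hr : RootedFace D (w.side .W) (farW w)) (h : ω.IsB2a)
    (hS : ω.2.firstSideG = .S) {θ : ℝ}
    (hW : ω.WE (fun _ => θ) ≠ excursionWinding θ ω.2.firstSideG (ω.z1 hr h) ω.1) :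
    ω.2.kindsIn (farSW w) = [.coCorner, .coCorner] := by
  rcases ω.AJ_ne_zero_or_rev_of_wound hr h θ hW with hA | hA
  · obtain ⟨k, hFk, hkn, hfck, hkW⟩ :=
      ω.exists_excursion_arc_farSW_W_of_AJ_ne_zero_deadEnd hh hrow hK hW1 hW2 hB hr h hS hA
    exact ω.kindsIn_farSW_eq_of_excursion_arc_W h hS hFk hkn hfck hkW
  · have h' := ω.rev_isB2a hr h
    have hS' : (ω.rev hr).2.firstSideG = .S := (ω.rev_firstSide hr h).trans hS
    obtain ⟨k, hFk, hkn, hfck, hkW⟩ :=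
      (ω.rev hr).exists_excursion_arc_farSW_W_of_AJ_ne_zero_deadEnd hh hrow hK hW1 hW2 hB hr h' hS' hA
    have hk := (ω.rev hr).kindsIn_farSW_eq_of_excursion_arc_W h' hS' hFk hkn hfck hkW
    have hperm := ω.kindsIn_rev_perm hr h (farSW_ne_farW w)
    rw [hk] at hperm
    have hp : (ω.2.kindsIn (farSW w)).Perm (List.replicate 2 .coCorner) := hperm.symm
    exact List.perm_replicate.1 hp

/-- ★★★ The companion file's hypothesis `hS₂`, discharged in the dead-end geometry.
[cite: GlazmanManolescu2019, §1 (the paragraph of Fig. 2: «if θ = π/3, then w₂ = 0»)]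
[cite: CourantRobbins1958, Ch. V Appendix §2 (The Jordan Curve Theorem for Polygons: the even–odd rule)] -/
theorem under_killed_of_killSW_deadEnd (hh : holeFaceW w ∉ D)
    (hrow : ∀ x : ℤ, x ≤ w.1 - 5 → (x, w.2) ∉ D ∨ (x, w.2 - 1) ∉ D) (hK : killSW w ∉ D)
    (hW1 : ((w.1 - 5, w.2 - 1) : Face) ∉ D) (hW2 : ((w.1 - 5, w.2 - 2) : Face) ∉ D)
    (hB : ((w.1 - 4, w.2 - 3) : Face) ∉ D) (hr : RootedFace D (w.side .W) (farW w)) (θ : ℝ) :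
    ∀ (ω : ΩG D (w.side .W) (farW w)) (h : ω.IsB2a), ω.2.firstSideG = .S →
      ω.WE (fun _ => θ) ≠ excursionWinding θ ω.2.firstSideG (ω.z1 hr h) ω.1 → ¬ω.2.W2FreeOff (farW w) :=
  fun ω h hS hW => ω.not_W2FreeOff_farW_of_kindsIn_farSW
    (ω.kindsIn_farSW_eq_of_wound_under_deadEnd hh hrow hK hW1 hW2 hB hr h hS hW)

/-! ### The row-mirror twin of the dead-end version -/

/-- The reflection carries the cells of the western column to their northern twins. [cite: GlazmanManolescu2019, §4.2 (lattice symmetries)] -/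
theorem mirrorRowFace_col (w : Face) (x : ℤ) (d : ℤ) : mirrorRowFace w.2 (x, w.2 - d) = (x, w.2 + d) := by
  simp [mirrorRowFace]; ring

/-- ★★★ **THE STRUCTURAL OVER-ROUTE `w₁`-KILL, dead-end version** (row-mirror twin): northern kill cell
`K_N1 = (w.1 − 3, w.2 + 2)` absent, column `w.1 − 5` absent on the rows `w.2 + 1`, `w.2 + 2`, `(w.1 − 4, w.2 + 3)` absent,
top line uncrossable for `x ≤ w.1 − 5` ⇒ every wound over-walk has `kindsIn (farNW w) = [corner, corner]`.
[cite: GlazmanManolescu2019, §1, Fig. 1 and the remark after eq. (1) (θ ↔ π − θ exchanges w₁ and w₂)]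
[cite: Glazman2015WeightedSAW, Lemma 3.1 (proof, pp. 6–7: the classes of walks through a rhombus)]
[cite: CourantRobbins1958, Ch. V Appendix §2 (The Jordan Curve Theorem for Polygons: the even–odd rule)] -/
theorem kindsIn_farNW_eq_of_wound_over_deadEnd (hh : holeFaceW w ∉ D)
    (hrow : ∀ x : ℤ, x ≤ w.1 - 5 → (x, w.2) ∉ D ∨ (x, w.2 + 1) ∉ D) (hK : killNW w ∉ D)
    (hW1 : ((w.1 - 5, w.2 + 1) : Face) ∉ D) (hW2 : ((w.1 - 5, w.2 + 2) : Face) ∉ D)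
    (hB : ((w.1 - 4, w.2 + 3) : Face) ∉ D)
    (ω : ΩG D (w.side .W) (farW w)) (hr : RootedFace D (w.side .W) (farW w)) (h : ω.IsB2a)
    (hN : ω.2.firstSideG = .N) {θ : ℝ}
    (hW : ω.WE (fun _ => θ) ≠ excursionWinding θ ω.2.firstSideG (ω.z1 hr h) ω.1) :
    ω.2.kindsIn (farNW w) = [.corner, .corner] := by
  have hr' := rootedFace_rowMirrorDom w hr
  have h' := ω.mirrorFar_isB2a hr h
  have hh' : holeFaceW w ∉ rowMirrorDom w D := by rwa [mem_rowMirrorDom, mirrorRowFace_holeFaceW]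
  have hK' : killSW w ∉ rowMirrorDom w D := by rwa [mem_rowMirrorDom, mirrorRowFace_killSW]
  have hW1' : ((w.1 - 5, w.2 - 1) : Face) ∉ rowMirrorDom w D := by rwa [mem_rowMirrorDom, mirrorRowFace_col]
  have hW2' : ((w.1 - 5, w.2 - 2) : Face) ∉ rowMirrorDom w D := by rwa [mem_rowMirrorDom, mirrorRowFace_col]
  have hB' : ((w.1 - 4, w.2 - 3) : Face) ∉ rowMirrorDom w D := by rwa [mem_rowMirrorDom, mirrorRowFace_col]
  have hrow' : ∀ x : ℤ, x ≤ w.1 - 5 → (x, w.2) ∉ rowMirrorDom w D ∨ (x, w.2 - 1) ∉ rowMirrorDom w D := by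
    intro x hx
    rw [mem_rowMirrorDom, mem_rowMirrorDom, mirrorRowFace_row, mirrorRowFace_row_pred]
    exact hrow x hx
  have hS' : ω.mirrorFar.2.firstSideG = .S := by rw [mirrorFar_firstSideG, hN]; rfl
  have hk := ω.mirrorFar.kindsIn_farSW_eq_of_wound_under_deadEnd hh' hrow' hK' hW1' hW2' hB' hr' h' hS'
    (ω.mirrorFar_wound hr h hW)
  obtain ⟨i, j, hij, hj, hfi, hfj⟩ :=
    ω.mirrorFar.2.exists_two_arcs_of_two_le_length_kindsIn (f := farSW w) (by rw [hk]; simp)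
  have hn := ω.mirrorFar_length
  have hi0 : i < ω.2.arcs.length := by omega
  have hj0 : j < ω.2.arcs.length := by omega
  have hface : ∀ {m : ℕ}, m < ω.2.arcs.length → ω.mirrorFar.2.fc m = farSW w → ω.2.fc m = farNW w := by
    intro m hm e
    have e1 := ω.mirrorFar_fc hm
    rw [e] at e1
    have e2 := congrArg (mirrorRowFace w.2) e1
    rw [mirrorRowFace_farSW, mirrorRowFace_mirrorRowFace] at e2
    exact e2.symm
  have hkind : ∀ {m : ℕ}, m < ω.2.arcs.length → ω.mirrorFar.2.fc m = farSW w →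
      arcKind (ω.2.sIn m) (ω.2.sOut m) = .corner := by
    intro m hm e
    have hmem := ω.mirrorFar.2.arcKind_mem_kindsIn (i := m) (by omega)
    obtain ⟨e1, e2⟩ := ω.mirrorFar_sIn_sOut hm
    rw [e, hk, e1, e2, arcKind_mirrorSide] at hmem
    have e3 : mirrorKind (arcKind (ω.2.sIn m) (ω.2.sOut m)) = .coCorner := by simpa using hmem
    have e4 := congrArg mirrorKind e3
    rw [mirrorKind_mirrorKind] at e4
    exact e4
  have hfci := hface hi0 hfi
  have hfcj := hface hj0 hfj
  rw [← hfci]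
  exact ω.2.kindsIn_eq_corner_corner hi0 hj0 hij (hfcj.trans hfci.symm) (hkind hi0 hfi) (hkind hj0 hfj)

/-- ★★★ The companion file's hypothesis `hN₁`, discharged in the dead-end geometry.
[cite: GlazmanManolescu2019, §1, remark after eq. (1)]
[cite: CourantRobbins1958, Ch. V Appendix §2 (The Jordan Curve Theorem for Polygons: the even–odd rule)] -/
theorem over_killed_of_killNW_deadEnd (hh : holeFaceW w ∉ D)
    (hrow : ∀ x : ℤ, x ≤ w.1 - 5 → (x, w.2) ∉ D ∨ (x, w.2 + 1) ∉ D) (hK : killNW w ∉ D)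
    (hW1 : ((w.1 - 5, w.2 + 1) : Face) ∉ D) (hW2 : ((w.1 - 5, w.2 + 2) : Face) ∉ D)
    (hB : ((w.1 - 4, w.2 + 3) : Face) ∉ D) (hr : RootedFace D (w.side .W) (farW w)) (θ : ℝ) :
    ∀ (ω : ΩG D (w.side .W) (farW w)) (h : ω.IsB2a), ω.2.firstSideG = .N →
      ω.WE (fun _ => θ) ≠ excursionWinding θ ω.2.firstSideG (ω.z1 hr h) ω.1 → ¬ω.2.W1FreeOff (farW w) := by
  intro ω h hN hW hfree
  have hk := ω.kindsIn_farNW_eq_of_wound_over_deadEnd hh hrow hK hW1 hW2 hB hr h hN hW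
  have hmem : farNW w ∈ ω.2.facesVisited := by
    by_contra hn
    rw [YBWalk.kindsIn_eq_nil hn] at hk
    exact List.cons_ne_nil _ _ hk.symm
  exact hfree _ hmem (farNW_ne_farW w) hk

end ΩG

end Literature.Probability.RandomPlanarGeometry.SAW.YangBaxter

/-! ### The far-cell defect in the dead-end geometry -/

namespace Literature.Barriers.CriticalPhenomena.PlaquetteWalk

open Literature.Probability.RandomPlanarGeometry.SAW.YangBaxter
open Real Complex

/-- ★★★★ **THE KILL-FORCED ZERO WITH BOTH KILLS STRUCTURAL, dead-end geometry** — the lane's boxes with the hole in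
column `3` (`6×5 ∖ (3,2)` and its relatives with the two corner cells `K_S2`, `K_N1` removed, e.g. the asymmetric
`6×5 ∖ {(3,2),(1,0),(1,4),(0,1)}` of the companion file's docstring, whose zero `θ* ∈ [0.50557π, 0.50570π]` is off the
mirror point): hole, both kill cells `(w.1 − 3, w.2 ∓ 2)`, column `w.1 − 5` absent on the five rows `w.2 − 2 … w.2 + 2`
(as two row conditions and four cells), `(w.1 − 4, w.2 ∓ 3)` absent, ONE `w₂`-free wound over-walk and ONE `w₁`-free
wound under-walk ⇒ an exact zero of the Yang–Baxter vertex functional of the hole root in `(π/3, 2π/3)`.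
[cite: GlazmanManolescu2019, Lemma 2.1 (statement, "in the form given in [Gl]")]
[cite: GlazmanManolescu2019, §1 (the paragraph of Fig. 2 and the remark after eq. (1))]
[cite: Glazman2015WeightedSAW, Lemma 3.1 (proof, pp. 6–7)] [cite: DuminilCopinSmirnov2012, proof of Lemma 1]
[cite: CourantRobbins1958, Ch. V Appendix §2 (The Jordan Curve Theorem for Polygons: the even–odd rule)] -/
theorem vertexFunctional_printed_farCellW_exists_eq_zero_Ioo_of_kills_deadEnd (Dl : List Face) (w : Face)
    (hf : farW w ∈ Dl) (hh : holeFaceW w ∉ dom Dl) (hr : RootedFace (dom Dl) (w.side .W) (farW w))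
    (hKS : killSW w ∉ dom Dl) (hKN : killNW w ∉ dom Dl)
    (hrowS : ∀ x : ℤ, x ≤ w.1 - 5 → (x, w.2) ∉ dom Dl ∨ (x, w.2 - 1) ∉ dom Dl)
    (hrowN : ∀ x : ℤ, x ≤ w.1 - 5 → (x, w.2) ∉ dom Dl ∨ (x, w.2 + 1) ∉ dom Dl)
    (hS1 : ((w.1 - 5, w.2 - 1) : Face) ∉ dom Dl) (hS2 : ((w.1 - 5, w.2 - 2) : Face) ∉ dom Dl)
    (hN1 : ((w.1 - 5, w.2 + 1) : Face) ∉ dom Dl) (hN2 : ((w.1 - 5, w.2 + 2) : Face) ∉ dom Dl)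
    (hBS : ((w.1 - 4, w.2 - 3) : Face) ∉ dom Dl) (hBN : ((w.1 - 4, w.2 + 3) : Face) ∉ dom Dl)
    (hN₂ : ∃ (ω : ΩG (dom Dl) (w.side .W) (farW w)) (h : ω.IsB2a), ω.2.firstSideG = .N ∧
      ω.WE (fun _ => π / 3) ≠ excursionWinding (π / 3) ω.2.firstSideG (ω.z1 hr h) ω.1 ∧ ω.2.W2FreeOff (farW w))
    (hS₁ : ∃ (ω : ΩG (dom Dl) (w.side .W) (farW w)) (h : ω.IsB2a), ω.2.firstSideG = .S ∧
      ω.WE (fun _ => 2 * π / 3) ≠ excursionWinding (2 * π / 3) ω.2.firstSideG (ω.z1 hr h) ω.1 ∧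
        ω.2.W1FreeOff (farW w)) :
    ∃ θ ∈ Set.Ioo (π / 3) (2 * π / 3),
      vertexFunctional (printedWeights θ) tFiveEighths (ybCoeff θ) Dl (w.side .W) (farW w) = 0 :=
  vertexFunctional_printed_farCellW_exists_eq_zero_Ioo_of_opposite_kills Dl w hf hh hr
    (ΩG.under_killed_of_killSW_deadEnd hh hrowS hKS hS1 hS2 hBS hr (π / 3)) hN₂
    (ΩG.over_killed_of_killNW_deadEnd hh hrowN hKN hN1 hN2 hBN hr (2 * π / 3)) hS₁

/-- ★★★ The structural honeycomb sign, dead-end geometry: `Im VF(π/3) > 0` from ONE `w₂`-free wound over-walk.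
[cite: GlazmanManolescu2019, Lemma 2.1 (statement, "in the form given in [Gl]")]
[cite: GlazmanManolescu2019, §1 (the paragraph of Fig. 2: «if θ = π/3, then w₂ = 0»)] -/
theorem im_vertexFunctional_printed_farCellW_pi_div_three_pos_of_killSW_deadEnd (Dl : List Face) (w : Face)
    (hf : farW w ∈ Dl) (hh : holeFaceW w ∉ dom Dl) (hr : RootedFace (dom Dl) (w.side .W) (farW w))
    (hK : killSW w ∉ dom Dl) (hrow : ∀ x : ℤ, x ≤ w.1 - 5 → (x, w.2) ∉ dom Dl ∨ (x, w.2 - 1) ∉ dom Dl)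
    (hW1 : ((w.1 - 5, w.2 - 1) : Face) ∉ dom Dl) (hW2 : ((w.1 - 5, w.2 - 2) : Face) ∉ dom Dl)
    (hB : ((w.1 - 4, w.2 - 3) : Face) ∉ dom Dl)
    (hN : ∃ (ω : ΩG (dom Dl) (w.side .W) (farW w)) (h : ω.IsB2a), ω.2.firstSideG = .N ∧
      ω.WE (fun _ => π / 3) ≠ excursionWinding (π / 3) ω.2.firstSideG (ω.z1 hr h) ω.1 ∧ ω.2.W2FreeOff (farW w)) :
    0 < (vertexFunctional (printedWeights (π / 3)) tFiveEighths (ybCoeff (π / 3)) Dl (w.side .W) (farW w)).im :=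
  im_vertexFunctional_printed_farCellW_pi_div_three_pos_of_under_killed Dl w hf hh hr
    (ΩG.under_killed_of_killSW_deadEnd hh hrow hK hW1 hW2 hB hr (π / 3)) hN

/-- ★★★ The structural dual sign, dead-end geometry: `Im VF(2π/3) < 0` from ONE `w₁`-free wound under-walk.
[cite: GlazmanManolescu2019, Lemma 2.1 (statement, "in the form given in [Gl]")] [cite: GlazmanManolescu2019, §1, remark after eq. (1)] -/
theorem im_vertexFunctional_printed_farCellW_two_pi_div_three_neg_of_killNW_deadEnd (Dl : List Face) (w : Face)
    (hf : farW w ∈ Dl) (hh : holeFaceW w ∉ dom Dl) (hr : RootedFace (dom Dl) (w.side .W) (farW w))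
    (hK : killNW w ∉ dom Dl) (hrow : ∀ x : ℤ, x ≤ w.1 - 5 → (x, w.2) ∉ dom Dl ∨ (x, w.2 + 1) ∉ dom Dl)
    (hW1 : ((w.1 - 5, w.2 + 1) : Face) ∉ dom Dl) (hW2 : ((w.1 - 5, w.2 + 2) : Face) ∉ dom Dl)
    (hB : ((w.1 - 4, w.2 + 3) : Face) ∉ dom Dl)
    (hS : ∃ (ω : ΩG (dom Dl) (w.side .W) (farW w)) (h : ω.IsB2a), ω.2.firstSideG = .S ∧
      ω.WE (fun _ => 2 * π / 3) ≠ excursionWinding (2 * π / 3) ω.2.firstSideG (ω.z1 hr h) ω.1 ∧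
        ω.2.W1FreeOff (farW w)) :
    (vertexFunctional (printedWeights (2 * π / 3)) tFiveEighths (ybCoeff (2 * π / 3)) Dl (w.side .W)
      (farW w)).im < 0 :=
  im_vertexFunctional_printed_farCellW_two_pi_div_three_neg_of_over_killed Dl w hf hh hr
    (ΩG.over_killed_of_killNW_deadEnd hh hrow hK hW1 hW2 hB hr (2 * π / 3)) hS

end Literature.Barriers.CriticalPhenomena.PlaquetteWalk

/-! ## §10 (edition 4) The EAST pair for the DIRECT under route: the structural `w₁`-kill below the root plaquette

The remaining two rows of the lane's corner-kill table concern the cells east of the ROOT PLAQUETTE `w`: the kill cell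
`K_S1 = (w.1 + 1, w.2 − 2)` (under route, `w₁`) and its row mirror `K_N2 = (w.1 + 1, w.2 + 2)` (over route, `w₂`). The
half-line used here is the one running EAST from the root along the bottom line of the root row (presentation
`(holeFaceW w, E)` of the root edge, `ExcursionJordan.AJ_root_ne_zero_iff_odd_rayCountAt` again): its crossable edges are
the bottom side of `w` itself (`= (rootS w).side N`) and the top side of the eastern pocket `pocketSE w = (w.1 + 1, w.2 − 1)`;
beyond, the row is assumed uncrossable. This edition settles the DIRECT under route — the walks whose first arc leaves
the root plaquette through its `S` side (`nth 1 = w.side S`; in the lane's census boxes every wound under-walk is of this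
kind, see the docstring's scope note): then the root plaquette's bottom side is a prefix edge, the odd crossing is the
pocket's top side, the pocket's only other door is the `E` side of `rootS w`, and the prefix arc `{N, W}` plus the
excursion arc `{S, E}` of `rootS w` are its two `θ`-corners. (For a prefix leaving `w` through `E` the same argument puts
the double corner in `(w.1 + 1, w.2)`, for one leaving through `N` and an excursion through `w` in `w` itself; the last
configuration — prefix north, excursion avoiding `w` — needs a separation argument for the prefix loop and is not typed.) -/

namespace Literature.Probability.RandomPlanarGeometry.SAW.YangBaxter

open Real
open Literature.Barriers.CriticalPhenomena.PlaquetteWalk (mirrorRow mirrorRowFace mirrorSide mirrorKind mirrorArc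
  mirrorRow_side arcsOf_map_mirrorRow arcKind_mirrorSide mirrorRowFace_mirrorRowFace mirrorSide_mirrorSide
  mirrorKind_mirrorKind)

open private fc_fh rev_snd_nth from Literature.Probability.RandomPlanarGeometry.YangBaxterSAWGeneralDomain

section CellsE

variable (w : Face)

/-- The EASTERN POCKET `(w.1 + 1, w.2 − 1)`: east of the cell below the root plaquette. [cite: GlazmanManolescu2019, §1 (the lattice of rhombi and its mid-edges)] -/
def pocketSE : Face := (w.1 + 1, w.2 - 1)

/-- The eastern KILL CELL `K_S1 = (w.1 + 1, w.2 − 2)` below the eastern pocket. [cite: GlazmanManolescu2019, §1 (the lattice of rhombi and its mid-edges)] -/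
def killSE : Face := (w.1 + 1, w.2 - 2)

/-- The cell `(w.1 + 2, w.2 − 1)` east of the eastern pocket. [cite: GlazmanManolescu2019, §1 (the lattice of rhombi and its mid-edges)] -/
def pocketSEE : Face := (w.1 + 2, w.2 - 1)

/-- The cell `(w.1 + 1, w.2)` east of the root plaquette. [cite: GlazmanManolescu2019, §1 (the lattice of rhombi and its mid-edges)] -/
def rootE : Face := (w.1 + 1, w.2)

/-- The northern twins: `(w.1 + 1, w.2 + 1)`, `K_N2 = (w.1 + 1, w.2 + 2)`, `(w.1 + 2, w.2 + 1)`. [cite: GlazmanManolescu2019, §1 (the lattice of rhombi and its mid-edges)] -/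
def pocketNE : Face := (w.1 + 1, w.2 + 1)

/-- The eastern kill cell of the over route, `K_N2 = (w.1 + 1, w.2 + 2)`. [cite: GlazmanManolescu2019, §1 (the lattice of rhombi and its mid-edges)] -/
def killNE : Face := (w.1 + 1, w.2 + 2)

/-- The cell `(w.1 + 2, w.2 + 1)` east of the north-eastern pocket. [cite: GlazmanManolescu2019, §1 (the lattice of rhombi and its mid-edges)] -/
def pocketNEE : Face := (w.1 + 2, w.2 + 1)

/-- The ray behind the root running EAST: its `m`-th edge is the bottom side of the cell `m` columns east of `w`.
[cite: CourantRobbins1958, Ch. V Appendix §2 (The Jordan Curve Theorem for Polygons: the even–odd rule)] -/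
theorem rayMid_holeFaceW_E_eq (m : ℕ) : rayMid (holeFaceW w) .E m = MidEdge.slant (w.1 + m) w.2 := by
  obtain ⟨k, j⟩ := w
  simp only [rayMid, rayCell, raySide, holeFaceW, Face.side, MidEdge.slant.injEq, and_true]
  ring

/-- `w.S` is the ray edge `m = 0`. [cite: CourantRobbins1958, Ch. V Appendix §2 (the even–odd rule)] -/
theorem root_side_S_eq_rayMid : w.side .S = rayMid (holeFaceW w) .E 0 := by
  rw [rayMid_holeFaceW_E_eq]; obtain ⟨k, j⟩ := w; simp [Face.side]

/-- The eastern pocket's top side is the ray edge `m = 1`. [cite: CourantRobbins1958, Ch. V Appendix §2 (the even–odd rule)] -/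
theorem pocketSE_side_N_eq_rayMid : (pocketSE w).side .N = rayMid (holeFaceW w) .E 1 := by
  rw [rayMid_holeFaceW_E_eq]; obtain ⟨k, j⟩ := w; simp [pocketSE, Face.side]

/-- `w.S = rootS.N`. [cite: GlazmanManolescu2019, §1 (the lattice of rhombi and its mid-edges)] -/
theorem root_side_S_eq_rootS_side_N : w.side .S = (rootS w).side .N := by
  obtain ⟨k, j⟩ := w; simp [rootS, Face.side]

/-- `pocketSE.N = rootE.S`. [cite: GlazmanManolescu2019, §1 (the lattice of rhombi and its mid-edges)] -/
theorem pocketSE_side_N_eq : (pocketSE w).side .N = MidEdge.slant (w.1 + 1) w.2 := by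
  obtain ⟨k, j⟩ := w; simp [pocketSE, Face.side]

/-- `pocketSE.W = rootS.E`. [cite: GlazmanManolescu2019, §1 (the lattice of rhombi and its mid-edges)] -/
theorem pocketSE_side_W : (pocketSE w).side .W = (rootS w).side .E := by
  obtain ⟨k, j⟩ := w; simp [pocketSE, rootS, Face.side]

/-- Faces of the eastern pocket's `N` side. [cite: GlazmanManolescu2019, §1 (the lattice of rhombi and its mid-edges)] -/
theorem pocketSE_side_N_faces : ((pocketSE w).side .N).faces = (pocketSE w, rootE w) := by
  obtain ⟨k, j⟩ := w; simp [pocketSE, rootE, Face.side, MidEdge.faces]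

/-- Faces of the eastern pocket's `S` side. [cite: GlazmanManolescu2019, §1 (the lattice of rhombi and its mid-edges)] -/
theorem pocketSE_side_S_faces : ((pocketSE w).side .S).faces = (killSE w, pocketSE w) := by
  obtain ⟨k, j⟩ := w; simp [pocketSE, killSE, Face.side, MidEdge.faces]; ring

/-- Faces of the eastern pocket's `E` side. [cite: GlazmanManolescu2019, §1 (the lattice of rhombi and its mid-edges)] -/
theorem pocketSE_side_E_faces : ((pocketSE w).side .E).faces = (pocketSE w, pocketSEE w) := by
  obtain ⟨k, j⟩ := w; simp [pocketSE, pocketSEE, Face.side, MidEdge.faces]; ring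

/-- Faces of the eastern pocket's `W` side. [cite: GlazmanManolescu2019, §1 (the lattice of rhombi and its mid-edges)] -/
theorem pocketSE_side_W_faces : ((pocketSE w).side .W).faces = (rootS w, pocketSE w) := by
  obtain ⟨k, j⟩ := w; simp [pocketSE, rootS, Face.side, MidEdge.faces]

/-- Faces of the root plaquette's bottom side. [cite: GlazmanManolescu2019, §1 (the lattice of rhombi and its mid-edges)] -/
theorem root_side_S_faces : (w.side .S).faces = (rootS w, w) := by
  obtain ⟨k, j⟩ := w; simp [rootS, Face.side, MidEdge.faces]

/-- No side of the far cell lies on the root row's bottom line east of the hole. [cite: GlazmanManolescu2019, §1 (the lattice of rhombi and its mid-edges)] -/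
theorem farW_side_ne_slant_east (s : Side) (m : ℕ) : (farW w).side s ≠ MidEdge.slant (w.1 + m) w.2 := by
  intro h
  have := (farW_side_eq_slant_row w h).2
  omega

/-- No side of the far cell is a side of the eastern pocket. [cite: GlazmanManolescu2019, §1 (the lattice of rhombi and its mid-edges)] -/
theorem farW_side_ne_pocketSE_side (s t : Side) : (farW w).side s ≠ (pocketSE w).side t := by
  obtain ⟨k, j⟩ := w
  cases s <;> cases t <;> simp only [farW, pocketSE, Face.side, ne_eq, MidEdge.vert.injEq, MidEdge.slant.injEq,
    reduceCtorEq, not_false_eq_true, not_and] <;> omega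

/-- The far cell is not the cell below the root plaquette. [cite: GlazmanManolescu2019, §1 (the lattice of rhombi and its mid-edges)] -/
theorem rootS_ne_farW : rootS w ≠ farW w := by
  obtain ⟨k, j⟩ := w
  simp only [rootS, farW, ne_eq, Prod.mk.injEq, not_and]
  omega

/-- The two crossable eastern ray edges are distinct. [cite: GlazmanManolescu2019, §1 (the lattice of rhombi and its mid-edges)] -/
theorem root_side_S_ne_pocketSE_side_N : w.side .S ≠ (pocketSE w).side .N := by
  obtain ⟨k, j⟩ := w; simp [pocketSE, Face.side]

/-- The faces of the root edge: the hole and the root plaquette. [cite: GlazmanManolescu2019, §1 (the lattice of rhombi and its mid-edges)] -/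
theorem root_faces : (w.side .W).faces = (holeFaceW w, w) := by
  obtain ⟨k, j⟩ := w; simp [holeFaceW, Face.side, MidEdge.faces]

/-- The first arc of a walk from the root lies in the root plaquette when the hole is absent.
[cite: Glazman2015WeightedSAW, Lemma 3.1 (proof, pp. 6–7)] -/
theorem fc_zero_eq_root {D : Set Face} {z : MidEdge} (hh : holeFaceW w ∉ D) (γ : YBWalk D (w.side .W) z)
    (hn : 0 < γ.arcs.length) : γ.fc 0 = w := by
  obtain ⟨hin, -, -⟩ := γ.side_sIn_nth hn
  rw [γ.nth_zero] at hin
  have hf := (Face.exists_side_eq_iff (γ.fc 0) (w.side .W)).1 ⟨_, hin⟩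
  have hD := (YBWalk.arcFace_arcAt hn).2
  rw [root_faces] at hf
  simp only at hf
  rcases hf with e | e
  · rw [e] at hD; exact absurd hD hh
  · exact e

/-- No side of the far cell is a side of the cell below the root plaquette. [cite: GlazmanManolescu2019, §1 (the lattice of rhombi and its mid-edges)] -/
theorem farW_side_ne_rootS_side (s t : Side) : (farW w).side s ≠ (rootS w).side t := by
  obtain ⟨k, j⟩ := w
  cases s <;> cases t <;> simp only [farW, rootS, Face.side, ne_eq, MidEdge.vert.injEq, MidEdge.slant.injEq,
    reduceCtorEq, not_false_eq_true, not_and] <;> omega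

end CellsE

namespace ΩG

variable {D : Set Face} {w : Face}

/-- A face having the mid-edge `e` as a side is one of the two faces of `e`. [cite: GlazmanManolescu2019, §1 (the lattice of rhombi and its mid-edges)] -/
private theorem face_of_side_eqE {F : Face} {s : Side} {e : MidEdge} (h : F.side s = e) : F = e.faces.1 ∨ F = e.faces.2 :=
  (Face.exists_side_eq_iff F e).1 ⟨s, h⟩

/-- ★ **The eastern crossing lemma (with parity).** Hole absent and the bottom line of the root row uncrossable for
`x ≥ w.1 + 2`: the excursion polygon of a class-`B2a` walk at the far cell that winds around the root crosses the bottom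
side of the root plaquette or the top side of the eastern pocket — and NOT BOTH.
[cite: CourantRobbins1958, Ch. V Appendix §2 (The Jordan Curve Theorem for Polygons: the even–odd rule)]
[cite: Glazman2015WeightedSAW, Lemma 3.1 (proof, pp. 6–7: the classes of walks through a rhombus)] -/
theorem exists_nth_eq_east_sides_of_AJ_ne_zero (hh : holeFaceW w ∉ D)
    (hrow : ∀ x : ℤ, w.1 + 2 ≤ x → (x, w.2) ∉ D ∨ (x, w.2 - 1) ∉ D)
    (ω : ΩG D (w.side .W) (farW w)) (hr : RootedFace D (w.side .W) (farW w)) (h : ω.IsB2a)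
    (hA : ω.AJ hr h (toC (midPt (w.side .W))) ≠ 0) :
    (∃ i, ω.2.firstHitG < i ∧ i + 1 < ω.2.arcs.length ∧
        (ω.2.nth (i + 1) = w.side .S ∨ ω.2.nth (i + 1) = (pocketSE w).side .N)) ∧
      ¬((∃ i, ω.2.firstHitG ≤ i ∧ i < ω.2.arcs.length ∧ ω.2.nth (i + 1) = w.side .S) ∧
        (∃ i, ω.2.firstHitG ≤ i ∧ i < ω.2.arcs.length ∧ ω.2.nth (i + 1) = (pocketSE w).side .N)) := by
  classical
  have hodd := (ω.AJ_root_ne_zero_iff_odd_rayCountAt (hr := hr) h (b := holeFaceW w) (τ := .E)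
    (holeFaceW_side_E w)).1 hA
  have hF := ω.fh_lt h
  set F := ω.2.firstHitG with hFdef
  set n := ω.2.arcs.length with hndef
  have hexit : ∀ j < ω.Mv, (ω.jFace h j).side (ω.jOut hr h j) = ω.2.nth (F + j + 1) := by
    intro j hj
    have hjn : F + j < n := by unfold ΩG.Mv at hj; omega
    by_cases hj0 : j = 0
    · subst hj0
      simp only [ΩG.jFace, ΩG.jOut, Nat.add_zero]
      exact (ω.2.exitSide_specG hr hF).1.symm
    · simp only [ΩG.jFace, ΩG.jOut, if_neg hj0]
      exact (ω.2.side_sIn_nth hjn).2.1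
  have hclass : ∀ j < ω.Mv, ∀ m : ℕ, ω.2.nth (F + j + 1) = rayMid (holeFaceW w) .E m →
      F < F + j ∧ F + j + 1 < n ∧
        (ω.2.nth (F + j + 1) = w.side .S ∨ ω.2.nth (F + j + 1) = (pocketSE w).side .N) := by
    intro j hj m hm
    have hjn : F + j < n := by unfold ΩG.Mv at hj; omega
    rw [rayMid_holeFaceW_E_eq] at hm
    have hlt : F + j + 1 < n := by
      rcases Nat.lt_or_ge (F + j + 1) n with hl | hl
      · exact hl
      · exfalso
        have e : F + j + 1 = n := by omega
        rw [e, ω.2.nth_length] at hm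
        exact farW_side_ne_slant_east w ω.1 m hm
    have hpos : F < F + j := by
      by_contra hle
      have ej : j = 0 := by omega
      subst ej
      have e2 := (ω.2.exitSide_specG hr hF).1
      rw [Nat.add_zero] at hm
      rw [hm] at e2
      exact farW_side_ne_slant_east w _ m e2.symm
    have hdoor := ω.2.door_nth (j := F + j + 1) (by omega) hlt
    rw [hm] at hdoor
    simp only [MidEdge.faces] at hdoor
    refine ⟨hpos, hlt, ?_⟩
    obtain rfl | rfl | hm2 : m = 0 ∨ m = 1 ∨ 2 ≤ m := by omega
    · left; rw [hm]; obtain ⟨k, l⟩ := w; simp [Face.side]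
    · right; rw [hm, pocketSE_side_N_eq]; push_cast; ring_nf
    · rcases hrow (w.1 + m) (by omega) with hx | hx
      · exact absurd hdoor.2 hx
      · exact absurd hdoor.1 hx
  set S := (Finset.range ω.Mv).filter fun j => ∃ m : ℕ, (ω.jFace h j).side (ω.jOut hr h j) = rayMid (holeFaceW w) .E m
    with hSdef
  have hcard : S.card = ω.rayCountAt hr h (holeFaceW w) .E := by unfold ΩG.rayCountAt; rfl
  have hmemS : ∀ j, j ∈ S ↔ j < ω.Mv ∧ ∃ m : ℕ, ω.2.nth (F + j + 1) = rayMid (holeFaceW w) .E m := by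
    intro j
    rw [hSdef, Finset.mem_filter, Finset.mem_range]
    constructor
    · rintro ⟨hj, m, hm⟩; exact ⟨hj, m, by rw [← hexit j hj]; exact hm⟩
    · rintro ⟨hj, m, hm⟩; exact ⟨hj, m, by rw [hexit j hj]; exact hm⟩
  refine ⟨?_, ?_⟩
  · have hpos : 0 < S.card := by rw [hcard]; exact hodd.pos
    obtain ⟨j, hj⟩ := Finset.card_pos.1 hpos
    obtain ⟨hjM, m, hm⟩ := (hmemS j).1 hj
    obtain ⟨h1, h2, h3⟩ := hclass j hjM m hm
    exact ⟨F + j, h1, h2, h3⟩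
  · rintro ⟨⟨i₀, hi₀, hi₀n, e₀⟩, ⟨i₁, hi₁, hi₁n, e₁⟩⟩
    have hFM : F + ω.Mv = n := by unfold ΩG.Mv; omega
    have hj₀ : i₀ - F ∈ S := (hmemS _).2 ⟨by omega, 0, by
      rw [show F + (i₀ - F) + 1 = i₀ + 1 by omega, e₀, root_side_S_eq_rayMid]⟩
    have hj₁ : i₁ - F ∈ S := (hmemS _).2 ⟨by omega, 1, by
      rw [show F + (i₁ - F) + 1 = i₁ + 1 by omega, e₁, pocketSE_side_N_eq_rayMid]⟩
    have hne : i₀ - F ≠ i₁ - F := by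
      intro e
      have ei : i₀ = i₁ := by omega
      rw [ei] at e₀
      exact root_side_S_ne_pocketSE_side_N w (e₀.symm.trans e₁)
    have htwo : 2 ≤ S.card := Finset.one_lt_card.2 ⟨_, hj₀, _, hj₁, hne⟩
    have hle : S.card ≤ 2 := by
      calc S.card ≤ ({w.side .S, (pocketSE w).side .N} : Finset MidEdge).card :=
            Finset.card_le_card_of_injOn (fun j => ω.2.nth (F + j + 1)) (fun j hj => by
              obtain ⟨hjM, m, hm⟩ := (hmemS j).1 hj
              rcases (hclass j hjM m hm).2.2 with e | e <;> simp [e]) (fun j hj j' hj' e => by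
              obtain ⟨hjM, -⟩ := (hmemS j).1 hj
              obtain ⟨hjM', -⟩ := (hmemS j').1 hj'
              have := ω.2.nth_inj (by omega) (by omega) e
              omega)
        _ ≤ 2 := Finset.card_le_two
    have h2 : S.card = 2 := le_antisymm hle htwo
    rw [hcard] at h2
    rw [h2] at hodd
    exact absurd hodd (by decide)

/-- ★★ **THE DOUBLE θ-CORNER BELOW THE ROOT PLAQUETTE (direct under route).** Hole absent, eastern kill cell
`K_S1 = (w.1 + 1, w.2 − 2)` and the cell `(w.1 + 2, w.2 − 1)` east of the eastern pocket absent, bottom line of the root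
row uncrossable for `x ≥ w.1 + 2`: a class-`B2a` walk at the far cell whose FIRST ARC LEAVES THE ROOT PLAQUETTE
SOUTHWARDS (`nth 1 = w.side S`) and whose excursion polygon winds around the root passes the cell below the root
plaquette twice, through its two `θ`-corners `{N, W}` (the prefix) and `{S, E}` (the excursion): the root plaquette's
bottom side being a prefix edge, the odd crossing of the eastern half-line is the pocket's top side; the pocket's only
other door is the `E` side of `rootS w`. [cite: GlazmanManolescu2019, §1, Fig. 1 (two arcs at the two θ-corners weigh w₁)]
[cite: Glazman2015WeightedSAW, Lemma 3.1 (proof, pp. 6–7: the classes of walks through a rhombus)]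
[cite: CourantRobbins1958, Ch. V Appendix §2 (The Jordan Curve Theorem for Polygons: the even–odd rule)] -/
theorem kindsIn_rootS_eq_of_AJ_ne_zero_direct (hh : holeFaceW w ∉ D)
    (hrow : ∀ x : ℤ, w.1 + 2 ≤ x → (x, w.2) ∉ D ∨ (x, w.2 - 1) ∉ D) (hK : killSE w ∉ D) (hPE : pocketSEE w ∉ D)
    (ω : ΩG D (w.side .W) (farW w)) (hr : RootedFace D (w.side .W) (farW w)) (h : ω.IsB2a)
    (hdir : ω.2.nth 1 = w.side .S) (hA : ω.AJ hr h (toC (midPt (w.side .W))) ≠ 0) :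
    ω.2.kindsIn (rootS w) = [.corner, .corner] := by
  obtain ⟨⟨i, hFi, hi1, hnth⟩, hnotboth⟩ := ω.exists_nth_eq_east_sides_of_AJ_ne_zero hh hrow hr h hA
  have hF := ω.fh_lt h
  have hfcF : ω.2.fc ω.2.firstHitG = farW w := (fc_fh ω hr h).1
  set F := ω.2.firstHitG with hFdef
  set n := ω.2.arcs.length with hndef
  -- the prefix: arc 0 in `w` (`W → S`), arc 1 in `rootS w` from `N`
  have h2F : 2 ≤ F := by
    by_contra hlt
    have hF1 : F ≤ 1 := by omega
    -- `nth F` is a side of the far cell; `nth 0 = a`, `nth 1 = w.S` are not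
    have e := ω.2.nth_firstHitG
    rcases Nat.eq_zero_or_pos F with e0 | e0
    · rw [← hFdef, e0, ω.2.nth_zero] at e; exact farW_side_ne_root w _ e.symm
    · have e1 : F = 1 := by omega
      rw [← hFdef, e1, hdir] at e
      have h2 := (farW_side_eq_slant_row w (x := w.1) (e.symm.trans (rfl : w.side .S = MidEdge.slant w.1 w.2))).2
      omega
  have hn3 : 3 ≤ n := by omega
  have hfc1 : ω.2.fc 1 = rootS w := by
    obtain ⟨hin, -, -⟩ := ω.2.side_sIn_nth (i := 1) (by omega)
    rw [hdir] at hin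
    have hf := face_of_side_eqE hin
    rw [root_side_S_faces] at hf
    simp only at hf
    rcases hf with e | e
    · exact e
    · exfalso
      have h0 : ω.2.fc 0 = w := fc_zero_eq_root w hh ω.2 (by omega)
      exact YBWalk.fc_succ_ne (γ := ω.2) (i := 0) (by omega) (h0.trans e.symm)
  have hsIn1 : ω.2.sIn 1 = .N := by
    obtain ⟨hin, -, -⟩ := ω.2.side_sIn_nth (i := 1) (by omega)
    rw [hdir, hfc1, root_side_S_eq_rootS_side_N] at hin
    exact Face.side_injective (rootS w) hin
  -- the crossing is not the root plaquette's bottom side (a prefix edge)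
  have hnth' : ω.2.nth (i + 1) = (pocketSE w).side .N := by
    rcases hnth with e | e
    · exfalso
      have := ω.2.nth_inj (i := i + 1) (j := 1) (by omega) (by omega) (e.trans hdir.symm)
      omega
    · exact e
  -- an excursion arc in `rootS w` through `E`
  have hlastP : ∀ t : Side, ω.2.nth n ≠ (pocketSE w).side t := by
    intro t; rw [ω.2.nth_length]; exact farW_side_ne_pocketSE_side w ω.1 t
  have hlastR : ∀ t : Side, ω.2.nth n ≠ (rootS w).side t := by
    intro t; rw [ω.2.nth_length]; exact farW_side_ne_rootS_side w ω.1 t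
  -- the pocket arc with an `N` end: its other end is `W` (`S` = kill cell, `E` absent)
  obtain ⟨-, hout_i, -⟩ := ω.2.side_sIn_nth (i := i) (by omega)
  obtain ⟨hin_i1, -, -⟩ := ω.2.side_sIn_nth (i := i + 1) hi1
  rw [hnth'] at hout_i hin_i1
  have hfi := face_of_side_eqE hout_i
  have hfi1 := face_of_side_eqE hin_i1
  rw [pocketSE_side_N_faces] at hfi hfi1
  simp only at hfi hfi1
  have hsucc : ω.2.fc i ≠ ω.2.fc (i + 1) := YBWalk.fc_succ_ne hi1
  have hk : ∃ k, F < k ∧ k < n ∧ ω.2.fc k = pocketSE w ∧ (ω.2.sIn k = .N ∨ ω.2.sOut k = .N) := by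
    rcases hfi1 with e1 | e1
    · exact ⟨i + 1, by omega, hi1, e1, Or.inl (Face.side_injective (pocketSE w) (by rw [e1] at hin_i1; exact hin_i1))⟩
    · have e0 : ω.2.fc i = pocketSE w := by
        rcases hfi with e | e
        · exact e
        · exact absurd (e.trans e1.symm) hsucc
      exact ⟨i, hFi, by omega, e0, Or.inr (Face.side_injective (pocketSE w) (by rw [e0] at hout_i; exact hout_i))⟩
  obtain ⟨k, hFk, hkn, hfk, hN⟩ := hk
  obtain ⟨hin, hout, hne⟩ := ω.2.side_sIn_nth hkn
  rw [hfk] at hin hout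
  have other : ∀ t : Side, t ≠ .N →
      ((pocketSE w).side t = ω.2.nth k ∨ (pocketSE w).side t = ω.2.nth (k + 1)) → t = .W := by
    intro t htN ht
    have hdoor : ((pocketSE w).side t).faces.1 ∈ D ∧ ((pocketSE w).side t).faces.2 ∈ D := by
      rcases ht with e | e
      · rw [e]; exact ω.2.door_nth (j := k) (by omega) hkn
      · have hk1 : k + 1 < n := by
          rcases Nat.lt_or_ge (k + 1) n with hl | hl
          · exact hl
          · exact absurd (by rw [show n = k + 1 by omega]; exact e.symm) (hlastP t)
        rw [e]; exact ω.2.door_nth (j := k + 1) (by omega) hk1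
    cases t
    · rfl
    · rw [pocketSE_side_E_faces] at hdoor; exact absurd hdoor.2 hPE
    · rw [pocketSE_side_S_faces] at hdoor; exact absurd hdoor.1 hK
    · exact absurd rfl htN
  -- hence an excursion arc in `rootS w` with an `E` end, at index `k - 1` or `k + 1`
  have hR : ∃ k', F < k' ∧ k' < n ∧ ω.2.fc k' = rootS w ∧ (ω.2.sIn k' = .E ∨ ω.2.sOut k' = .E) := by
    rcases hN with e | e
    · have ht := other (ω.2.sOut k) (fun h' => hne (e.trans h'.symm)) (Or.inr (by rw [hout]))
      rw [ht, pocketSE_side_W] at hout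
      have hk1 : k + 1 < n := by
        rcases Nat.lt_or_ge (k + 1) n with hl | hl
        · exact hl
        · exact absurd (by rw [show n = k + 1 by omega]; exact hout.symm) (hlastR .E)
      obtain ⟨hi', -, -⟩ := ω.2.side_sIn_nth (i := k + 1) hk1
      rw [← hout] at hi'
      have hf' := face_of_side_eqE hi'
      rw [← pocketSE_side_W, pocketSE_side_W_faces] at hf'
      simp only at hf'
      have hsucc' : ω.2.fc k ≠ ω.2.fc (k + 1) := YBWalk.fc_succ_ne hk1
      rw [hfk] at hsucc'
      rcases hf' with e' | e'
      · exact ⟨k + 1, by omega, hk1, e', Or.inl (Face.side_injective (rootS w) (by rw [e'] at hi'; exact hi'))⟩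
      · exact absurd e'.symm hsucc'
    · have ht := other (ω.2.sIn k) (fun h' => hne (h'.trans e.symm)) (Or.inl (by rw [hin]))
      rw [ht, pocketSE_side_W] at hin
      have hk0 : 1 ≤ k := by omega
      obtain ⟨-, ho, -⟩ := ω.2.side_sIn_nth (i := k - 1) (by omega)
      rw [show k - 1 + 1 = k by omega, ← hin] at ho
      have hf' := face_of_side_eqE ho
      rw [← pocketSE_side_W, pocketSE_side_W_faces] at hf'
      simp only at hf'
      have hsucc' : ω.2.fc (k - 1) ≠ ω.2.fc (k - 1 + 1) := YBWalk.fc_succ_ne (by omega)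
      rw [show k - 1 + 1 = k by omega, hfk] at hsucc'
      rcases hf' with e' | e'
      · refine ⟨k - 1, ?_, by omega, e', Or.inr (Face.side_injective (rootS w) (by rw [e'] at ho; exact ho))⟩
        rcases Nat.lt_or_ge F (k - 1) with hl | hl
        · exact hl
        · exfalso
          have eF : k - 1 = F := by omega
          rw [eF, hfcF] at e'
          exact rootS_ne_farW w e'.symm
      · exact absurd e' hsucc'
  obtain ⟨k', hFk', hk'n, hfk', hE'⟩ := hR
  -- two arcs in `rootS w`: the prefix arc 1 `{N, X}` and the excursion arc `k'` with an `E` end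
  have hf : ω.2.fc k' = ω.2.fc 1 := hfk'.trans hfc1.symm
  obtain ⟨hopp, d1, d2, d3, d4⟩ := YBWalk.not_straight_of_two_arcs (γ := ω.2) (i := 1) (i' := k') (by omega) hk'n
    (by omega) hf
  obtain ⟨hopp', -, -, -, -⟩ := YBWalk.not_straight_of_two_arcs (γ := ω.2) (i := k') (i' := 1) hk'n (by omega)
    (by omega) hf.symm
  have h1ne := (ω.2.side_sIn_nth (i := 1) (by omega)).2.2
  have hst := (ω.2.side_sIn_nth hk'n).2.2
  rw [hsIn1] at hopp d1 d3 h1ne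
  -- side bookkeeping
  have key : ∀ {x s t : Side}, Side.N ≠ x → x ≠ (Side.N).opp → s ≠ t → t ≠ s.opp → s ≠ Side.N → s ≠ x →
      t ≠ Side.N → t ≠ x → (s = .E ∨ t = .E) → arcKind .N x = .corner ∧ arcKind s t = .corner := by
    intro x s t; cases x <;> cases s <;> cases t <;> decide
  obtain ⟨c1, c2⟩ := key h1ne hopp hst hopp' d1 d2 d3 d4 hE'
  rw [← hsIn1] at c1
  rw [← hfc1]
  exact ω.2.kindsIn_eq_corner_corner (m := 1) (m' := k') (by omega) hk'n (by omega) hf c1 c2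


/-- The first hit of the far cell is not the start. [cite: Glazman2015WeightedSAW, Lemma 3.1 (proof, pp. 6–7: the first crossing of ∂r)] -/
theorem one_le_firstHitG_far (ω : ΩG D (w.side .W) (farW w)) : 1 ≤ ω.2.firstHitG := by
  rcases Nat.eq_zero_or_pos ω.2.firstHitG with e | e
  · exfalso
    have h := ω.2.nth_firstHitG
    rw [e, ω.2.nth_zero] at h
    exact farW_side_ne_root w _ h.symm
  · exact e

/-- ★★★ **THE STRUCTURAL `w₁`-KILL BELOW THE ROOT PLAQUETTE, direct route, wound form.** Eastern kill geometry
(hole, `K_S1 = (w.1 + 1, w.2 − 2)`, `(w.1 + 2, w.2 − 1)` absent, bottom line of the root row uncrossable for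
`x ≥ w.1 + 2`): every WOUND class-`B2a` walk at the far cell whose first arc leaves the root plaquette southwards has
`kindsIn (rootS w) = [corner, corner]` (either orientation of the winding witness: the reversed companion has the same
prefix and the same kinds off the far cell). [cite: GlazmanManolescu2019, §1, Fig. 1 and the remark after eq. (1) («w₁ = 0 at θ = 2π/3»)]
[cite: Glazman2015WeightedSAW, Lemma 3.1 (proof, pp. 6–7: the classes of walks through a rhombus)]
[cite: CourantRobbins1958, Ch. V Appendix §2 (The Jordan Curve Theorem for Polygons: the even–odd rule)] -/
theorem kindsIn_rootS_eq_of_wound_direct (hh : holeFaceW w ∉ D)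
    (hrow : ∀ x : ℤ, w.1 + 2 ≤ x → (x, w.2) ∉ D ∨ (x, w.2 - 1) ∉ D) (hK : killSE w ∉ D) (hPE : pocketSEE w ∉ D)
    (ω : ΩG D (w.side .W) (farW w)) (hr : RootedFace D (w.side .W) (farW w)) (h : ω.IsB2a)
    (hdir : ω.2.nth 1 = w.side .S) {θ : ℝ}
    (hW : ω.WE (fun _ => θ) ≠ excursionWinding θ ω.2.firstSideG (ω.z1 hr h) ω.1) :
    ω.2.kindsIn (rootS w) = [.corner, .corner] := by
  rcases ω.AJ_ne_zero_or_rev_of_wound hr h θ hW with hA | hA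
  · exact ω.kindsIn_rootS_eq_of_AJ_ne_zero_direct hh hrow hK hPE hr h hdir hA
  · have h' := ω.rev_isB2a hr h
    have hn : 1 ≤ ω.2.arcs.length := by have := ω.fh_lt h; omega
    have hdir' : (ω.rev hr).2.nth 1 = w.side .S := by
      rw [rev_snd_nth ω hr h hn, if_pos (ω.one_le_firstHitG_far)]; exact hdir
    have hk := (ω.rev hr).kindsIn_rootS_eq_of_AJ_ne_zero_direct hh hrow hK hPE hr h' hdir' hA
    have hperm := ω.kindsIn_rev_perm hr h (rootS_ne_farW w)
    rw [hk] at hperm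
    have hp : (ω.2.kindsIn (rootS w)).Perm (List.replicate 2 .corner) := hperm.symm
    exact List.perm_replicate.1 hp

/-- ★★ Hence such a walk is NOT `w₁`-free off the far cell. [cite: GlazmanManolescu2019, §1, remark after eq. (1)] -/
theorem not_W1FreeOff_farW_of_wound_direct (hh : holeFaceW w ∉ D)
    (hrow : ∀ x : ℤ, w.1 + 2 ≤ x → (x, w.2) ∉ D ∨ (x, w.2 - 1) ∉ D) (hK : killSE w ∉ D) (hPE : pocketSEE w ∉ D)
    (ω : ΩG D (w.side .W) (farW w)) (hr : RootedFace D (w.side .W) (farW w)) (h : ω.IsB2a)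
    (hdir : ω.2.nth 1 = w.side .S) {θ : ℝ}
    (hW : ω.WE (fun _ => θ) ≠ excursionWinding θ ω.2.firstSideG (ω.z1 hr h) ω.1) : ¬ω.2.W1FreeOff (farW w) := by
  have hk := ω.kindsIn_rootS_eq_of_wound_direct hh hrow hK hPE hr h hdir hW
  intro hfree
  have hmem : rootS w ∈ ω.2.facesVisited := by
    by_contra hn
    rw [YBWalk.kindsIn_eq_nil hn] at hk
    exact List.cons_ne_nil _ _ hk.symm
  exact hfree _ hmem (rootS_ne_farW w) hk

/-- ★★★ The companion file's hypothesis `hS₁` («every wound under-walk is `w₁`-marked», dual point) in the eastern kill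
geometry, GIVEN that every wound under-walk at the far cell leaves the root plaquette southwards («direct under
route» — in the venture lane's census boxes all of them do; the general case needs a separation argument for the prefix
loop, not typed here). [cite: GlazmanManolescu2019, §1, remark after eq. (1)]
[cite: CourantRobbins1958, Ch. V Appendix §2 (The Jordan Curve Theorem for Polygons: the even–odd rule)] -/
theorem under_w1_killed_of_killSE_of_direct (hh : holeFaceW w ∉ D)
    (hrow : ∀ x : ℤ, w.1 + 2 ≤ x → (x, w.2) ∉ D ∨ (x, w.2 - 1) ∉ D) (hK : killSE w ∉ D) (hPE : pocketSEE w ∉ D)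
    (hr : RootedFace D (w.side .W) (farW w)) (θ : ℝ)
    (hdirect : ∀ (ω : ΩG D (w.side .W) (farW w)) (h : ω.IsB2a), ω.2.firstSideG = .S →
      ω.WE (fun _ => θ) ≠ excursionWinding θ ω.2.firstSideG (ω.z1 hr h) ω.1 → ω.2.nth 1 = w.side .S) :
    ∀ (ω : ΩG D (w.side .W) (farW w)) (h : ω.IsB2a), ω.2.firstSideG = .S →
      ω.WE (fun _ => θ) ≠ excursionWinding θ ω.2.firstSideG (ω.z1 hr h) ω.1 → ¬ω.2.W1FreeOff (farW w) :=
  fun ω h hS hW => ω.not_W1FreeOff_farW_of_wound_direct hh hrow hK hPE hr h (hdirect ω h hS hW) hW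

/-! ### The row-mirror twin: the structural `w₂`-kill ABOVE the root plaquette (`K_N2`), direct over route -/

/-- The reflection exchanges the cells below and above the root plaquette. [cite: GlazmanManolescu2019, §4.2 (lattice symmetries)] -/
theorem mirrorRowFace_rootS (w : Face) : mirrorRowFace w.2 (rootS w) = rootN w := by
  obtain ⟨k, j⟩ := w; simp [mirrorRowFace, rootS, rootN]; ring

/-- The reflection carries the eastern kill cell to its northern twin. [cite: GlazmanManolescu2019, §4.2 (lattice symmetries)] -/
theorem mirrorRowFace_killSE (w : Face) : mirrorRowFace w.2 (killSE w) = killNE w := by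
  obtain ⟨k, j⟩ := w; simp [mirrorRowFace, killSE, killNE]; ring

/-- The reflection carries the cell east of the eastern pocket to its northern twin. [cite: GlazmanManolescu2019, §4.2 (lattice symmetries)] -/
theorem mirrorRowFace_pocketSEE (w : Face) : mirrorRowFace w.2 (pocketSEE w) = pocketNEE w := by
  obtain ⟨k, j⟩ := w; simp [mirrorRowFace, pocketSEE, pocketNEE]; ring

/-- The far cell is not the cell above the root plaquette. [cite: GlazmanManolescu2019, §1 (the lattice of rhombi and its mid-edges)] -/
theorem rootN_ne_farW (w : Face) : rootN w ≠ farW w := by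
  obtain ⟨k, j⟩ := w
  simp only [rootN, farW, ne_eq, Prod.mk.injEq, not_and]
  omega

/-- ★★★ **THE STRUCTURAL `w₂`-KILL ABOVE THE ROOT PLAQUETTE, direct over route** (row-mirror twin): hole,
`K_N2 = (w.1 + 1, w.2 + 2)` and `(w.1 + 2, w.2 + 1)` absent, top line of the root row uncrossable for `x ≥ w.1 + 2` ⇒
every wound class-`B2a` walk at the far cell whose first arc leaves the root plaquette NORTHWARDS has
`kindsIn (rootN w) = [coCorner, coCorner]`. [cite: GlazmanManolescu2019, §1, Fig. 1 and the paragraph of Fig. 2 («if θ = π/3, then w₂ = 0»)]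
[cite: Glazman2015WeightedSAW, Lemma 3.1 (proof, pp. 6–7: the classes of walks through a rhombus)]
[cite: CourantRobbins1958, Ch. V Appendix §2 (The Jordan Curve Theorem for Polygons: the even–odd rule)] -/
theorem kindsIn_rootN_eq_of_wound_direct (hh : holeFaceW w ∉ D)
    (hrow : ∀ x : ℤ, w.1 + 2 ≤ x → (x, w.2) ∉ D ∨ (x, w.2 + 1) ∉ D) (hK : killNE w ∉ D) (hPE : pocketNEE w ∉ D)
    (ω : ΩG D (w.side .W) (farW w)) (hr : RootedFace D (w.side .W) (farW w)) (h : ω.IsB2a)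
    (hdir : ω.2.nth 1 = w.side .N) {θ : ℝ}
    (hW : ω.WE (fun _ => θ) ≠ excursionWinding θ ω.2.firstSideG (ω.z1 hr h) ω.1) :
    ω.2.kindsIn (rootN w) = [.coCorner, .coCorner] := by
  have hr' := rootedFace_rowMirrorDom w hr
  have h' := ω.mirrorFar_isB2a hr h
  have hh' : holeFaceW w ∉ rowMirrorDom w D := by rwa [mem_rowMirrorDom, mirrorRowFace_holeFaceW]
  have hK' : killSE w ∉ rowMirrorDom w D := by rwa [mem_rowMirrorDom, mirrorRowFace_killSE]
  have hPE' : pocketSEE w ∉ rowMirrorDom w D := by rwa [mem_rowMirrorDom, mirrorRowFace_pocketSEE]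
  have hrow' : ∀ x : ℤ, w.1 + 2 ≤ x → (x, w.2) ∉ rowMirrorDom w D ∨ (x, w.2 - 1) ∉ rowMirrorDom w D := by
    intro x hx
    rw [mem_rowMirrorDom, mem_rowMirrorDom, mirrorRowFace_row, mirrorRowFace_row_pred]
    exact hrow x hx
  have hdir' : ω.mirrorFar.2.nth 1 = w.side .S := by
    rw [YBWalk.nth_eq_of_mids_mirror ω.mirrorFar_mids, hdir, mirrorRow_side_N_self_row]
  have hk := ω.mirrorFar.kindsIn_rootS_eq_of_wound_direct hh' hrow' hK' hPE' hr' h' hdir' (ω.mirrorFar_wound hr h hW)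
  obtain ⟨i, j, hij, hj, hfi, hfj⟩ :=
    ω.mirrorFar.2.exists_two_arcs_of_two_le_length_kindsIn (f := rootS w) (by rw [hk]; simp)
  have hn := ω.mirrorFar_length
  have hi0 : i < ω.2.arcs.length := by omega
  have hj0 : j < ω.2.arcs.length := by omega
  have hface : ∀ {m : ℕ}, m < ω.2.arcs.length → ω.mirrorFar.2.fc m = rootS w → ω.2.fc m = rootN w := by
    intro m hm e
    have e1 := ω.mirrorFar_fc hm
    rw [e] at e1
    have e2 := congrArg (mirrorRowFace w.2) e1
    rw [mirrorRowFace_rootS, mirrorRowFace_mirrorRowFace] at e2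
    exact e2.symm
  have hkind : ∀ {m : ℕ}, m < ω.2.arcs.length → ω.mirrorFar.2.fc m = rootS w →
      arcKind (ω.2.sIn m) (ω.2.sOut m) = .coCorner := by
    intro m hm e
    have hmem := ω.mirrorFar.2.arcKind_mem_kindsIn (i := m) (by omega)
    obtain ⟨e1, e2⟩ := ω.mirrorFar_sIn_sOut hm
    rw [e, hk, e1, e2, arcKind_mirrorSide] at hmem
    have e3 : mirrorKind (arcKind (ω.2.sIn m) (ω.2.sOut m)) = .corner := by simpa using hmem
    have e4 := congrArg mirrorKind e3
    rw [mirrorKind_mirrorKind] at e4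
    exact e4
  have hfci := hface hi0 hfi
  have hfcj := hface hj0 hfj
  rw [← hfci]
  exact ω.2.kindsIn_eq_coCorner_coCorner hi0 hj0 hij (hfcj.trans hfci.symm) (hkind hi0 hfi) (hkind hj0 hfj)

/-- ★★ Hence such a walk is NOT `w₂`-free off the far cell. [cite: GlazmanManolescu2019, §1 (the paragraph of Fig. 2: «if θ = π/3, then w₂ = 0»)] -/
theorem not_W2FreeOff_farW_of_wound_over_direct (hh : holeFaceW w ∉ D)
    (hrow : ∀ x : ℤ, w.1 + 2 ≤ x → (x, w.2) ∉ D ∨ (x, w.2 + 1) ∉ D) (hK : killNE w ∉ D) (hPE : pocketNEE w ∉ D)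
    (ω : ΩG D (w.side .W) (farW w)) (hr : RootedFace D (w.side .W) (farW w)) (h : ω.IsB2a)
    (hdir : ω.2.nth 1 = w.side .N) {θ : ℝ}
    (hW : ω.WE (fun _ => θ) ≠ excursionWinding θ ω.2.firstSideG (ω.z1 hr h) ω.1) : ¬ω.2.W2FreeOff (farW w) := by
  have hk := ω.kindsIn_rootN_eq_of_wound_direct hh hrow hK hPE hr h hdir hW
  intro hfree
  have hmem : rootN w ∈ ω.2.facesVisited := by
    by_contra hn
    rw [YBWalk.kindsIn_eq_nil hn] at hk
    exact List.cons_ne_nil _ _ hk.symm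
  exact hfree _ hmem (rootN_ne_farW w) hk

/-- ★★★ The companion file's hypothesis `hN₂` («every wound over-walk is `w₂`-marked», honeycomb point) in the
north-eastern kill geometry, GIVEN that every wound over-walk leaves the root plaquette northwards («direct over route»).
[cite: GlazmanManolescu2019, §1 (the paragraph of Fig. 2)]
[cite: CourantRobbins1958, Ch. V Appendix §2 (The Jordan Curve Theorem for Polygons: the even–odd rule)] -/
theorem over_w2_killed_of_killNE_of_direct (hh : holeFaceW w ∉ D)
    (hrow : ∀ x : ℤ, w.1 + 2 ≤ x → (x, w.2) ∉ D ∨ (x, w.2 + 1) ∉ D) (hK : killNE w ∉ D) (hPE : pocketNEE w ∉ D)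
    (hr : RootedFace D (w.side .W) (farW w)) (θ : ℝ)
    (hdirect : ∀ (ω : ΩG D (w.side .W) (farW w)) (h : ω.IsB2a), ω.2.firstSideG = .N →
      ω.WE (fun _ => θ) ≠ excursionWinding θ ω.2.firstSideG (ω.z1 hr h) ω.1 → ω.2.nth 1 = w.side .N) :
    ∀ (ω : ΩG D (w.side .W) (farW w)) (h : ω.IsB2a), ω.2.firstSideG = .N →
      ω.WE (fun _ => θ) ≠ excursionWinding θ ω.2.firstSideG (ω.z1 hr h) ω.1 → ¬ω.2.W2FreeOff (farW w) :=
  fun ω h hN hW => ω.not_W2FreeOff_farW_of_wound_over_direct hh hrow hK hPE hr h (hdirect ω h hN hW) hW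

end ΩG

end Literature.Probability.RandomPlanarGeometry.SAW.YangBaxter

namespace Literature.Barriers.CriticalPhenomena.PlaquetteWalk

open Literature.Probability.RandomPlanarGeometry.SAW.YangBaxter
open Real Complex

/-- ★★★ **THE KILL-FORCED ZERO OF THE EASTERN PAIR, routes exchanged (`K_N2` at `π/3`, `K_S1` at `2π/3`), for direct
routes.** Hole, the two eastern kill cells `(w.1 + 1, w.2 ± 2)` and the two cells `(w.1 + 2, w.2 ± 1)` absent, the root
row's bottom and top lines uncrossable for `x ≥ w.1 + 2`; every wound over-walk leaves the root plaquette northwards and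
every wound under-walk southwards (directness: the lane's data, not a theorem); ONE `w₂`-free wound under-walk and ONE
`w₁`-free wound over-walk ⇒ an exact zero of the Yang–Baxter vertex functional in `(π/3, 2π/3)` (the companion file's
§4′ with both universal kill hypotheses reduced to directness; instance in the lane's data: the asymmetric
`6×5 ∖ {(3,2),(5,0),(5,4),(0,0)}`, zero in `[0.37208π, 0.37225π]`, up to directness and the witnesses).
[cite: GlazmanManolescu2019, Lemma 2.1 (statement, "in the form given in [Gl]")]
[cite: GlazmanManolescu2019, §1 (the paragraph of Fig. 2 and the remark after eq. (1))]
[cite: Glazman2015WeightedSAW, Lemma 3.1 (proof, pp. 6–7)] [cite: DuminilCopinSmirnov2012, proof of Lemma 1]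
[cite: CourantRobbins1958, Ch. V Appendix §2 (The Jordan Curve Theorem for Polygons: the even–odd rule)] -/
theorem vertexFunctional_printed_farCellW_exists_eq_zero_Ioo_of_killNE_of_killSE_of_direct (Dl : List Face) (w : Face)
    (hf : farW w ∈ Dl) (hh : holeFaceW w ∉ dom Dl) (hr : RootedFace (dom Dl) (w.side .W) (farW w))
    (hKN : killNE w ∉ dom Dl) (hPN : pocketNEE w ∉ dom Dl)
    (hrowN : ∀ x : ℤ, w.1 + 2 ≤ x → (x, w.2) ∉ dom Dl ∨ (x, w.2 + 1) ∉ dom Dl)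
    (hKS : killSE w ∉ dom Dl) (hPS : pocketSEE w ∉ dom Dl)
    (hrowS : ∀ x : ℤ, w.1 + 2 ≤ x → (x, w.2) ∉ dom Dl ∨ (x, w.2 - 1) ∉ dom Dl)
    (hdirN : ∀ (ω : ΩG (dom Dl) (w.side .W) (farW w)) (h : ω.IsB2a), ω.2.firstSideG = .N →
      ω.WE (fun _ => π / 3) ≠ excursionWinding (π / 3) ω.2.firstSideG (ω.z1 hr h) ω.1 → ω.2.nth 1 = w.side .N)
    (hdirS : ∀ (ω : ΩG (dom Dl) (w.side .W) (farW w)) (h : ω.IsB2a), ω.2.firstSideG = .S →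
      ω.WE (fun _ => 2 * π / 3) ≠ excursionWinding (2 * π / 3) ω.2.firstSideG (ω.z1 hr h) ω.1 →
        ω.2.nth 1 = w.side .S)
    (hS₂ : ∃ (ω : ΩG (dom Dl) (w.side .W) (farW w)) (h : ω.IsB2a), ω.2.firstSideG = .S ∧
      ω.WE (fun _ => π / 3) ≠ excursionWinding (π / 3) ω.2.firstSideG (ω.z1 hr h) ω.1 ∧ ω.2.W2FreeOff (farW w))
    (hN₁ : ∃ (ω : ΩG (dom Dl) (w.side .W) (farW w)) (h : ω.IsB2a), ω.2.firstSideG = .N ∧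
      ω.WE (fun _ => 2 * π / 3) ≠ excursionWinding (2 * π / 3) ω.2.firstSideG (ω.z1 hr h) ω.1 ∧
        ω.2.W1FreeOff (farW w)) :
    ∃ θ ∈ Set.Ioo (π / 3) (2 * π / 3),
      vertexFunctional (printedWeights θ) tFiveEighths (ybCoeff θ) Dl (w.side .W) (farW w) = 0 :=
  vertexFunctional_printed_farCellW_exists_eq_zero_Ioo_of_opposite_kills' Dl w hf hh hr
    (ΩG.over_w2_killed_of_killNE_of_direct hh hrowN hKN hPN hr (π / 3) hdirN) hS₂
    (ΩG.under_w1_killed_of_killSE_of_direct hh hrowS hKS hPS hr (2 * π / 3) hdirS) hN₁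

end Literature.Barriers.CriticalPhenomena.PlaquetteWalk

/-! ## §11 (edition 5) The east pair beyond direct routes: first arc EAST, and excursions through the root plaquette

Two more configurations of §10's case analysis are local: (a) if the excursion polygon crosses the bottom side of the
root plaquette `w` at all, then `w` itself carries the prefix arc `{W, N}` and the excursion arc `{S, E}` — a double
`θ`-corner, with no hypothesis on the domain beyond the hole; (b) if the first arc runs straight EAST through `w`
(`nth 1 = w.side E`), the odd eastern crossing is the top side of the eastern pocket, i.e. an excursion arc in
`rootE w = (w.1 + 1, w.2)` through its `S` side next to the prefix arc from `W`: `rootE w` carries the double `θ`-corner —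
again without any kill cell. Hence in the `K_S1` geometry every wound walk at the far cell whose first arc does NOT leave
the root plaquette northwards is `w₁`-marked off the far cell (`ΩG.not_W1FreeOff_farW_of_wound_not_north`), and dually
(`K_N2`, first arc not southwards, `w₂`). What remains of LAW L's east pair is exactly: first arc north (resp. south) AND
excursion avoiding `w` — the prefix-loop separation case of the lane's DESIGN-next-g24 §2. -/

namespace Literature.Probability.RandomPlanarGeometry.SAW.YangBaxter

open Real
open Literature.Barriers.CriticalPhenomena.PlaquetteWalk (mirrorRow mirrorRowFace mirrorSide mirrorKind mirrorArc
  mirrorRow_side arcsOf_map_mirrorRow arcKind_mirrorSide mirrorRowFace_mirrorRowFace mirrorSide_mirrorSide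
  mirrorKind_mirrorKind)

open private fc_fh rev_snd_nth from Literature.Probability.RandomPlanarGeometry.YangBaxterSAWGeneralDomain

section CellsE2

variable (w : Face)

/-- Faces of the root plaquette's `E` side. [cite: GlazmanManolescu2019, §1 (the lattice of rhombi and its mid-edges)] -/
theorem root_side_E_faces : (w.side .E).faces = (w, rootE w) := by
  obtain ⟨k, j⟩ := w; simp [rootE, Face.side, MidEdge.faces]

/-- `w.E = rootE.W`. [cite: GlazmanManolescu2019, §1 (the lattice of rhombi and its mid-edges)] -/
theorem root_side_E_eq_rootE_side_W : w.side .E = (rootE w).side .W := by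
  obtain ⟨k, j⟩ := w; simp [rootE, Face.side]

/-- `rootE.S = pocketSE.N`. [cite: GlazmanManolescu2019, §1 (the lattice of rhombi and its mid-edges)] -/
theorem rootE_side_S : (rootE w).side .S = (pocketSE w).side .N := by
  obtain ⟨k, j⟩ := w; simp [rootE, pocketSE, Face.side]

/-- No side of the far cell is the root plaquette's `E` side. [cite: GlazmanManolescu2019, §1 (the lattice of rhombi and its mid-edges)] -/
theorem farW_side_ne_root_E (t : Side) : (farW w).side t ≠ w.side .E := by
  obtain ⟨k, j⟩ := w
  cases t <;> simp only [farW, Face.side, ne_eq, MidEdge.vert.injEq, reduceCtorEq, not_false_eq_true, not_and] <;> omega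

/-- The far cell is not the root plaquette. [cite: GlazmanManolescu2019, §1 (the lattice of rhombi and its mid-edges)] -/
theorem root_ne_farW : w ≠ farW w := by
  obtain ⟨k, j⟩ := w
  simp only [farW, ne_eq, Prod.mk.injEq, and_true]
  omega

/-- The far cell is not the cell east of the root plaquette. [cite: GlazmanManolescu2019, §1 (the lattice of rhombi and its mid-edges)] -/
theorem rootE_ne_farW : rootE w ≠ farW w := by
  obtain ⟨k, j⟩ := w
  simp only [rootE, farW, ne_eq, Prod.mk.injEq, and_true]
  omega

/-- The reflection fixes the cell east of the root plaquette. [cite: GlazmanManolescu2019, §4.2 (lattice symmetries)] -/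
theorem mirrorRowFace_rootE : mirrorRowFace w.2 (rootE w) = rootE w := by
  obtain ⟨k, j⟩ := w; simp [mirrorRowFace, rootE]; ring

/-- The reflection exchanges the top and bottom sides of the root plaquette. [cite: GlazmanManolescu2019, §4.2 (lattice symmetries)] -/
theorem mirrorRow_root_side_S : mirrorRow w.2 (w.side .S) = w.side .N := by
  rw [mirrorRow_side, mirrorRowFace_self]; rfl

end CellsE2

namespace ΩG

variable {D : Set Face} {w : Face}

/-- A face having the mid-edge `e` as a side is one of the two faces of `e`. [cite: GlazmanManolescu2019, §1 (the lattice of rhombi and its mid-edges)] -/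
private theorem face_of_side_eqE2 {F : Face} {s : Side} {e : MidEdge} (h : F.side s = e) : F = e.faces.1 ∨ F = e.faces.2 :=
  (Face.exists_side_eq_iff F e).1 ⟨s, h⟩

/-- The first arc enters the root plaquette from `W`. [cite: Glazman2015WeightedSAW, Lemma 3.1 (proof, pp. 6–7)] -/
theorem sIn_zero_eq_W (hh : holeFaceW w ∉ D) (ω : ΩG D (w.side .W) (farW w)) (hn : 0 < ω.2.arcs.length) :
    ω.2.sIn 0 = .W := by
  obtain ⟨hin, -, -⟩ := ω.2.side_sIn_nth hn
  rw [ω.2.nth_zero, fc_zero_eq_root w hh ω.2 hn] at hin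
  exact Face.side_injective w hin

/-- ★★ **(a) AN EXCURSION THROUGH THE ROOT PLAQUETTE'S BOTTOM SIDE DOUBLES THE ROOT PLAQUETTE.** If some edge of the walk
after its arc in the far cell is the bottom side of the root plaquette `w`, then the first arc left `w` NORTHWARDS and `w`
carries the two `θ`-corner arcs `{W, N}` (prefix) and `{S, E}` (excursion). No hypothesis on the domain beyond the hole.
[cite: GlazmanManolescu2019, §1, Fig. 1 (two arcs at the two θ-corners weigh w₁)]
[cite: Glazman2015WeightedSAW, Lemma 3.1 (proof, pp. 6–7: the classes of walks through a rhombus)] -/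
theorem kindsIn_root_eq_of_cross_root_S (hh : holeFaceW w ∉ D) (ω : ΩG D (w.side .W) (farW w))
    (hr : RootedFace D (w.side .W) (farW w)) (h : ω.IsB2a)
    (hc : ∃ i, ω.2.firstHitG ≤ i ∧ i < ω.2.arcs.length ∧ ω.2.nth (i + 1) = w.side .S) :
    ω.2.nth 1 = w.side .N ∧ ω.2.kindsIn w = [.corner, .corner] := by
  obtain ⟨i, hFi, hin, hnth⟩ := hc
  have hF := ω.fh_lt h
  have hfcF : ω.2.fc ω.2.firstHitG = farW w := (fc_fh ω hr h).1
  set F := ω.2.firstHitG with hFdef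
  set n := ω.2.arcs.length with hndef
  have hfc0 : ω.2.fc 0 = w := fc_zero_eq_root w hh ω.2 (by omega)
  have hsIn0 : ω.2.sIn 0 = .W := ω.sIn_zero_eq_W hh (by omega)
  -- an excursion arc in `w` with an `S` end
  have hi1 : i + 1 < n := by
    rcases Nat.lt_or_ge (i + 1) n with hl | hl
    · exact hl
    · exfalso
      have e : i + 1 = n := by omega
      rw [e, ω.2.nth_length] at hnth
      exact farW_side_ne_slant_east w ω.1 0 (hnth.trans (by obtain ⟨k, j⟩ := w; simp [Face.side]))
  obtain ⟨-, hout_i, -⟩ := ω.2.side_sIn_nth (i := i) (by omega)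
  obtain ⟨hin_i1, -, -⟩ := ω.2.side_sIn_nth (i := i + 1) hi1
  rw [hnth] at hout_i hin_i1
  have hfi := face_of_side_eqE2 hout_i
  have hfi1 := face_of_side_eqE2 hin_i1
  rw [root_side_S_faces] at hfi hfi1
  simp only at hfi hfi1
  have hsucc : ω.2.fc i ≠ ω.2.fc (i + 1) := YBWalk.fc_succ_ne hi1
  have hk : ∃ k, F ≤ k ∧ k < n ∧ ω.2.fc k = w ∧ (ω.2.sIn k = .S ∨ ω.2.sOut k = .S) := by
    rcases hfi1 with e1 | e1
    · -- arc `i + 1` lies in `rootS`; arc `i` lies in `w` and exits `S`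
      have e0 : ω.2.fc i = w := by
        rcases hfi with e | e
        · exact absurd (e.trans e1.symm) hsucc
        · exact e
      exact ⟨i, hFi, by omega, e0, Or.inr (Face.side_injective w (by rw [e0] at hout_i; exact hout_i))⟩
    · exact ⟨i + 1, by omega, hi1, e1, Or.inl (Face.side_injective w (by rw [e1] at hin_i1; exact hin_i1))⟩
  obtain ⟨k, hFk, hkn, hfk, hkS⟩ := hk
  have hk0 : 0 < k := by
    rcases Nat.eq_zero_or_pos k with e | e
    · exfalso
      have hF0 : F = 0 := by omega
      rw [hF0] at hfcF
      exact root_ne_farW w (hfc0.symm.trans hfcF)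
    · exact e
  -- two arcs in `w`: arc 0 `{W, Y}` and arc `k` with an `S` end
  have hf : ω.2.fc k = ω.2.fc 0 := hfk.trans hfc0.symm
  obtain ⟨hopp, d1, d2, d3, d4⟩ := YBWalk.not_straight_of_two_arcs (γ := ω.2) (i := 0) (i' := k) (by omega) hkn
    (by omega) hf
  obtain ⟨hopp', -, -, -, -⟩ := YBWalk.not_straight_of_two_arcs (γ := ω.2) (i := k) (i' := 0) hkn (by omega)
    (by omega) hf.symm
  have h0ne := (ω.2.side_sIn_nth (i := 0) (by omega)).2.2
  have hst := (ω.2.side_sIn_nth hkn).2.2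
  have key : ∀ {x y s t : Side}, x = .W → x ≠ y → y ≠ x.opp → s ≠ t → t ≠ s.opp → s ≠ x → s ≠ y →
      t ≠ x → t ≠ y → (s = .S ∨ t = .S) → y = .N ∧ arcKind x y = .corner ∧ arcKind s t = .corner := by
    intro x y s t hx; subst hx; cases y <;> cases s <;> cases t <;> decide
  obtain ⟨hY, c1, c2⟩ := key hsIn0 h0ne hopp hst hopp' d1 d2 d3 d4 hkS
  refine ⟨?_, ?_⟩
  · obtain ⟨-, hout0, -⟩ := ω.2.side_sIn_nth (i := 0) (by omega)
    rw [hfc0, hY] at hout0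
    exact hout0.symm
  · have hk2 := ω.2.kindsIn_eq_corner_corner (m := 0) (m' := k) (by omega) hkn hk0 hf c1 c2
    rw [hfc0] at hk2
    exact hk2

/-- ★★ **(b) FIRST ARC EAST: the cell east of the root plaquette doubles.** Hole absent and the bottom line of the root
row uncrossable for `x ≥ w.1 + 2`: a class-`B2a` walk at the far cell whose first arc runs straight east through the
root plaquette (`nth 1 = w.side E`) and whose excursion polygon winds around the root passes `rootE w = (w.1 + 1, w.2)`
twice, through its two `θ`-corners (prefix `{W, N}`, excursion `{S, E}`) — no kill cell needed.
[cite: GlazmanManolescu2019, §1, Fig. 1 (two arcs at the two θ-corners weigh w₁)]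
[cite: Glazman2015WeightedSAW, Lemma 3.1 (proof, pp. 6–7: the classes of walks through a rhombus)]
[cite: CourantRobbins1958, Ch. V Appendix §2 (The Jordan Curve Theorem for Polygons: the even–odd rule)] -/
theorem kindsIn_rootE_eq_of_AJ_ne_zero_east (hh : holeFaceW w ∉ D)
    (hrow : ∀ x : ℤ, w.1 + 2 ≤ x → (x, w.2) ∉ D ∨ (x, w.2 - 1) ∉ D)
    (ω : ΩG D (w.side .W) (farW w)) (hr : RootedFace D (w.side .W) (farW w)) (h : ω.IsB2a)
    (hdir : ω.2.nth 1 = w.side .E) (hA : ω.AJ hr h (toC (midPt (w.side .W))) ≠ 0) :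
    ω.2.kindsIn (rootE w) = [.corner, .corner] := by
  obtain ⟨⟨i, hFi, hi1, hnth⟩, -⟩ := ω.exists_nth_eq_east_sides_of_AJ_ne_zero hh hrow hr h hA
  have hF := ω.fh_lt h
  have hfcF : ω.2.fc ω.2.firstHitG = farW w := (fc_fh ω hr h).1
  set F := ω.2.firstHitG with hFdef
  set n := ω.2.arcs.length with hndef
  -- the crossing is not the root plaquette's bottom side: that would force the first arc north
  have hnth' : ω.2.nth (i + 1) = (pocketSE w).side .N := by
    rcases hnth with e | e
    · exfalso
      have hN := (ω.kindsIn_root_eq_of_cross_root_S hh hr h ⟨i, hFi.le, by omega, e⟩).1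
      rw [hdir] at hN
      exact absurd (Face.side_injective w hN) (by decide)
    · exact e
  -- the prefix: arc 0 in `w` (`W → E`), arc 1 in `rootE w` from `W`
  have h2F : 2 ≤ F := by
    by_contra hlt
    have e := ω.2.nth_firstHitG
    rcases Nat.eq_zero_or_pos F with e0 | e0
    · rw [← hFdef, e0, ω.2.nth_zero] at e; exact farW_side_ne_root w _ e.symm
    · have e1 : F = 1 := by omega
      rw [← hFdef, e1, hdir] at e
      exact farW_side_ne_root_E w _ e.symm
  have hn3 : 3 ≤ n := by omega
  have hfc0 : ω.2.fc 0 = w := fc_zero_eq_root w hh ω.2 (by omega)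
  have hfc1 : ω.2.fc 1 = rootE w := by
    obtain ⟨hin, -, -⟩ := ω.2.side_sIn_nth (i := 1) (by omega)
    rw [hdir] at hin
    have hf := face_of_side_eqE2 hin
    rw [root_side_E_faces] at hf
    simp only at hf
    rcases hf with e | e
    · exact absurd (hfc0.trans e.symm) (YBWalk.fc_succ_ne (γ := ω.2) (i := 0) (by omega))
    · exact e
  have hsIn1 : ω.2.sIn 1 = .W := by
    obtain ⟨hin, -, -⟩ := ω.2.side_sIn_nth (i := 1) (by omega)
    rw [hdir, hfc1, root_side_E_eq_rootE_side_W] at hin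
    exact Face.side_injective (rootE w) hin
  -- the excursion arc in `rootE w` through `S`
  obtain ⟨-, hout_i, -⟩ := ω.2.side_sIn_nth (i := i) (by omega)
  obtain ⟨hin_i1, -, -⟩ := ω.2.side_sIn_nth (i := i + 1) hi1
  rw [hnth', ← rootE_side_S] at hout_i hin_i1
  have hfi := face_of_side_eqE2 hout_i
  have hfi1 := face_of_side_eqE2 hin_i1
  rw [rootE_side_S, pocketSE_side_N_faces] at hfi hfi1
  simp only at hfi hfi1
  have hsucc : ω.2.fc i ≠ ω.2.fc (i + 1) := YBWalk.fc_succ_ne hi1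
  have hk : ∃ k, F < k ∧ k < n ∧ ω.2.fc k = rootE w ∧ (ω.2.sIn k = .S ∨ ω.2.sOut k = .S) := by
    rcases hfi1 with e1 | e1
    · have e0 : ω.2.fc i = rootE w := by
        rcases hfi with e | e
        · exact absurd (e.trans e1.symm) hsucc
        · exact e
      exact ⟨i, hFi, by omega, e0, Or.inr (Face.side_injective (rootE w) (by rw [e0] at hout_i; exact hout_i))⟩
    · exact ⟨i + 1, by omega, hi1, e1, Or.inl (Face.side_injective (rootE w) (by rw [e1] at hin_i1; exact hin_i1))⟩
  obtain ⟨k, hFk, hkn, hfk, hkS⟩ := hk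
  have hf : ω.2.fc k = ω.2.fc 1 := hfk.trans hfc1.symm
  obtain ⟨hopp, d1, d2, d3, d4⟩ := YBWalk.not_straight_of_two_arcs (γ := ω.2) (i := 1) (i' := k) (by omega) hkn
    (by omega) hf
  obtain ⟨hopp', -, -, -, -⟩ := YBWalk.not_straight_of_two_arcs (γ := ω.2) (i := k) (i' := 1) hkn (by omega)
    (by omega) hf.symm
  have h1ne := (ω.2.side_sIn_nth (i := 1) (by omega)).2.2
  have hst := (ω.2.side_sIn_nth hkn).2.2
  have key : ∀ {x y s t : Side}, x = .W → x ≠ y → y ≠ x.opp → s ≠ t → t ≠ s.opp → s ≠ x → s ≠ y →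
      t ≠ x → t ≠ y → (s = .S ∨ t = .S) → arcKind x y = .corner ∧ arcKind s t = .corner := by
    intro x y s t hx; subst hx; cases y <;> cases s <;> cases t <;> decide
  obtain ⟨c1, c2⟩ := key hsIn1 h1ne hopp hst hopp' d1 d2 d3 d4 hkS
  rw [← hfc1]
  exact ω.2.kindsIn_eq_corner_corner (m := 1) (m' := k) (by omega) hkn (by omega) hf c1 c2

/-- ★★★ **THE `K_S1` KILL FOR EVERY WOUND WALK THAT DOES NOT LEAVE THE ROOT PLAQUETTE NORTHWARDS.** Eastern kill
geometry (hole, `K_S1`, the cell east of the eastern pocket absent, bottom line uncrossable for `x ≥ w.1 + 2`): a wound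
class-`B2a` walk at the far cell with `nth 1 ≠ w.side N` is NOT `w₁`-free off the far cell — the double `θ`-corner sits in
`rootS w` (first arc south, §10) or in `rootE w` (first arc east, (b)). [cite: GlazmanManolescu2019, §1, Fig. 1 and the remark after eq. (1)]
[cite: Glazman2015WeightedSAW, Lemma 3.1 (proof, pp. 6–7)] [cite: CourantRobbins1958, Ch. V Appendix §2 (the even–odd rule)] -/
theorem not_W1FreeOff_farW_of_wound_not_north (hh : holeFaceW w ∉ D)
    (hrow : ∀ x : ℤ, w.1 + 2 ≤ x → (x, w.2) ∉ D ∨ (x, w.2 - 1) ∉ D) (hK : killSE w ∉ D) (hPE : pocketSEE w ∉ D)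
    (ω : ΩG D (w.side .W) (farW w)) (hr : RootedFace D (w.side .W) (farW w)) (h : ω.IsB2a)
    (hnotN : ω.2.nth 1 ≠ w.side .N) {θ : ℝ}
    (hW : ω.WE (fun _ => θ) ≠ excursionWinding θ ω.2.firstSideG (ω.z1 hr h) ω.1) : ¬ω.2.W1FreeOff (farW w) := by
  have hF := ω.fh_lt h
  have hn : 0 < ω.2.arcs.length := by omega
  -- the first arc leaves `w` through `S` or `E`
  obtain ⟨-, hout0, hne0⟩ := ω.2.side_sIn_nth (i := 0) hn
  rw [fc_zero_eq_root w hh ω.2 hn] at hout0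
  have hsIn0 := ω.sIn_zero_eq_W hh hn
  have hdir : ω.2.nth 1 = w.side .S ∨ ω.2.nth 1 = w.side .E := by
    have h1 : ω.2.sOut 0 ≠ .W := fun e => hne0 (hsIn0.trans e.symm)
    have h2 : ω.2.sOut 0 ≠ .N := fun e => hnotN (by rw [← hout0, e])
    have hY : ω.2.sOut 0 = .S ∨ ω.2.sOut 0 = .E := by
      revert h1 h2; cases ω.2.sOut 0 <;> decide
    rcases hY with e | e
    · left; rw [← hout0, e]
    · right; rw [← hout0, e]
  rcases hdir with hS | hE
  · exact ω.not_W1FreeOff_farW_of_wound_direct hh hrow hK hPE hr h hS hW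
  · -- first arc east: the double corner sits in `rootE w`, for the walk or its reversed companion
    have hk : ω.2.kindsIn (rootE w) = [.corner, .corner] := by
      rcases ω.AJ_ne_zero_or_rev_of_wound hr h θ hW with hA | hA
      · exact ω.kindsIn_rootE_eq_of_AJ_ne_zero_east hh hrow hr h hE hA
      · have h' := ω.rev_isB2a hr h
        have hdir' : (ω.rev hr).2.nth 1 = w.side .E := by
          rw [rev_snd_nth ω hr h (by omega), if_pos (ω.one_le_firstHitG_far)]; exact hE
        have hk' := (ω.rev hr).kindsIn_rootE_eq_of_AJ_ne_zero_east hh hrow hr h' hdir' hA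
        have hperm := ω.kindsIn_rev_perm hr h (rootE_ne_farW w)
        rw [hk'] at hperm
        have hp : (ω.2.kindsIn (rootE w)).Perm (List.replicate 2 .corner) := hperm.symm
        exact List.perm_replicate.1 hp
    intro hfree
    have hmem : rootE w ∈ ω.2.facesVisited := by
      by_contra hn'
      rw [YBWalk.kindsIn_eq_nil hn'] at hk
      exact List.cons_ne_nil _ _ hk.symm
    exact hfree _ hmem (rootE_ne_farW w) hk

/-- **Generic mirror transfer of a doubled rhombus**: if the reflected walk doubles `g` with two `θ`-corner arcs, the walk
doubles the reflected rhombus with two `(π − θ)`-corner arcs. [cite: GlazmanManolescu2019, §1, Fig. 1 (θ ↔ π − θ exchanges the corner kinds)] -/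
theorem kindsIn_eq_coCorner_of_mirrorFar_corner (ω : ΩG D (w.side .W) (farW w)) {g : Face}
    (hk : ω.mirrorFar.2.kindsIn g = [.corner, .corner]) :
    ω.2.kindsIn (mirrorRowFace w.2 g) = [.coCorner, .coCorner] := by
  obtain ⟨i, j, hij, hj, hfi, hfj⟩ := ω.mirrorFar.2.exists_two_arcs_of_two_le_length_kindsIn (f := g) (by rw [hk]; simp)
  have hn := ω.mirrorFar_length
  have hi0 : i < ω.2.arcs.length := by omega
  have hj0 : j < ω.2.arcs.length := by omega
  have hface : ∀ {m : ℕ}, m < ω.2.arcs.length → ω.mirrorFar.2.fc m = g → ω.2.fc m = mirrorRowFace w.2 g := by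
    intro m hm e
    have e1 := ω.mirrorFar_fc hm
    rw [e] at e1
    have e2 := congrArg (mirrorRowFace w.2) e1
    rw [mirrorRowFace_mirrorRowFace] at e2
    exact e2.symm
  have hkind : ∀ {m : ℕ}, m < ω.2.arcs.length → ω.mirrorFar.2.fc m = g → arcKind (ω.2.sIn m) (ω.2.sOut m) = .coCorner := by
    intro m hm e
    have hmem := ω.mirrorFar.2.arcKind_mem_kindsIn (i := m) (by omega)
    obtain ⟨e1, e2⟩ := ω.mirrorFar_sIn_sOut hm
    rw [e, hk, e1, e2, arcKind_mirrorSide] at hmem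
    have e3 : mirrorKind (arcKind (ω.2.sIn m) (ω.2.sOut m)) = .corner := by simpa using hmem
    have e4 := congrArg mirrorKind e3
    rw [mirrorKind_mirrorKind] at e4
    exact e4
  have hfci := hface hi0 hfi
  have hfcj := hface hj0 hfj
  rw [← hfci]
  exact ω.2.kindsIn_eq_coCorner_coCorner hi0 hj0 hij (hfcj.trans hfci.symm) (hkind hi0 hfi) (hkind hj0 hfj)

/-- ★★★ **THE `K_N2` KILL FOR EVERY WOUND WALK THAT DOES NOT LEAVE THE ROOT PLAQUETTE SOUTHWARDS** (row-mirror twin):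
north-eastern kill geometry (hole, `K_N2 = (w.1 + 1, w.2 + 2)`, `(w.1 + 2, w.2 + 1)` absent, top line uncrossable for
`x ≥ w.1 + 2`), `nth 1 ≠ w.side S` ⇒ NOT `w₂`-free off the far cell (double co-corner in `rootN w` or `rootE w`).
[cite: GlazmanManolescu2019, §1, Fig. 1 and the paragraph of Fig. 2] [cite: Glazman2015WeightedSAW, Lemma 3.1 (proof, pp. 6–7)]
[cite: CourantRobbins1958, Ch. V Appendix §2 (the even–odd rule)] -/
theorem not_W2FreeOff_farW_of_wound_not_south (hh : holeFaceW w ∉ D)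
    (hrow : ∀ x : ℤ, w.1 + 2 ≤ x → (x, w.2) ∉ D ∨ (x, w.2 + 1) ∉ D) (hK : killNE w ∉ D) (hPE : pocketNEE w ∉ D)
    (ω : ΩG D (w.side .W) (farW w)) (hr : RootedFace D (w.side .W) (farW w)) (h : ω.IsB2a)
    (hnotS : ω.2.nth 1 ≠ w.side .S) {θ : ℝ}
    (hW : ω.WE (fun _ => θ) ≠ excursionWinding θ ω.2.firstSideG (ω.z1 hr h) ω.1) : ¬ω.2.W2FreeOff (farW w) := by
  have hr' := rootedFace_rowMirrorDom w hr
  have h' := ω.mirrorFar_isB2a hr h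
  have hh' : holeFaceW w ∉ rowMirrorDom w D := by rwa [mem_rowMirrorDom, mirrorRowFace_holeFaceW]
  have hK' : killSE w ∉ rowMirrorDom w D := by rwa [mem_rowMirrorDom, mirrorRowFace_killSE]
  have hPE' : pocketSEE w ∉ rowMirrorDom w D := by rwa [mem_rowMirrorDom, mirrorRowFace_pocketSEE]
  have hrow' : ∀ x : ℤ, w.1 + 2 ≤ x → (x, w.2) ∉ rowMirrorDom w D ∨ (x, w.2 - 1) ∉ rowMirrorDom w D := by
    intro x hx
    rw [mem_rowMirrorDom, mem_rowMirrorDom, mirrorRowFace_row, mirrorRowFace_row_pred]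
    exact hrow x hx
  have hnotN' : ω.mirrorFar.2.nth 1 ≠ w.side .N := by
    rw [YBWalk.nth_eq_of_mids_mirror ω.mirrorFar_mids]
    intro e
    apply hnotS
    have e' := congrArg (mirrorRow w.2) e
    rw [Literature.Barriers.CriticalPhenomena.PlaquetteWalk.mirrorRow_mirrorRow, mirrorRow_side_N_self_row] at e'
    exact e'
  have hkill := ω.mirrorFar.not_W1FreeOff_farW_of_wound_not_north hh' hrow' hK' hPE' hr' h' hnotN' (ω.mirrorFar_wound hr h hW)
  -- a doubled rhombus of the reflected walk reflects to a doubled rhombus of the walk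
  intro hfree
  apply hkill
  intro g hg hgf hk
  have hk2 := ω.kindsIn_eq_coCorner_of_mirrorFar_corner hk
  have hmem : mirrorRowFace w.2 g ∈ ω.2.facesVisited := by
    by_contra hn'
    rw [YBWalk.kindsIn_eq_nil hn'] at hk2
    exact List.cons_ne_nil _ _ hk2.symm
  have hne : mirrorRowFace w.2 g ≠ farW w := by
    intro e
    apply hgf
    have e' := congrArg (mirrorRowFace w.2) e
    rw [mirrorRowFace_mirrorRowFace, mirrorRowFace_farW] at e'
    exact e'
  exact hfree _ hmem hne hk2

/-- ★★★ The companion file's `hS₁` in the `K_S1` geometry, GIVEN ONLY that no wound under-walk leaves the root plaquette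
northwards with its excursion avoiding the plaquette — stated here with the simpler sufficient condition «no wound
under-walk leaves `w` northwards». [cite: GlazmanManolescu2019, §1, remark after eq. (1)] [cite: CourantRobbins1958, Ch. V Appendix §2 (the even–odd rule)] -/
theorem under_w1_killed_of_killSE_of_not_north (hh : holeFaceW w ∉ D)
    (hrow : ∀ x : ℤ, w.1 + 2 ≤ x → (x, w.2) ∉ D ∨ (x, w.2 - 1) ∉ D) (hK : killSE w ∉ D) (hPE : pocketSEE w ∉ D)
    (hr : RootedFace D (w.side .W) (farW w)) (θ : ℝ)
    (hnn : ∀ (ω : ΩG D (w.side .W) (farW w)) (h : ω.IsB2a), ω.2.firstSideG = .S →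
      ω.WE (fun _ => θ) ≠ excursionWinding θ ω.2.firstSideG (ω.z1 hr h) ω.1 → ω.2.nth 1 ≠ w.side .N) :
    ∀ (ω : ΩG D (w.side .W) (farW w)) (h : ω.IsB2a), ω.2.firstSideG = .S →
      ω.WE (fun _ => θ) ≠ excursionWinding θ ω.2.firstSideG (ω.z1 hr h) ω.1 → ¬ω.2.W1FreeOff (farW w) :=
  fun ω h hS hW => ω.not_W1FreeOff_farW_of_wound_not_north hh hrow hK hPE hr h (hnn ω h hS hW) hW

/-- ★★★ The companion file's `hN₂` in the `K_N2` geometry, given that no wound over-walk leaves `w` southwards.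
[cite: GlazmanManolescu2019, §1 (the paragraph of Fig. 2)] [cite: CourantRobbins1958, Ch. V Appendix §2 (the even–odd rule)] -/
theorem over_w2_killed_of_killNE_of_not_south (hh : holeFaceW w ∉ D)
    (hrow : ∀ x : ℤ, w.1 + 2 ≤ x → (x, w.2) ∉ D ∨ (x, w.2 + 1) ∉ D) (hK : killNE w ∉ D) (hPE : pocketNEE w ∉ D)
    (hr : RootedFace D (w.side .W) (farW w)) (θ : ℝ)
    (hns : ∀ (ω : ΩG D (w.side .W) (farW w)) (h : ω.IsB2a), ω.2.firstSideG = .N →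
      ω.WE (fun _ => θ) ≠ excursionWinding θ ω.2.firstSideG (ω.z1 hr h) ω.1 → ω.2.nth 1 ≠ w.side .S) :
    ∀ (ω : ΩG D (w.side .W) (farW w)) (h : ω.IsB2a), ω.2.firstSideG = .N →
      ω.WE (fun _ => θ) ≠ excursionWinding θ ω.2.firstSideG (ω.z1 hr h) ω.1 → ¬ω.2.W2FreeOff (farW w) :=
  fun ω h hN hW => ω.not_W2FreeOff_farW_of_wound_not_south hh hrow hK hPE hr h (hns ω h hN hW) hW

end ΩG

end Literature.Probability.RandomPlanarGeometry.SAW.YangBaxter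

namespace Literature.Barriers.CriticalPhenomena.PlaquetteWalk

open Literature.Probability.RandomPlanarGeometry.SAW.YangBaxter
open Real Complex

/-- ★★★ **THE EASTERN KILL-FORCED ZERO (routes exchanged), with the universal kills reduced to «no wound over-walk turns
south at the root plaquette, no wound under-walk turns north».** Hole, the two eastern kill cells `(w.1 + 1, w.2 ± 2)`,
the two cells `(w.1 + 2, w.2 ± 1)` absent, the root row's two lines uncrossable for `x ≥ w.1 + 2`, ONE `w₂`-free wound
under-walk and ONE `w₁`-free wound over-walk ⇒ an exact zero of the Yang–Baxter vertex functional in `(π/3, 2π/3)`.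
[cite: GlazmanManolescu2019, Lemma 2.1 (statement, "in the form given in [Gl]")]
[cite: GlazmanManolescu2019, §1 (the paragraph of Fig. 2 and the remark after eq. (1))]
[cite: Glazman2015WeightedSAW, Lemma 3.1 (proof, pp. 6–7)] [cite: DuminilCopinSmirnov2012, proof of Lemma 1]
[cite: CourantRobbins1958, Ch. V Appendix §2 (The Jordan Curve Theorem for Polygons: the even–odd rule)] -/
theorem vertexFunctional_printed_farCellW_exists_eq_zero_Ioo_of_killNE_of_killSE (Dl : List Face) (w : Face)
    (hf : farW w ∈ Dl) (hh : holeFaceW w ∉ dom Dl) (hr : RootedFace (dom Dl) (w.side .W) (farW w))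
    (hKN : killNE w ∉ dom Dl) (hPN : pocketNEE w ∉ dom Dl)
    (hrowN : ∀ x : ℤ, w.1 + 2 ≤ x → (x, w.2) ∉ dom Dl ∨ (x, w.2 + 1) ∉ dom Dl)
    (hKS : killSE w ∉ dom Dl) (hPS : pocketSEE w ∉ dom Dl)
    (hrowS : ∀ x : ℤ, w.1 + 2 ≤ x → (x, w.2) ∉ dom Dl ∨ (x, w.2 - 1) ∉ dom Dl)
    (hnsN : ∀ (ω : ΩG (dom Dl) (w.side .W) (farW w)) (h : ω.IsB2a), ω.2.firstSideG = .N →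
      ω.WE (fun _ => π / 3) ≠ excursionWinding (π / 3) ω.2.firstSideG (ω.z1 hr h) ω.1 → ω.2.nth 1 ≠ w.side .S)
    (hnnS : ∀ (ω : ΩG (dom Dl) (w.side .W) (farW w)) (h : ω.IsB2a), ω.2.firstSideG = .S →
      ω.WE (fun _ => 2 * π / 3) ≠ excursionWinding (2 * π / 3) ω.2.firstSideG (ω.z1 hr h) ω.1 →
        ω.2.nth 1 ≠ w.side .N)
    (hS₂ : ∃ (ω : ΩG (dom Dl) (w.side .W) (farW w)) (h : ω.IsB2a), ω.2.firstSideG = .S ∧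
      ω.WE (fun _ => π / 3) ≠ excursionWinding (π / 3) ω.2.firstSideG (ω.z1 hr h) ω.1 ∧ ω.2.W2FreeOff (farW w))
    (hN₁ : ∃ (ω : ΩG (dom Dl) (w.side .W) (farW w)) (h : ω.IsB2a), ω.2.firstSideG = .N ∧
      ω.WE (fun _ => 2 * π / 3) ≠ excursionWinding (2 * π / 3) ω.2.firstSideG (ω.z1 hr h) ω.1 ∧
        ω.2.W1FreeOff (farW w)) :
    ∃ θ ∈ Set.Ioo (π / 3) (2 * π / 3),
      vertexFunctional (printedWeights θ) tFiveEighths (ybCoeff θ) Dl (w.side .W) (farW w) = 0 :=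
  vertexFunctional_printed_farCellW_exists_eq_zero_Ioo_of_opposite_kills' Dl w hf hh hr
    (ΩG.over_w2_killed_of_killNE_of_not_south hh hrowN hKN hPN hr (π / 3) hnsN) hS₂
    (ΩG.under_w1_killed_of_killSE_of_not_north hh hrowS hKS hPS hr (2 * π / 3) hnnS) hN₁

end Literature.Barriers.CriticalPhenomena.PlaquetteWalk
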